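import Literature.NumberTheory.LFunctions.XiHigherTuranInequalities
import Literature.Analysis.Complex.JensenPolynomialHyperbolicity
import Mathlib.Analysis.SpecialFunctions.Gaussian.GaussianIntegral
import Mathlib.MeasureTheory.Integral.Gamma
import Mathlib.MeasureTheory.Integral.ExpDecay
import Mathlib.MeasureTheory.Integral.IntegralEqImproper
import Mathlib.MeasureTheory.Integral.Prod
import Mathlib.Analysis.SpecialFunctions.Sqrt
import Mathlib.Analysis.SpecialFunctions.Log.Deriv
import Mathlib.Analysis.Calculus.Deriv.MeanValue
import HarnessLib

/-!
# Barrier `JensenPolynomialsLogConcaveKernel`: log-concavity of `K(√t)` certifies the Turán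
# inequalities (row `d = 2` of the Jensen grid) and NOT the higher order Turán inequalities
# (cell `(3,0)`); Dimitrov–Lucas 2011, Theorem 1, is false as stated

Barrier catalogue `Literature/Barriers/RiemannHypothesis/` (D-0021); kernel-side sibling of
`JensenPolynomials.lean` / `JensenPolynomialsProofs.lean` / `JensenPolynomialsCone.lean` (which
neutralise coefficient-side and zero-side Jensen data). By Pólya's criterion
(`Literature.NumberTheory.LFunctions.polya_jensen`) RH is the hyperbolicity of every Jensen polynomial
`J^{d,n}_γ` of `γ = xiTaylorCoeff`, and `γ(m) = 64·4^m·(m!/(2m)!)·∫₀^∞ Φ(t)t^{2m} dt`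
(`xiTaylorCoeff_eq_kernelTaylorSeq`) is the Taylor sequence of the cosine transform of the kernel
`Φ = deBruijnPhi`. The one KERNEL-SIDE input that has ever certified cells of this grid is
Csordas–Norfolk–Varga's **log-concavity of `Φ(√t)`** (Varga 1990, §3.3 Thm. 3; Dimitrov–Lucas'
Theorem B; tree: `Literature.NumberTheory.LFunctions.DeBruijnPhiLogConcaveSqrt`): for every
admissible kernel `K` with `log K(√t)` concave the moments satisfy the Turán inequalities
`ĉ_m² ≥ ((2m−1)/(2m+1)) ĉ_{m−1}ĉ_{m+1}` (Varga 1990 (3.25)–(3.28) = Csordas–Varga 1988; Dimitrov–Lucas'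
Theorem A), i.e. ROW `d = 2` of the Jensen grid is hyperbolic at every shift. Dimitrov–Lucas,
Proc. AMS 139 (2011), **Theorem 1**, asserts that the same input also gives the HIGHER ORDER Turán
inequalities `H̃_k ≥ 0` (hyperbolicity of all cubic `J^{3,k−1}`, their (9)/(5) and Lemma 1).

This file PROVES that the log-concavity class stops at row 2:

* **`JensenPolynomialsLogConcaveKernel`** (proved, `JensenPolynomialsLogConcaveKernel_holds`): there
  is a kernel `K` satisfying every clause of Dimitrov–Lucas' Definition 1 ((i) positive, (ii) entire,
  (iii) even, (iv) `K′ < 0` on `(0,∞)`, (v) `K^{(n)}(t) = O(e^{−|t|³})` for all `n`) and (8)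
  (`(d²/ds²) log K(√s) < 0` for `s > 0`; also `t ↦ −K′(t)/(tK(t))` strictly increasing, the tree's
  shape of log-concavity) with `H̃_1 < 0` and `J^{3,0}` NOT hyperbolic;
* **`not_dimitrovLucas2011_theorem1`**: hence Theorem 1 of Dimitrov–Lucas is false as stated (with
  the full-line moments `∫_{−∞}^{∞} t^{2k}K` of its statement; `H̃` is homogeneous of degree 4).
* **`exists_admissible_dlJ_neg`**, **`not_dimitrovLucas2011_Jpos`**,
  **`not_dimitrovLucas2011_strongerIneq`** (section "Dimitrov–Lucas' `T_k`, `U_k`, `J_k`"): the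
  printed proof fails at its own intermediate inequality "`J_k > 0`" (p. 1021) — for the witness
  `T_1, T_2 > 0` (the positive side) but `J_1 = (H̃_1 − 8T_1T_2)/3 < 0`, and `J_2 < 0` although
  `H̃_2 > 0` — and the closing remark "the logarithmic concavity of `K(√t)` … implies the stronger
  inequalities `H̃_k > 8T_kT_{k+1}`" (p. 1021) is false as stated, being equivalent to `J_k > 0` by
  (12) (`dlHtilde_sub_eight_mul_dlT`: `H̃_k − 8T_kT_{k+1} = (2k+1)J_k`).
* **`ExplicitKernel.dlHtilde_Kb_one_mem`**, **`ExplicitKernel.Kb_admissible`**,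
  **`ExplicitKernel.jensenPolynomialsLogConcaveKernel_of_Kb`** (section "The explicit admissible
  kernel `K_β`"): the same refutation by ONE pinned admissible kernel with a kernel-certified
  enclosure of `H̃_1` (no `ε → 0⁺` limit); and the full grid of the `ε = 0` witness in closed form
  (`LogConcaveKernel.splits_jensenPoly_K_zero_iff_lt_cornerThreshold`, section "The full Jensen grid
  of `K_0`").
* Companion module `Literature.Barriers.RiemannHypothesis.JensenPolynomialsLogConcaveKernelDoubleTuran`
  (2026-08-26; separate only for file size): **`exists_admissible_doubleTuran_neg`**,
  **`not_doubleTuran_of_logConcaveSqrt`** — the class certifies ALL of Csordas' Turán differences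
  `T_k = γ_k² − γ_{k−1}γ_{k+1} > 0` but NOT his first double Turán inequality `E_2 = T_2² − T_1T_3 ≥ 0`
  (RH-necessary, Csordas 2015 §4): witness `e^{−t²−εt⁴}(1 + t²/2 + t⁴/16 + t⁶/96)`,
  `E_2(γ) = −48439·π²/2⁴⁴` at `ε = 0` exactly. The kernel-side route to `E_k ≥ 0` in print uses MORE
  than the class — Csordas–Dimitrov's SECOND-level concavity `(log(s′² − ss″))″ < 0`, `s = K(√t)` (their
  Theorem 2.4, as reported by Csordas 2015 §4; proved for `Φ` by Planat–Solé, arXiv Aug. 2026,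
  Theorem 1.1) — so that extra input is not redundant in the technique class.

The witness is the Gaussian-times-quartic family `K_ε(t) = e^{−t²−εt⁴}(1 + t²/10 + 49t⁴/10⁴)`
(namespace `LogConcaveKernel`). For `ε ≥ 0` the class properties are elementary calculus
(`K_pos`, `K_even`, `deriv_K_neg`, `strictMonoOn_neg_deriv_K_div`, `deriv2_log_K_sqrt_neg` — the
point being `(1/10)² > 2·49/10⁴`; `differentiable_KC`; `iteratedDeriv_K_isBigO` for `ε > 0`). At
`ε = 0` everything is EXACT: `γ_m(K_0) = (√π/2)·4^{−m}·q(m)` with the QUADRATIC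
`q(m) = 1 + (m+½)/10 + 49(m+½)(m+3/2)/10⁴` (`kernelTaylorSeq_K_zero`, from
`∫₀^∞ e^{−t²}t^{2m} = Γ(m+½)/2`), so by geometric rescaling
(`splits_jensenPoly_const_mul_pow_mul_iff`) the Jensen grid of `K_0` is that of `q`: row 2 is
hyperbolic at EVERY shift (`qSeq_turan`, `splits_jensenPoly_K_zero_two`) while the higher order
Turán expression at `k = 1` is the negative rational `−440773179/(2.5·10¹⁵)` (`higherTuran_qSeq`),
so `J^{3,0}` is not hyperbolic (`not_splits_jensenPoly_K_zero_three`, via the tree's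
`higherTuran_nonneg_of_splits` = Dimitrov–Lucas Lemma 1) and `H̃_1(K_0) < 0` (`dlHtilde_K_zero_neg`).
`K_0` fails only clause (v) (its decay is exactly Gaussian); for `ε > 0` the kernel is admissible and
`H̃_1(K_ε) → H̃_1(K_0) < 0` as `ε → 0⁺` by dominated convergence
(`continuousWithinAt_kernelMoment_K`, `exists_pos_dlHtilde_K_neg`). The EXPLICIT admissible member
`K_β(t) = exp(−t² − t⁴/1000)(1 + t²/20 + 17t⁴/8000)` (namespace `ExplicitKernel`, section appended
2026-08-26) is certified in the kernel without any limit: `K_β` satisfies (i)–(v) and (8)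
(`ExplicitKernel.Kb_admissible`, margin `(log K_β(√s))″ ≤ −1/4000`) and
`−1.13732·10⁻⁶·π² < H̃_1(K_β) < −1.13731·10⁻⁶·π²` in full-line moments
(`ExplicitKernel.dlHtilde_Kb_one_fullLine_mem`; `= −1.12249·10⁻⁵`, the number of the referee sheet
DLREF-1; half-line `−7.0155·10⁻⁷`, `ExplicitKernel.dlHtilde_Kb_one_mem`) by a Taylor sandwich of
`e^{−t⁴/1000}`, exact Gaussian moments and rational interval arithmetic.
The WHOLE Jensen grid of `K_0` is decided in closed form (section "The full Jensen grid of `K_0`",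
appended 2026-08-26): since `q` is quadratic, `J^{d,n}_q = (X+1)^{d−2}·Q_{d−2,n}` with ONE quadratic
cofactor (`jensenPoly_qSeq_eq`), so `J^{d,n}(K_0)` is hyperbolic iff
`L(d,n) = (9604n − 749594)d + 9604n² + 215208n + 2065203 ≥ 0` (`splits_jensenPoly_K_zero_iff`), i.e.
iff `n ≥ 79` or `d < d(n)`, `d(n) = ⌊(9604n² + 215208n + 2065203)/(749594 − 9604n)⌋ + 1 =
3, 4, 4, 4, 5, 5, 6, 6, 7, 8, 8, 9, …, 160337` (`splits_jensenPoly_K_zero_iff_lt_cornerThreshold`,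
`cornerThreshold_values`): the non-hyperbolic cells are EXACTLY the staircase
`{(d,n) : n ≤ 78, d ≥ d(n)}` — rh-jensen-idea-1's "corner `d ≥ d(n)`, `d(n) = 3,4,4,4,5,…`", which
has finite height (rows `n ≥ 79` are entirely hyperbolic, `splits_jensenPoly_K_zero_of_le`).

The GAP in the printed proof of Theorem 1 (p. 1020, last display): with `A(y,z) = (z²−y²)B(y,z)`
(p. 1021) the function `z ↦ A_{1,0}(y,z)/A(y,z)` has a pole at `z = y`, so the Mean Value Theorem
cannot be applied across the diagonal; `D_{0,1}(A_{1,0}/A) > 0` holds on each side separately.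

The POSITIVE side (row 2 for the whole class) is the named fact `CsordasVarga1988_momentTuran`
(Varga 1990 (3.25)–(3.28)), DISCHARGED in the last section (`CsordasVarga1988_momentTuran_holds`) by
Matiyasevich's double integral (3.6): `F = K′/(tK)` is strictly decreasing
(`MomentTuran.strictAntiOn_F`), `K′ < 0` eventually (integrability), integration by parts on
`(0,∞)` (`MomentTuran.integral_pow_mul_deriv`), and
`∬ u^{2m+2}v^{2m+2}K(u)K(v)(v²−u²)(F(u)−F(v)) = 2(2m+3)ĉ_{m+1}² − 2(2m+1)ĉ_mĉ_{m+2} > 0`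
(`MomentTuran.momentTuran`); with the algebra "moment Turán ⟹ `J^{2,n}` hyperbolic"
(`splits_jensenPoly_two_of_momentTuran`) this gives ROW 2 FOR THE WHOLE CLASS as a theorem
(`splits_jensenPoly_two_of_logConcaveSqrt`). The barrier theorem itself uses no named fact.

What is NOT here: Dimitrov–Lucas' Corollary 1 (row 3 for `Ξ`) is TRUE and is a theorem of the tree by
zero-side means (`Literature.NumberTheory.LFunctions.xiTaylorCoeff_higherTuran_nonneg`, from
`jensenPoly_xiTaylorCoeff_splits_of_le`, Chasse/Kim–Lee); nothing in this file bears on it, nor on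
RH. (The failure of the bonus claim `H̃_k > 8T_kT_{k+1}`, p. 1021, is:
`not_dimitrovLucas2011_strongerIneq`, section appended 2026-08-26; the full grid of `K_0`:
`splits_jensenPoly_K_zero_iff_lt_cornerThreshold`, section appended 2026-08-26. For the admissible
members `ε > 0` only finitely many cells are transported by continuity; the grid of `K_ε` itself is
not computed here.)

## References

* [DimitrovLucas2011] D. K. Dimitrov, F. R. Lucas, *Higher order Turán inequalities for the Riemann
  ξ-function*, Proc. AMS 139 (2011) 1013–1022: Definition 1 and (9) (p. 1016), Theorem 1 and
  Corollary 1 (p. 1017), Lemma 1 (p. 1015), proof pp. 1018–1021 (read in full).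
* [Varga1990] R. S. Varga, *Scientific Computation on Mathematical Problems and Conjectures*, SIAM
  1990, §3.3: Theorem 3, (3.6)–(3.8), Theorem 4, (3.25)–(3.28) (read, pp. 40–48).
* [CsordasVarga1988] G. Csordas, R. S. Varga, *Moment inequalities and the Riemann hypothesis*,
  Constr. Approx. 4 (1988) 175–198 (cited through Varga1990 §3.3).
* [CsordasNorfolkVarga1986] G. Csordas, T. S. Norfolk, R. S. Varga, Trans. AMS 296 (1986) 521–541.
* [CoffeyCsordas2013] M. W. Coffey, G. Csordas, Math. Comp. 82 (2013), §3, Problem 3.3.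
* [GORZPNAS2019] M. Griffin, K. Ono, L. Rolen, D. Zagier, PNAS 116 (2019), eq. (1), Thms. 1–2.
* [Csordas2015] G. Csordas, Comput. Methods Funct. Theory 15 (2015) 373–391 (arXiv:1309.0055, read):
  §4, (4.4)–(4.5), the paragraph before Open Problem 4.14 ("[14, Theorem 2.4]"), Open Problem 4.14.
* [CsordasDimitrov2000] G. Csordas, D. K. Dimitrov, Numer. Algorithms 25 (2000) 109–122: Theorem 2.4,
  Problem 3.3 — NOT held (acq-11869), cited through Csordas2015 §4; proof not examined here.
* [PlanatSole2026] M. Planat, P. Solé, *Second-Level Concavity of the Riemann Ξ Kernel*,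
  arXiv:2608.19160 (19 Aug 2026, read): Theorem 1.1, §7.
* Origin: rh-jensen-idea-1 g2, `TRANSFER-LENS-2.md` §4.2–4.3 and `LaguerreFlowSketch.lean`
  (cell `(3,0)` of `q`), 2026-08-26; numerics re-derived by the typing seat.
-/

noncomputable section

open Polynomial Real Set MeasureTheory Filter
open scoped Nat Topology

namespace Literature.Barriers.RiemannHypothesis

open Literature.NumberTheory.LFunctions Literature.Analysis.Complex.PolyaSchur

/-! ## Moments and the Taylor sequence of the cosine transform of a kernel -/

/-- The (half-line) even moments `b_m(K) = ∫₀^∞ t^{2m} K(t) dt` of a kernel `K`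
(Dimitrov–Lucas p. 1015 `b_m`; Varga (3.26) `ĉ_m`; for `K = Φ` these are the `b̂_m` of
Csordas–Norfolk–Varga, `= Literature.NumberTheory.LFunctions.xiMoment (2m)`).
[cite: DimitrovLucas2011, p. 1015] -/
def kernelMoment (K : ℝ → ℝ) (m : ℕ) : ℝ := ∫ t in Ioi (0 : ℝ), K t * t ^ (2 * m)

/-- The Taylor sequence `γ_m(K) = m! b_m(K)/(2m)!` of `F₁(x) = Σ γ_m x^m/m!`, where
`F(z) = ∫₀^∞ K(t) cos(zt) dt = Σ (-1)^m b_m z^{2m}/(2m)!` and `F₁(-z²) = F(z)` (Dimitrov–Lucas p. 1015;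
for `K = Φ`, `γ = xiTaylorCoeff = 64·4^m·γ_m(Φ)`, `xiTaylorCoeff_eq_kernelTaylorSeq`). The Jensen
polynomials `J^{d,n}` of this sequence are the `g_{d,n}` of Dimitrov–Lucas (4).
[cite: DimitrovLucas2011, p. 1015 and (4)] -/
def kernelTaylorSeq (K : ℝ → ℝ) (m : ℕ) : ℝ := (m ! : ℝ) / ((2 * m)! : ℝ) * kernelMoment K m

/-- Dimitrov–Lucas (9): the higher order Turán expression in MOMENT form,
`H̃_k(b) = 4(2k+3)[(2k+1)b_k² − (2k−1)b_{k−1}b_{k+1}][(2k+3)b_{k+1}² − (2k+1)b_kb_{k+2}]`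
`− (2k+1)[(2k+3)b_kb_{k+1} − (2k−1)b_{k−1}b_{k+2}]²`, related to (5) by `H_k = d_kH̃_k`,
`d_k = [k!]²[(k+1)!]²/((2k)!(2k+1)![(2k+3)!]²) > 0`. As in the source, `k ∈ ℕ = {1, 2, …}`: the
index `k − 1` is `ℕ`-subtraction and only `k ≥ 1` is meaningful (`higherTuran_one_eq_dlHtilde` is the
case `k = 1`). Homogeneous of degree `4` in `b` (`dlHtilde_const_mul`), so its SIGN is the same for
the half-line moments `∫₀^∞` used here and the full-line moments `∫_{-∞}^{∞} = 2∫₀^∞` of Theorem 1.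
[cite: DimitrovLucas2011, (9)] -/
def dlHtilde (b : ℕ → ℝ) (k : ℕ) : ℝ :=
  4 * (2 * (k : ℝ) + 3) * (((2 * (k : ℝ) + 1) * b k ^ 2 - (2 * (k : ℝ) - 1) * b (k - 1) * b (k + 1)) *
      ((2 * (k : ℝ) + 3) * b (k + 1) ^ 2 - (2 * (k : ℝ) + 1) * b k * b (k + 2))) -
    (2 * (k : ℝ) + 1) * ((2 * (k : ℝ) + 3) * b k * b (k + 1) - (2 * (k : ℝ) - 1) * b (k - 1) * b (k + 2)) ^ 2

/-- `H̃_k` of (9) is homogeneous of degree `4` in the moment sequence. [cite: DimitrovLucas2011, (9)] -/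
theorem dlHtilde_const_mul (c : ℝ) (b : ℕ → ℝ) (k : ℕ) :
    dlHtilde (fun m => c * b m) k = c ^ 4 * dlHtilde b k := by
  simp only [dlHtilde]; ring

/-- `b ↦ H̃_1(b)` is continuous (a polynomial in `b₀, …, b₃`). [folklore] -/
private theorem continuous_dlHtilde_one : Continuous fun b : ℕ → ℝ => dlHtilde b 1 := by
  unfold dlHtilde
  fun_prop

/-- Dimitrov–Lucas' normalisation at `k = 1`: with `γ_m = m! b_m/(2m)!`,
`H_1(γ) = 4(γ₁² − γ₀γ₂)(γ₂² − γ₁γ₃) − (γ₁γ₂ − γ₀γ₃)² = H̃_1(b)/43200` (`d_1 = 1/43200`).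
[cite: DimitrovLucas2011, (5) and (9)] -/
theorem higherTuran_one_eq_dlHtilde (K : ℝ → ℝ) :
    4 * (kernelTaylorSeq K 1 ^ 2 - kernelTaylorSeq K 0 * kernelTaylorSeq K 2) *
        (kernelTaylorSeq K 2 ^ 2 - kernelTaylorSeq K 1 * kernelTaylorSeq K 3) -
      (kernelTaylorSeq K 1 * kernelTaylorSeq K 2 - kernelTaylorSeq K 0 * kernelTaylorSeq K 3) ^ 2 =
    dlHtilde (kernelMoment K) 1 / 43200 := by
  simp only [kernelTaylorSeq, dlHtilde]
  norm_num [Nat.factorial]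
  ring

/-- If `γ₃(K) ≠ 0` and `H̃_1(K) < 0`, then `J^{3,0}` of the Taylor sequence of `K` is not hyperbolic
(Dimitrov–Lucas Lemma 1, "only if"). [cite: DimitrovLucas2011, Lemma 1] -/
theorem not_splits_jensenPoly_three_of_dlHtilde_neg {K : ℝ → ℝ} (h3 : kernelTaylorSeq K 3 ≠ 0)
    (hH : dlHtilde (kernelMoment K) 1 < 0) : ¬ (jensenPoly (kernelTaylorSeq K) 3 0).Splits := by
  intro hs
  rw [jensenPoly_three_eq_toPoly] at hs
  have h := higherTuran_nonneg_of_splits (a₀ := kernelTaylorSeq K 0) h3 hs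
  rw [zero_add, higherTuran_one_eq_dlHtilde] at h
  linarith

/-- `γ = xiTaylorCoeff` is `64·4^m` times the Taylor sequence of the kernel `Φ = deBruijnPhi`.
[cite: GORZPNAS2019, eq. (1)] -/
theorem xiTaylorCoeff_eq_kernelTaylorSeq (m : ℕ) :
    xiTaylorCoeff m = 64 * 4 ^ m * kernelTaylorSeq deBruijnPhi m := by
  rw [xiTaylorCoeff_eq_xiMoment, kernelTaylorSeq, kernelMoment, xiMoment]
  ring

/-! ## Geometric rescaling of a sequence does not change hyperbolicity of its Jensen polynomials -/

/-- `J^{d,n}` of the sequence `k ↦ r^k γ(k)` is `r^n · J^{d,n}_γ(rX)` (the Jensen polynomials (4) of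
`ψ(rx)` in terms of those of `ψ`). [cite: DimitrovLucas2011, (4)] -/
theorem jensenPoly_pow_mul (r : ℝ) (γ : ℕ → ℝ) (d n : ℕ) :
    jensenPoly (fun k => r ^ k * γ k) d n = C (r ^ n) * (jensenPoly γ d n).comp (C r * X) := by
  ext j
  rw [coeff_C_mul, comp_C_mul_X_coeff, coeff_jensenPoly, coeff_jensenPoly]
  split_ifs <;> ring

/-- Hyperbolicity of `J^{d,n}` is invariant under `γ(k) ↦ c r^k γ(k)` with `c, r ≠ 0` (`ψ(x) ↦ cψ(rx)`).
[cite: DimitrovLucas2011, (4)] -/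
theorem splits_jensenPoly_const_mul_pow_mul_iff {c r : ℝ} (hc : c ≠ 0) (hr : r ≠ 0) (γ : ℕ → ℝ)
    (d n : ℕ) :
    (jensenPoly (fun k => c * r ^ k * γ k) d n).Splits ↔ (jensenPoly γ d n).Splits := by
  have key : ∀ (c r : ℝ) (γ : ℕ → ℝ), (jensenPoly γ d n).Splits →
      (jensenPoly (fun k => c * r ^ k * γ k) d n).Splits := by
    intro c r γ h
    have h1 : jensenPoly (fun k => c * r ^ k * γ k) d n =
        C c * (C (r ^ n) * (jensenPoly γ d n).comp (C r * X)) := by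
      rw [← jensenPoly_pow_mul, ← jensenPoly_const_mul]
      simp only [mul_assoc]
    rw [h1]
    refine ((h.comp_of_natDegree_le_one ?_).C_mul _).C_mul _
    exact (natDegree_C_mul_le _ _).trans natDegree_X_le
  refine ⟨fun h => ?_, key c r γ⟩
  have h2 := key c⁻¹ r⁻¹ (fun k => c * r ^ k * γ k) h
  have h3 : (fun k => c⁻¹ * r⁻¹ ^ k * (c * r ^ k * γ k)) = γ := by
    funext k
    rw [inv_pow]
    field_simp
  rwa [h3] at h2

/-! ## Quadratic Jensen polynomials: Turán's inequality gives hyperbolicity -/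

/-- `J^{2,n}_γ = γ(n) + 2γ(n+1)X + γ(n+2)X²`. [cite: DimitrovLucas2011, (4)] -/
theorem jensenPoly_two_eq (γ : ℕ → ℝ) (n : ℕ) :
    jensenPoly γ 2 n = C (γ n) + C (2 * γ (n + 1)) * X + C (γ (n + 2)) * X ^ 2 := by
  simp only [jensenPoly, Finset.sum_range_succ, Finset.sum_range_zero, zero_add, add_zero, pow_zero,
    mul_one, pow_one]
  norm_num [Nat.choose]

/-- If `γ(n+2) ≠ 0` and Turán's inequality `γ(n+1)² ≥ γ(n)γ(n+2)` holds, then `J^{2,n}_γ` is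
hyperbolic (the discriminant `4(γ(n+1)² − γ(n)γ(n+2))` is nonnegative; "these are in fact necessary
and sufficient conditions for the second degree generalized Jensen polynomials to be hyperbolic").
[cite: DimitrovLucas2011, Abstract and p. 1015] -/
theorem splits_jensenPoly_two_of_turan {γ : ℕ → ℝ} {n : ℕ} (h2 : γ (n + 2) ≠ 0)
    (hT : γ n * γ (n + 2) ≤ γ (n + 1) ^ 2) : (jensenPoly γ 2 n).Splits := by
  set c := γ (n + 2) with hc
  set D := γ (n + 1) ^ 2 - γ n * γ (n + 2) with hD
  have hD0 : 0 ≤ D := by rw [hD]; linarith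
  set s := Real.sqrt D with hs
  have hs2 : s ^ 2 = D := Real.sq_sqrt hD0
  set r₁ := (-γ (n + 1) + s) / c
  set r₂ := (-γ (n + 1) - s) / c
  have hsum : c * (r₁ + r₂) = -(2 * γ (n + 1)) := by
    simp only [r₁, r₂]; field_simp; ring
  have hprod : c * (r₁ * r₂) * c = γ n * c := by
    simp only [r₁, r₂]
    field_simp
    nlinarith [hs2]
  have hprod' : c * (r₁ * r₂) = γ n := mul_right_cancel₀ h2 hprod
  have key : jensenPoly γ 2 n = C c * ((X - C r₁) * (X - C r₂)) := by
    rw [jensenPoly_two_eq]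
    have e : C c * ((X - C r₁) * (X - C r₂)) =
        C (c * (r₁ * r₂)) + C (-(c * (r₁ + r₂))) * X + C c * X ^ 2 := by
      simp only [C_mul, C_neg, C_add]
      ring
    rw [e, hprod', hsum, neg_neg]
  rw [key]
  exact ((Splits.X_sub_C r₁).mul (Splits.X_sub_C r₂)).C_mul c

/-! ## The witness family `K_ε(t) = exp(-t² - εt⁴)(1 + t²/10 + 49t⁴/10⁴)` -/

namespace LogConcaveKernel

/-- The polynomial factor `P(s) = 1 + s/10 + 49 s²/10⁴` (in the variable `s = t²`). [folklore] -/
def P (s : ℝ) : ℝ := 1 + s / 10 + 49 / 10000 * s ^ 2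

/-- `P′(s) = 1/10 + 98 s/10⁴`. [folklore] -/
def P' (s : ℝ) : ℝ := 1 / 10 + 98 / 10000 * s

/-- The witness kernels `K_ε(t) = exp(-t² - ε t⁴) · (1 + t²/10 + 49 t⁴/10⁴)` (`ε ≥ 0`): even, positive,
entire, strictly decreasing on `(0,∞)`, with `log K_ε(√s) = -s - εs² + log P(s)` strictly concave on
`(0,∞)`; `K_0` has exactly Gaussian decay and a cosine transform `e^{-z²/4}·R(z²)` with four non-real
zeros, `K_ε` (`ε > 0`) is an admissible kernel in the sense of Dimitrov–Lucas, Definition 1.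
[cite: DimitrovLucas2011, Definition 1] -/
def K (ε : ℝ) (t : ℝ) : ℝ := Real.exp (-t ^ 2 - ε * t ^ 4) * P (t ^ 2)

/-- `P(s) > 0` for every real `s` (negative discriminant). [folklore] -/
private theorem P_pos (s : ℝ) : 0 < P s := by
  rw [P]; nlinarith [sq_nonneg (s + 10)]

/-- `P` has derivative `P′`. [folklore] -/
private theorem hasDerivAt_P (s : ℝ) : HasDerivAt P (P' s) s := by
  have h := (((hasDerivAt_id' s).div_const (10 : ℝ)).const_add (1 : ℝ)).fun_add
    ((hasDerivAt_pow 2 s).const_mul (49 / 10000 : ℝ))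
  refine h.congr_deriv ?_
  simp [P']
  ring

/-- `P′` has derivative `P″ = 98/10⁴`. [folklore] -/
private theorem hasDerivAt_P' (s : ℝ) : HasDerivAt P' (98 / 10000 : ℝ) s := by
  have h := ((hasDerivAt_id' s).const_mul (98 / 10000 : ℝ)).const_add (1 / 10 : ℝ)
  refine h.congr_deriv ?_
  simp

/-- `K_ε > 0` (Dimitrov–Lucas (i)). [cite: DimitrovLucas2011, Definition 1 (i)] -/
theorem K_pos (ε t : ℝ) : 0 < K ε t := mul_pos (Real.exp_pos _) (P_pos _)

/-- `K_ε` is even (Dimitrov–Lucas (iii)). [cite: DimitrovLucas2011, Definition 1 (iii)] -/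
theorem K_even (ε t : ℝ) : K ε (-t) = K ε t := by
  simp only [K, even_two.neg_pow, show (-t) ^ 4 = t ^ 4 by ring]

/-- `K_ε(0) = 1`. [folklore] -/
private theorem K_zero_right (ε : ℝ) : K ε 0 = 1 := by simp [K, P]

/-- The derivative `K_ε′(t) = -2t·e^{-t²-εt⁴}·[(1 + 2εt²)P(t²) − P′(t²)]`. [folklore] -/
def dK (ε t : ℝ) : ℝ :=
  -(2 * t * Real.exp (-t ^ 2 - ε * t ^ 4) * ((1 + 2 * ε * t ^ 2) * P (t ^ 2) - P' (t ^ 2)))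

/-- The exponent `-t² - εt⁴` has derivative `-2t - 4εt³`. [folklore] -/
private theorem hasDerivAt_exponent (ε t : ℝ) :
    HasDerivAt (fun t : ℝ => -t ^ 2 - ε * t ^ 4) (-(2 * t) - ε * (4 * t ^ 3)) t := by
  have h := ((hasDerivAt_pow 2 t).fun_neg).fun_sub ((hasDerivAt_pow 4 t).const_mul ε)
  refine h.congr_deriv ?_
  simp

/-- `K_ε` has derivative `dK ε`. [folklore] -/
private theorem hasDerivAt_K (ε t : ℝ) : HasDerivAt (K ε) (dK ε t) t := by
  have h2 : HasDerivAt (fun t : ℝ => P (t ^ 2)) (P' (t ^ 2) * (2 * t)) t := by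
    have h := (hasDerivAt_P (t ^ 2)).comp t (hasDerivAt_pow 2 t)
    refine h.congr_deriv ?_
    simp
  have h := ((hasDerivAt_exponent ε t).exp).fun_mul h2
  refine h.congr_deriv ?_
  rw [dK]
  ring

/-- `deriv K_ε = dK ε`. [folklore] -/
private theorem deriv_K (ε : ℝ) : deriv (K ε) = dK ε := funext fun t => (hasDerivAt_K ε t).deriv

/-- `K_ε` is differentiable. [folklore] -/
private theorem differentiable_K (ε : ℝ) : Differentiable ℝ (K ε) := fun t => (hasDerivAt_K ε t).differentiableAt

/-- `K_ε` is continuous. [folklore] -/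
private theorem continuous_K (ε : ℝ) : Continuous (K ε) := (differentiable_K ε).continuous

/-- The bracket `(1 + 2εs)P(s) − P′(s) ≥ 9/10` for `ε, s ≥ 0`. [folklore] -/
private theorem bracket_pos {ε s : ℝ} (hε : 0 ≤ ε) (hs : 0 ≤ s) :
    9 / 10 ≤ (1 + 2 * ε * s) * P s - P' s := by
  have hP : 0 ≤ P s := (P_pos s).le
  have h1 : 0 ≤ 2 * ε * s * P s := by positivity
  rw [P, P'] at *
  nlinarith

/-- `K_ε′(t) < 0` for `t > 0`, `ε ≥ 0` (Dimitrov–Lucas (iv)). [cite: DimitrovLucas2011, Definition 1 (iv)] -/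
theorem deriv_K_neg {ε : ℝ} (hε : 0 ≤ ε) {t : ℝ} (ht : 0 < t) : deriv (K ε) t < 0 := by
  rw [deriv_K, dK, neg_lt_zero]
  have hb := bracket_pos hε (sq_nonneg t)
  have : 0 < (1 + 2 * ε * t ^ 2) * P (t ^ 2) - P' (t ^ 2) := by linarith
  positivity

/-- `K_ε` is strictly decreasing on `[0, ∞)` (`ε ≥ 0`; Dimitrov–Lucas (iv)). [cite: DimitrovLucas2011, Definition 1 (iv)] -/
theorem strictAntiOn_K {ε : ℝ} (hε : 0 ≤ ε) : StrictAntiOn (K ε) (Ici 0) :=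
  strictAntiOn_of_deriv_neg (convex_Ici 0) (continuous_K ε).continuousOn fun t ht => by
    rw [interior_Ici] at ht
    exact deriv_K_neg hε ht

/-- The logarithmic derivative in the shape of the tree's `DeBruijnPhiLogConcaveSqrt`: for `t > 0`,
`-K_ε′(t)/(t K_ε(t)) = 2(1 + 2εt²) − 2P′(t²)/P(t²)`. [folklore] -/
private theorem neg_deriv_K_div (ε : ℝ) {t : ℝ} (ht : 0 < t) :
    -deriv (K ε) t / (t * K ε t) = 2 * (1 + 2 * ε * t ^ 2) - 2 * P' (t ^ 2) / P (t ^ 2) := by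
  rw [deriv_K, dK, K]
  have hP := (P_pos (t ^ 2)).ne'
  have hE := (Real.exp_pos (-t ^ 2 - ε * t ^ 4)).ne'
  have ht' := ht.ne'
  field_simp

/-- `s ↦ P′(s)/P(s)` is strictly decreasing on `[0, ∞)`: for `0 ≤ a < b`,
`P′(a)P(b) − P′(b)P(a) = (b − a)·[1/5000 + 49(a+b)/10⁵ + 2·(98/10⁴)(49/10⁴)ab] > 0`. [folklore] -/
private theorem P'_div_P_strictAnti {a b : ℝ} (ha : 0 ≤ a) (hab : a < b) : P' b / P b < P' a / P a := by
  rw [div_lt_div_iff₀ (P_pos b) (P_pos a), P', P', P, P]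
  have hb : 0 < b := lt_of_le_of_lt ha hab
  have key : (1 / 10 + 98 / 10000 * a) * (1 + b / 10 + 49 / 10000 * b ^ 2) -
      (1 / 10 + 98 / 10000 * b) * (1 + a / 10 + 49 / 10000 * a ^ 2) =
      (b - a) * (1 / 5000 + 49 / 100000 * (a + b) + 2 * (49 / 10000) ^ 2 * a * b) := by
    ring
  have hpos : 0 < (b - a) * (1 / 5000 + 49 / 100000 * (a + b) + 2 * (49 / 10000) ^ 2 * a * b) := by
    have : 0 < b - a := sub_pos.2 hab
    positivity
  linarith

/-- **Log-concavity of `K_ε(√t)`, tree shape**: `t ↦ -K_ε′(t)/(tK_ε(t))` is strictly increasing on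
`(0, ∞)` for `ε ≥ 0` (compare `Literature.NumberTheory.LFunctions.DeBruijnPhiLogConcaveSqrt`, the
non-strict statement for `Φ`; Dimitrov–Lucas: (8) "is equivalent to `(d/dt)(K′(t)/(tK(t))) < 0`").
[cite: DimitrovLucas2011, (8) and the remark after Theorem B] -/
theorem strictMonoOn_neg_deriv_K_div {ε : ℝ} (hε : 0 ≤ ε) :
    StrictMonoOn (fun t : ℝ => -deriv (K ε) t / (t * K ε t)) (Ioi 0) := by
  intro a ha b hb hab
  have ha' : 0 < a := ha
  have hb' : 0 < b := hb
  show -deriv (K ε) a / (a * K ε a) < -deriv (K ε) b / (b * K ε b)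
  rw [neg_deriv_K_div ε ha', neg_deriv_K_div ε hb']
  have h1 : P' (b ^ 2) / P (b ^ 2) < P' (a ^ 2) / P (a ^ 2) :=
    P'_div_P_strictAnti (sq_nonneg a) (by nlinarith)
  have h1' : 2 * P' (b ^ 2) / P (b ^ 2) < 2 * P' (a ^ 2) / P (a ^ 2) := by
    rw [mul_div_assoc, mul_div_assoc]; linarith
  have h2 : ε * a ^ 2 ≤ ε * b ^ 2 := mul_le_mul_of_nonneg_left (by nlinarith) hε
  linarith

/-- `log K_ε(√s) = -s - εs² + log P(s)` for `s ≥ 0` (the function whose concavity is (8)). [cite: DimitrovLucas2011, (8)] -/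
theorem log_K_sqrt {ε s : ℝ} (hs : 0 ≤ s) :
    Real.log (K ε (Real.sqrt s)) = -s - ε * s ^ 2 + Real.log (P s) := by
  have h4 : Real.sqrt s ^ 4 = s ^ 2 := by
    rw [show (4 : ℕ) = 2 * 2 from rfl, pow_mul, Real.sq_sqrt hs]
  rw [K, Real.log_mul (Real.exp_pos _).ne' (P_pos _).ne', Real.log_exp, Real.sq_sqrt hs, h4]

/-- The smooth model `g_ε(s) = -s - εs² + log P(s)` of `log K_ε(√s)`: first derivative. [folklore] -/
private theorem hasDerivAt_logModel (ε s : ℝ) :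
    HasDerivAt (fun s : ℝ => -s - ε * s ^ 2 + Real.log (P s)) (-1 - ε * (2 * s) + P' s / P s) s := by
  have h1 : HasDerivAt (fun s : ℝ => -s - ε * s ^ 2) (-1 - ε * (2 * s)) s := by
    have h := ((hasDerivAt_id' s).fun_neg).fun_sub ((hasDerivAt_pow 2 s).const_mul ε)
    refine h.congr_deriv ?_
    simp
  exact h1.fun_add ((hasDerivAt_P s).log (P_pos s).ne')

/-- Second derivative of the model: `g_ε″(s) = -2ε + (P″P − P′²)/P²`, `P″ = 98/10⁴`. [folklore] -/
private theorem hasDerivAt_logModel_deriv (ε s : ℝ) :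
    HasDerivAt (fun s : ℝ => -1 - ε * (2 * s) + P' s / P s)
      (-(ε * 2) + (98 / 10000 * P s - P' s * P' s) / P s ^ 2) s := by
  have h1 : HasDerivAt (fun s : ℝ => -1 - ε * (2 * s)) (-(ε * 2)) s := by
    have h := (((hasDerivAt_id' s).const_mul (2 : ℝ)).const_mul ε).const_sub (-1 : ℝ)
    refine h.congr_deriv ?_
    simp
  exact h1.fun_add ((hasDerivAt_P' s).fun_div (hasDerivAt_P s) (P_pos s).ne')

/-- **(8) / (3.28) literally**: `(d²/ds²) log K_ε(√s) < 0` for every `s > 0` and `ε ≥ 0`; indeed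
`= -2ε - [1/5000 + 49 s/50000 + 4802 s²/10⁸]/P(s)²`. [cite: DimitrovLucas2011, (8)] -/
theorem deriv2_log_K_sqrt_neg {ε : ℝ} (hε : 0 ≤ ε) {s : ℝ} (hs : 0 < s) :
    deriv^[2] (fun s : ℝ => Real.log (K ε (Real.sqrt s))) s < 0 := by
  have hloc : (fun s : ℝ => Real.log (K ε (Real.sqrt s))) =ᶠ[𝓝 s]
      fun s : ℝ => -s - ε * s ^ 2 + Real.log (P s) := by
    filter_upwards [Ioi_mem_nhds hs] with x hx using log_K_sqrt hx.le
  have hd1 : deriv (fun s : ℝ => Real.log (K ε (Real.sqrt s))) =ᶠ[𝓝 s]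
      fun s : ℝ => -1 - ε * (2 * s) + P' s / P s := by
    refine hloc.eventually_nhds.mono fun x hx => ?_
    have hx' : (fun s : ℝ => Real.log (K ε (Real.sqrt s))) =ᶠ[𝓝 x]
        fun s : ℝ => -s - ε * s ^ 2 + Real.log (P s) := hx
    rw [hx'.deriv_eq]
    exact (hasDerivAt_logModel ε x).deriv
  show deriv (deriv fun s : ℝ => Real.log (K ε (Real.sqrt s))) s < 0
  rw [hd1.deriv_eq, (hasDerivAt_logModel_deriv ε s).deriv]
  have hP := P_pos s
  have hnum : 98 / 10000 * P s - P' s * P' s < 0 := by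
    rw [P, P']; nlinarith
  have : (98 / 10000 * P s - P' s * P' s) / P s ^ 2 < 0 := div_neg_of_neg_of_pos hnum (by positivity)
  nlinarith

/-- Gaussian decay: `K_ε(t) ≤ 2 e^{-t²/2}` (`ε ≥ 0`), since `P(s) ≤ 2e^{s/2}` — so `K_0` misses clause (v)
(`exp(−|t|^{2+ε})`) exactly by the `ε`. [cite: DimitrovLucas2011, Definition 1 (v)] -/
theorem K_le_gaussian {ε : ℝ} (hε : 0 ≤ ε) (t : ℝ) : K ε t ≤ 2 * Real.exp (-t ^ 2 / 2) := by
  rw [K]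
  have hP : P (t ^ 2) ≤ 2 * Real.exp (t ^ 2 / 2) := by
    have h2 : 1 + t ^ 2 / 2 + (t ^ 2 / 2) ^ 2 / 2 ≤ Real.exp (t ^ 2 / 2) :=
      Real.quadratic_le_exp_of_nonneg (by positivity)
    rw [P]; nlinarith [sq_nonneg t]
  have hE : Real.exp (-t ^ 2 - ε * t ^ 4) ≤ Real.exp (-t ^ 2) :=
    Real.exp_le_exp.2 (by nlinarith [mul_nonneg hε (show (0:ℝ) ≤ t ^ 4 by positivity)])
  calc Real.exp (-t ^ 2 - ε * t ^ 4) * P (t ^ 2)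
      ≤ Real.exp (-t ^ 2) * (2 * Real.exp (t ^ 2 / 2)) :=
        mul_le_mul hE hP (P_pos _).le (Real.exp_pos _).le
    _ = 2 * Real.exp (-t ^ 2 / 2) := by
        have : Real.exp (-t ^ 2) * Real.exp (t ^ 2 / 2) = Real.exp (-t ^ 2 / 2) := by
          rw [← Real.exp_add]; ring_nf
        rw [← this]; ring

/-! ### Exact moments of `K_0 = e^{-t²}P(t²)` -/

/-- Gaussian moments: `∫₀^∞ e^{-t²} t^{2m} dt = Γ(m + ½)/2`. [folklore] -/
private theorem integral_exp_neg_sq_mul_pow (m : ℕ) :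
    ∫ t in Ioi (0 : ℝ), Real.exp (-t ^ 2) * t ^ (2 * m) = Real.Gamma (m + 1 / 2) / 2 := by
  have h := integral_rpow_mul_exp_neg_rpow (p := 2) (q := ((2 * m : ℕ) : ℝ)) two_pos
    (by have : (0 : ℝ) ≤ ((2 * m : ℕ) : ℝ) := Nat.cast_nonneg _; linarith)
  have e : (fun x : ℝ => x ^ ((2 * m : ℕ) : ℝ) * Real.exp (-x ^ (2 : ℝ))) =
      fun x : ℝ => Real.exp (-x ^ 2) * x ^ (2 * m) := by
    funext x
    rw [Real.rpow_natCast, Real.rpow_two, mul_comm]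
  rw [e] at h
  rw [h]
  have e2 : (((2 * m : ℕ) : ℝ) + 1) / 2 = (m : ℝ) + 1 / 2 := by push_cast; ring
  rw [e2]
  ring

/-- Integrability of the Gaussian moments on `(0, ∞)`. [folklore] -/
private theorem integrableOn_exp_neg_sq_mul_pow (m : ℕ) :
    IntegrableOn (fun t : ℝ => Real.exp (-t ^ 2) * t ^ (2 * m)) (Ioi 0) := by
  have h := integrableOn_rpow_mul_exp_neg_rpow (s := ((2 * m : ℕ) : ℝ)) (p := 2)
    (by have : (0 : ℝ) ≤ ((2 * m : ℕ) : ℝ) := Nat.cast_nonneg _; linarith) (by norm_num)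
  have e : (fun x : ℝ => x ^ ((2 * m : ℕ) : ℝ) * Real.exp (-x ^ (2 : ℝ))) =
      fun x : ℝ => Real.exp (-x ^ 2) * x ^ (2 * m) := by
    funext x
    rw [Real.rpow_natCast, Real.rpow_two, mul_comm]
  rwa [e] at h

/-- The pointwise expansion `K_0(t) t^{2m} = e^{-t²}t^{2m} + e^{-t²}t^{2m+2}/10 + 49 e^{-t²}t^{2m+4}/10⁴`.
[folklore] -/
private theorem K_zero_mul_pow (m : ℕ) (t : ℝ) :
    K 0 t * t ^ (2 * m) = Real.exp (-t ^ 2) * t ^ (2 * m) +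
      (1 / 10 * (Real.exp (-t ^ 2) * t ^ (2 * (m + 1))) +
        49 / 10000 * (Real.exp (-t ^ 2) * t ^ (2 * (m + 2)))) := by
  simp only [K, P, zero_mul, sub_zero]
  ring

/-- The integrand `K_ε(t)t^{2m}` is dominated by `K_0(t)t^{2m}` on `(0,∞)` for `ε ≥ 0`. [folklore] -/
private theorem K_mul_pow_le {ε : ℝ} (hε : 0 ≤ ε) {t : ℝ} (ht : 0 ≤ t) (m : ℕ) :
    K ε t * t ^ (2 * m) ≤ K 0 t * t ^ (2 * m) := by
  refine mul_le_mul_of_nonneg_right ?_ (by positivity)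
  simp only [K, zero_mul, sub_zero]
  refine mul_le_mul_of_nonneg_right (Real.exp_le_exp.2 ?_) (P_pos _).le
  nlinarith [mul_nonneg hε (show (0 : ℝ) ≤ t ^ 4 by positivity)]

/-- `K_0(t) t^{2m}` is integrable on `(0, ∞)`. [folklore] -/
private theorem integrableOn_K_zero_mul_pow (m : ℕ) :
    IntegrableOn (fun t : ℝ => K 0 t * t ^ (2 * m)) (Ioi 0) := by
  have e : (fun t : ℝ => K 0 t * t ^ (2 * m)) = fun t : ℝ => Real.exp (-t ^ 2) * t ^ (2 * m) +
      (1 / 10 * (Real.exp (-t ^ 2) * t ^ (2 * (m + 1))) +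
        49 / 10000 * (Real.exp (-t ^ 2) * t ^ (2 * (m + 2)))) := funext (K_zero_mul_pow m)
  rw [e]
  exact (integrableOn_exp_neg_sq_mul_pow m).add
    (((integrableOn_exp_neg_sq_mul_pow (m + 1)).const_mul _).add
      ((integrableOn_exp_neg_sq_mul_pow (m + 2)).const_mul _))

/-- The moments `b_m(K_ε) = ∫₀^∞ t^{2m}K_ε` exist for every `ε ≥ 0` (domination by `ε = 0`).
[cite: DimitrovLucas2011, p. 1015] -/
theorem integrableOn_K_mul_pow {ε : ℝ} (hε : 0 ≤ ε) (m : ℕ) :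
    IntegrableOn (fun t : ℝ => K ε t * t ^ (2 * m)) (Ioi 0) := by
  refine Integrable.mono' (integrableOn_K_zero_mul_pow m)
    (((continuous_K ε).mul (continuous_pow _)).aestronglyMeasurable) ?_
  filter_upwards [ae_restrict_mem measurableSet_Ioi] with t ht
  rw [Real.norm_eq_abs, abs_of_nonneg (mul_nonneg (K_pos ε t).le (pow_nonneg (le_of_lt ht) _))]
  exact K_mul_pow_le hε (le_of_lt ht) m

/-- The GORZ/Dimitrov–Lucas sequence of the Gaussian-times-quartic family with the factor
`(√π/2)·4^{-m}` removed: the QUADRATIC `q(m) = 1 + (m + ½)/10 + 49 (m + ½)(m + 3/2)/10⁴`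
(from `Γ(m + 3/2) = (m + ½)Γ(m + ½)`, `Γ(m + 5/2) = (m + 3/2)(m + ½)Γ(m + ½)`). [folklore] -/
def qSeq (m : ℕ) : ℝ := 1 + 1 / 10 * ((m : ℝ) + 1 / 2) + 49 / 10000 * (((m : ℝ) + 1 / 2) * ((m : ℝ) + 3 / 2))

/-- `q(m) > 0`. [folklore] -/
private theorem qSeq_pos (m : ℕ) : 0 < qSeq m := by
  have hm : (0 : ℝ) ≤ m := Nat.cast_nonneg m
  unfold qSeq
  positivity

/-- **Exact moments of `K_0`**: `b_m(K_0) = Γ(m + ½)/2 · q(m)` (the moments `b_m` of p. 1015 for the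
witness). [cite: DimitrovLucas2011, p. 1015] -/
theorem kernelMoment_K_zero (m : ℕ) : kernelMoment (K 0) m = Real.Gamma (m + 1 / 2) / 2 * qSeq m := by
  rw [kernelMoment]
  have e : (fun t : ℝ => K 0 t * t ^ (2 * m)) = fun t : ℝ => Real.exp (-t ^ 2) * t ^ (2 * m) +
      (1 / 10 * (Real.exp (-t ^ 2) * t ^ (2 * (m + 1))) +
        49 / 10000 * (Real.exp (-t ^ 2) * t ^ (2 * (m + 2)))) := funext (K_zero_mul_pow m)
  have hA : IntegrableOn (fun t : ℝ => 1 / 10 * (Real.exp (-t ^ 2) * t ^ (2 * (m + 1)))) (Ioi 0) :=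
    (integrableOn_exp_neg_sq_mul_pow (m + 1)).const_mul _
  have hB : IntegrableOn (fun t : ℝ => 49 / 10000 * (Real.exp (-t ^ 2) * t ^ (2 * (m + 2)))) (Ioi 0) :=
    (integrableOn_exp_neg_sq_mul_pow (m + 2)).const_mul _
  have hAB : IntegrableOn (fun t : ℝ => 1 / 10 * (Real.exp (-t ^ 2) * t ^ (2 * (m + 1))) +
      49 / 10000 * (Real.exp (-t ^ 2) * t ^ (2 * (m + 2)))) (Ioi 0) := hA.add hB
  rw [e, integral_add (integrableOn_exp_neg_sq_mul_pow m) hAB, integral_add hA hB,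
    integral_const_mul, integral_const_mul, integral_exp_neg_sq_mul_pow, integral_exp_neg_sq_mul_pow,
    integral_exp_neg_sq_mul_pow]
  have hpos : (0 : ℝ) < m + 1 / 2 := by positivity
  have h1 : Real.Gamma (((m + 1 : ℕ) : ℝ) + 1 / 2) = ((m : ℝ) + 1 / 2) * Real.Gamma (m + 1 / 2) := by
    rw [Nat.cast_succ, show (m : ℝ) + 1 + 1 / 2 = ((m : ℝ) + 1 / 2) + 1 by ring,
      Real.Gamma_add_one hpos.ne']
  have h2 : Real.Gamma (((m + 2 : ℕ) : ℝ) + 1 / 2) =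
      ((m : ℝ) + 3 / 2) * (((m : ℝ) + 1 / 2) * Real.Gamma (m + 1 / 2)) := by
    rw [Nat.cast_add, Nat.cast_two, show (m : ℝ) + 2 + 1 / 2 = ((m : ℝ) + 1 / 2 + 1) + 1 by ring,
      Real.Gamma_add_one (by positivity), Real.Gamma_add_one hpos.ne']
    ring
  rw [h1, h2, qSeq]
  ring

/-- The normalising constant: `(m!/(2m)!)·Γ(m + ½)/2 = (√π/2)·4^{-m}` (Legendre duplication at
half-integers, by induction from `Γ(½) = √π`). [folklore] -/
private theorem factorial_div_mul_Gamma_half (m : ℕ) :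
    (m ! : ℝ) / ((2 * m)! : ℝ) * (Real.Gamma (m + 1 / 2) / 2) = Real.sqrt π / 2 * (1 / 4) ^ m := by
  induction m with
  | zero => rw [Nat.cast_zero, zero_add, Real.Gamma_one_half_eq]; simp
  | succ m ih =>
    have hpos : (0 : ℝ) < m + 1 / 2 := by positivity
    have hG : Real.Gamma (((m + 1 : ℕ) : ℝ) + 1 / 2) = ((m : ℝ) + 1 / 2) * Real.Gamma (m + 1 / 2) := by
      rw [Nat.cast_succ, show (m : ℝ) + 1 + 1 / 2 = ((m : ℝ) + 1 / 2) + 1 by ring,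
        Real.Gamma_add_one hpos.ne']
    have hf1 : ((m + 1)! : ℝ) = ((m : ℝ) + 1) * (m ! : ℝ) := by
      rw [Nat.factorial_succ]; push_cast; ring
    have hf2 : ((2 * (m + 1))! : ℝ) = (2 * (m : ℝ) + 2) * (2 * (m : ℝ) + 1) * ((2 * m)! : ℝ) := by
      rw [show 2 * (m + 1) = (2 * m + 1) + 1 by ring, Nat.factorial_succ, Nat.factorial_succ]
      push_cast; ring
    have hm0 : ((2 * m)! : ℝ) ≠ 0 := by positivity
    have h21 : (2 * (m : ℝ) + 1) ≠ 0 := by positivity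
    have h22 : (2 * (m : ℝ) + 2) ≠ 0 := by positivity
    calc ((m + 1)! : ℝ) / ((2 * (m + 1))! : ℝ) * (Real.Gamma (((m + 1 : ℕ) : ℝ) + 1 / 2) / 2)
        = (((m : ℝ) + 1) * ((m : ℝ) + 1 / 2) / ((2 * (m : ℝ) + 2) * (2 * (m : ℝ) + 1))) *
            ((m ! : ℝ) / ((2 * m)! : ℝ) * (Real.Gamma (m + 1 / 2) / 2)) := by
          rw [hG, hf1, hf2]
          field_simp
      _ = Real.sqrt π / 2 * (1 / 4) ^ (m + 1) := by
          rw [ih, pow_succ]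
          field_simp
          ring

/-- **Closed form of the Taylor sequence of `K_0`**: `γ_m(K_0) = (√π/2)·4^{-m}·q(m)` — a geometric
factor times a QUADRATIC in `m` (the `γ_k = k! b_k/(2k)!` of p. 1015 for the witness).
[cite: DimitrovLucas2011, p. 1015] -/
theorem kernelTaylorSeq_K_zero (m : ℕ) :
    kernelTaylorSeq (K 0) m = Real.sqrt π / 2 * (1 / 4) ^ m * qSeq m := by
  rw [kernelTaylorSeq, kernelMoment_K_zero, ← mul_assoc, factorial_div_mul_Gamma_half]

/-- The same, as an identity of sequences. [folklore] -/
private theorem kernelTaylorSeq_K_zero_eq :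
    kernelTaylorSeq (K 0) = fun m => Real.sqrt π / 2 * (1 / 4) ^ m * qSeq m :=
  funext kernelTaylorSeq_K_zero

/-! ### The Jensen grid of `q`: row `2` hyperbolic at every shift, cell `(3,0)` not -/

/-- Turán's inequality (3) for the quadratic sequence `q`, in closed form:
`q(n+1)² − q(n)q(n+2) = 2·(49/10⁴)²(n+1)² + 2·(49/10⁴)(549/5000)(n+1) + 341203/(2·10⁸) > 0`.
[cite: DimitrovLucas2011, (3)] -/
theorem qSeq_turan (n : ℕ) :
    qSeq (n + 1) ^ 2 - qSeq n * qSeq (n + 2) = 2 * (49 / 10000) ^ 2 * ((n : ℝ) + 1) ^ 2 +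
      2 * (49 / 10000) * (549 / 5000) * ((n : ℝ) + 1) + 341203 / 200000000 := by
  simp only [qSeq]; push_cast; ring

/-- **Row 2 of the witness is hyperbolic at every shift** (as Theorem A predicts for the whole
class): `J^{2,n}_q` splits over `ℝ` for every `n`. [cite: DimitrovLucas2011, Theorem A and (3)] -/
theorem splits_jensenPoly_qSeq_two (n : ℕ) : (jensenPoly qSeq 2 n).Splits := by
  refine splits_jensenPoly_two_of_turan (qSeq_pos _).ne' ?_
  have h := qSeq_turan n
  nlinarith [sq_nonneg ((n : ℝ) + 1), (n.cast_nonneg : (0 : ℝ) ≤ n)]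

/-- The higher order Turán expression (Dimitrov–Lucas (5), `k = 1`) of `q` is the NEGATIVE rational
`−440773179/(2.5·10¹⁵) ≈ −1.763·10⁻⁷` (exact arithmetic). [cite: DimitrovLucas2011, (5)] -/
theorem higherTuran_qSeq :
    4 * (qSeq 1 ^ 2 - qSeq 0 * qSeq 2) * (qSeq 2 ^ 2 - qSeq 1 * qSeq 3) -
      (qSeq 1 * qSeq 2 - qSeq 0 * qSeq 3) ^ 2 = -440773179 / 2500000000000000 := by
  norm_num [qSeq]

/-- **Cell `(3,0)` of the witness is NOT hyperbolic**: `J^{3,0}_q = q(0) + 3q(1)X + 3q(2)X² + q(3)X³`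
has a pair of non-real zeros (Dimitrov–Lucas Lemma 1, "only if": a hyperbolic cubic has `H ≥ 0`).
[cite: DimitrovLucas2011, Lemma 1] -/
theorem not_splits_jensenPoly_qSeq_three : ¬ (jensenPoly qSeq 3 0).Splits := by
  intro hs
  rw [jensenPoly_three_eq_toPoly] at hs
  have h3 : qSeq (0 + 3) ≠ 0 := (qSeq_pos _).ne'
  have h := higherTuran_nonneg_of_splits h3 hs
  norm_num [qSeq] at h

/-- Row 2 of `K_0`'s Jensen grid is hyperbolic at every shift (Theorem A's conclusion (6) for the
witness, here by exact computation). [cite: DimitrovLucas2011, Theorem A and (6)] -/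
theorem splits_jensenPoly_K_zero_two (n : ℕ) : (jensenPoly (kernelTaylorSeq (K 0)) 2 n).Splits := by
  rw [kernelTaylorSeq_K_zero_eq,
    splits_jensenPoly_const_mul_pow_mul_iff (by positivity) (by norm_num) qSeq 2 n]
  exact splits_jensenPoly_qSeq_two n

/-- **Cell `(3,0)` of `K_0`'s Jensen grid is not hyperbolic.** [cite: DimitrovLucas2011, Lemma 1] -/
theorem not_splits_jensenPoly_K_zero_three : ¬ (jensenPoly (kernelTaylorSeq (K 0)) 3 0).Splits := by
  rw [kernelTaylorSeq_K_zero_eq,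
    splits_jensenPoly_const_mul_pow_mul_iff (by positivity) (by norm_num) qSeq 3 0]
  exact not_splits_jensenPoly_qSeq_three

/-- **`H̃_1(K_0) < 0`** in Dimitrov–Lucas' moment form (9): with `b_m = ∫₀^∞ t^{2m}K_0`,
`4·5·T̃_1T̃_2 − 3Ũ_1² < 0`. [cite: DimitrovLucas2011, (9)] -/
theorem dlHtilde_K_zero_neg : dlHtilde (kernelMoment (K 0)) 1 < 0 := by
  simp only [dlHtilde, kernelMoment_K_zero]
  have h0 : Real.Gamma ((0 : ℕ) + 1 / 2) = Real.sqrt π := by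
    rw [Nat.cast_zero, zero_add, Real.Gamma_one_half_eq]
  have hpos : (0 : ℝ) < 1 / 2 := by norm_num
  have h1 : Real.Gamma ((1 : ℕ) + 1 / 2) = 1 / 2 * Real.sqrt π := by
    rw [Nat.cast_one, show (1 : ℝ) + 1 / 2 = 1 / 2 + 1 by ring, Real.Gamma_add_one hpos.ne',
      Real.Gamma_one_half_eq]
  have h2 : Real.Gamma ((2 : ℕ) + 1 / 2) = 3 / 2 * (1 / 2 * Real.sqrt π) := by
    rw [Nat.cast_two, show (2 : ℝ) + 1 / 2 = (1 / 2 + 1) + 1 by ring, Real.Gamma_add_one (by norm_num),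
      Real.Gamma_add_one hpos.ne', Real.Gamma_one_half_eq]
    norm_num
  have h3 : Real.Gamma ((3 : ℕ) + 1 / 2) = 5 / 2 * (3 / 2 * (1 / 2 * Real.sqrt π)) := by
    rw [show ((3 : ℕ) : ℝ) + 1 / 2 = ((1 / 2 + 1) + 1) + 1 by norm_num, Real.Gamma_add_one (by norm_num),
      Real.Gamma_add_one (by norm_num), Real.Gamma_add_one hpos.ne', Real.Gamma_one_half_eq]
    norm_num
  rw [h0, h1, h2, h3]
  have hπ : 0 < Real.sqrt π := Real.sqrt_pos.2 Real.pi_pos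
  have hπ4 : 0 < Real.sqrt π ^ 4 := by positivity
  norm_num [qSeq]
  nlinarith [hπ4]

/-! ### `K_ε` is an admissible kernel for `ε > 0`: (ii) entire, (v) super-Gaussian decay of all derivatives -/

/-- The entire function `F_ε(z) = exp(-z² - εz⁴)(1 + z²/10 + 49z⁴/10⁴)` extending `K_ε` to `ℂ`
(Dimitrov–Lucas (ii) asks only for analyticity in a strip `|Im z| < τ`). [cite: DimitrovLucas2011, Definition 1 (ii)] -/
def KC (ε : ℝ) (z : ℂ) : ℂ :=
  Complex.exp (-z ^ 2 - (ε : ℂ) * z ^ 4) * (1 + z ^ 2 / 10 + 49 / 10000 * (z ^ 2) ^ 2)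

/-- `F_ε` is entire (Dimitrov–Lucas (ii)). [cite: DimitrovLucas2011, Definition 1 (ii)] -/
theorem differentiable_KC (ε : ℝ) : Differentiable ℂ (KC ε) := by
  unfold KC
  fun_prop

/-- `F_ε` restricts to `K_ε` on the real line (Dimitrov–Lucas (ii)). [cite: DimitrovLucas2011, Definition 1 (ii)] -/
theorem KC_ofReal (ε t : ℝ) : KC ε (t : ℂ) = ((K ε t : ℝ) : ℂ) := by
  simp only [KC, K, P]
  push_cast
  ring

/-- The exponent `g_ε = -X² - εX⁴` as a polynomial. [folklore] -/
def gPoly (ε : ℝ) : ℝ[X] := -X ^ 2 - C ε * X ^ 4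

/-- The quartic `P(X²) = 1 + X²/10 + 49X⁴/10⁴` as a polynomial. [folklore] -/
def pPoly : ℝ[X] := 1 + C (1 / 10) * X ^ 2 + C (49 / 10000) * X ^ 4

/-- `K_ε(t) = P(t²)·exp(g_ε(t))` in polynomial language. [folklore] -/
private theorem K_eq_eval (ε t : ℝ) : K ε t = pPoly.eval t * Real.exp ((gPoly ε).eval t) := by
  simp only [K, P, gPoly, pPoly, eval_add, eval_sub, eval_neg, eval_mul, eval_pow, eval_C, eval_X,
    eval_one]
  ring_nf

/-- `(Q·e^{g})′ = (Q′ + Q g′)·e^{g}` for polynomials `Q, g`. [folklore] -/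
private theorem hasDerivAt_eval_mul_exp (Q g : ℝ[X]) (t : ℝ) :
    HasDerivAt (fun t : ℝ => Q.eval t * Real.exp (g.eval t))
      ((derivative Q + Q * derivative g).eval t * Real.exp (g.eval t)) t := by
  have h := (Q.hasDerivAt t).fun_mul (g.hasDerivAt t).exp
  refine h.congr_deriv ?_
  simp only [eval_add, eval_mul]
  ring

/-- Every derivative of `K_ε` has the form `Q_n(t)·e^{-t²-εt⁴}` with `Q_n` a real polynomial (towards
clause (v)). [cite: DimitrovLucas2011, Definition 1 (v)] -/
theorem exists_iteratedDeriv_K_eq (ε : ℝ) (n : ℕ) :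
    ∃ Q : ℝ[X], iteratedDeriv n (K ε) = fun t => Q.eval t * Real.exp ((gPoly ε).eval t) := by
  induction n with
  | zero => exact ⟨pPoly, by rw [iteratedDeriv_zero]; funext t; exact K_eq_eval ε t⟩
  | succ n ih =>
    obtain ⟨Q, hQ⟩ := ih
    refine ⟨derivative Q + Q * derivative (gPoly ε), ?_⟩
    rw [iteratedDeriv_succ, hQ]
    funext t
    exact (hasDerivAt_eval_mul_exp Q (gPoly ε) t).deriv

/-- For `ε > 0`, `Q(t)·e^{-t²-εt⁴} = O(e^{-t³})` as `t → +∞`, for every polynomial `Q`: indeed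
`|Q(t)| ≤ C t^d ≤ C d! e^{t}` and `t - t² - εt⁴ ≤ -t³` for `t ≥ max(1, 1/ε)`. [folklore] -/
private theorem eval_mul_exp_isBigO {ε : ℝ} (hε : 0 < ε) (Q : ℝ[X]) :
    (fun t : ℝ => Q.eval t * Real.exp ((gPoly ε).eval t)) =O[atTop] fun t : ℝ => Real.exp (-t ^ 3) := by
  set d := Q.natDegree with hd
  have hQ : (fun t : ℝ => Q.eval t) =O[atTop] fun t : ℝ => (X ^ d : ℝ[X]).eval t :=
    Polynomial.isBigO_atTop_of_degree_le Q (X ^ d) (by rw [degree_X_pow]; exact degree_le_natDegree)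
  obtain ⟨C, hC0, hC⟩ := hQ.exists_pos
  rw [Asymptotics.IsBigOWith_def] at hC
  refine Asymptotics.IsBigO.of_bound (C * d !) ?_
  filter_upwards [hC, eventually_ge_atTop (max 1 ε⁻¹)] with t hQt ht
  have ht1 : 1 ≤ t := le_trans (le_max_left _ _) ht
  have htε : ε⁻¹ ≤ t := le_trans (le_max_right _ _) ht
  have ht0 : 0 ≤ t := by linarith
  simp only [eval_pow, eval_X, Real.norm_eq_abs, abs_of_nonneg (pow_nonneg ht0 _)] at hQt
  rw [Real.norm_eq_abs, Real.norm_eq_abs, abs_mul, Real.abs_exp, Real.abs_exp]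
  have hεt : 1 ≤ ε * t := by
    have := mul_le_mul_of_nonneg_left htε hε.le
    rwa [mul_inv_cancel₀ hε.ne'] at this
  have hg : (gPoly ε).eval t + t ≤ -t ^ 3 := by
    simp only [gPoly, eval_sub, eval_neg, eval_pow, eval_X, eval_mul, eval_C]
    have h1 : t ^ 3 ≤ ε * t ^ 4 := by nlinarith [pow_nonneg ht0 3]
    nlinarith
  have hpow : t ^ d ≤ (d ! : ℝ) * Real.exp t := pow_le_factorial_mul_exp ht0 d
  calc |Q.eval t| * Real.exp ((gPoly ε).eval t)
      ≤ C * t ^ d * Real.exp ((gPoly ε).eval t) := by gcongr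
    _ ≤ C * ((d ! : ℝ) * Real.exp t) * Real.exp ((gPoly ε).eval t) := by gcongr
    _ = C * (d ! : ℝ) * Real.exp ((gPoly ε).eval t + t) := by rw [Real.exp_add]; ring
    _ ≤ C * (d ! : ℝ) * Real.exp (-t ^ 3) := by gcongr

/-- **(v) of Dimitrov–Lucas for `K_ε`, `ε > 0`**: every derivative is `O(e^{-t³})` as `t → +∞`.
[cite: DimitrovLucas2011, Definition 1 (v)] -/
theorem iteratedDeriv_K_isBigO {ε : ℝ} (hε : 0 < ε) (n : ℕ) :
    iteratedDeriv n (K ε) =O[atTop] fun t : ℝ => Real.exp (-t ^ 3) := by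
  obtain ⟨Q, hQ⟩ := exists_iteratedDeriv_K_eq ε n
  rw [hQ]
  exact eval_mul_exp_isBigO hε Q

/-- (v) in the printed shape `K^{(n)}(t) = O(exp(−|t|^{2+δ}))` with `δ = 1`. [cite: DimitrovLucas2011, Definition 1 (v)] -/
theorem iteratedDeriv_K_isBigO_rpow {ε : ℝ} (hε : 0 < ε) (n : ℕ) :
    iteratedDeriv n (K ε) =O[atTop] fun t : ℝ => Real.exp (-|t| ^ ((2 : ℝ) + 1)) := by
  refine (iteratedDeriv_K_isBigO hε n).congr' Filter.EventuallyEq.rfl ?_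
  filter_upwards [eventually_ge_atTop (0 : ℝ)] with t ht
  rw [abs_of_nonneg ht, show (2 : ℝ) + 1 = ((3 : ℕ) : ℝ) by norm_num, Real.rpow_natCast]

/-! ### Continuity of the moments at `ε = 0⁺` and the sign of `H̃_1(K_ε)` for small `ε > 0` -/

/-- `ε ↦ K_ε(t)` is continuous. [folklore] -/
private theorem continuous_K_param (t : ℝ) : Continuous fun ε : ℝ => K ε t := by
  unfold K
  fun_prop

/-- The moments `b_m(K_ε)` are continuous in `ε` at `0` from the right (dominated convergence,
dominating function `K_0(t)t^{2m}`) — the continuity step of the counterexample to Theorem 1.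
[cite: DimitrovLucas2011, Theorem 1] -/
theorem continuousWithinAt_kernelMoment_K (m : ℕ) :
    ContinuousWithinAt (fun ε : ℝ => kernelMoment (K ε) m) (Ici 0) 0 := by
  unfold kernelMoment
  refine continuousWithinAt_of_dominated (bound := fun t => K 0 t * t ^ (2 * m)) ?_ ?_ ?_ ?_
  · exact Eventually.of_forall fun ε => ((continuous_K ε).mul (continuous_pow _)).aestronglyMeasurable
  · filter_upwards [self_mem_nhdsWithin] with ε hε
    filter_upwards [ae_restrict_mem measurableSet_Ioi] with t ht
    rw [Real.norm_eq_abs, abs_of_nonneg (mul_nonneg (K_pos ε t).le (pow_nonneg (le_of_lt ht) _))]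
    exact K_mul_pow_le hε (le_of_lt ht) m
  · exact integrableOn_K_zero_mul_pow m
  · exact Eventually.of_forall fun t => ((continuous_K_param t).mul continuous_const).continuousWithinAt

/-- The moment sequence `b(K_ε) → b(K_0)` as `ε → 0⁺` (product topology). [folklore] -/
private theorem tendsto_kernelMoment_K :
    Tendsto (fun ε : ℝ => kernelMoment (K ε)) (𝓝[Ici 0] 0) (𝓝 (kernelMoment (K 0))) :=
  tendsto_pi_nhds.2 fun m => (continuousWithinAt_kernelMoment_K m).tendsto

/-- `b_m(K_0) > 0`. [folklore] -/
private theorem kernelMoment_K_zero_pos (m : ℕ) : 0 < kernelMoment (K 0) m := by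
  rw [kernelMoment_K_zero]
  have := Real.Gamma_pos_of_pos (show (0 : ℝ) < m + 1 / 2 by positivity)
  have := qSeq_pos m
  positivity

/-- For all sufficiently small `ε ≥ 0`: `H̃_1(K_ε) < 0` and `b_3(K_ε) > 0` (counterexamples to
Theorem 1 at `k = 1`). [cite: DimitrovLucas2011, Theorem 1 and (9)] -/
theorem eventually_dlHtilde_K_neg :
    ∀ᶠ ε in 𝓝[Ici 0] (0 : ℝ), dlHtilde (kernelMoment (K ε)) 1 < 0 ∧ 0 < kernelMoment (K ε) 3 := by
  have h1 : Tendsto (fun ε : ℝ => dlHtilde (kernelMoment (K ε)) 1) (𝓝[Ici 0] 0)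
      (𝓝 (dlHtilde (kernelMoment (K 0)) 1)) :=
    (continuous_dlHtilde_one.tendsto _).comp tendsto_kernelMoment_K
  have h2 : Tendsto (fun ε : ℝ => kernelMoment (K ε) 3) (𝓝[Ici 0] 0) (𝓝 (kernelMoment (K 0) 3)) :=
    (continuousWithinAt_kernelMoment_K 3).tendsto
  exact (h1.eventually (gt_mem_nhds dlHtilde_K_zero_neg)).and
    (h2.eventually (lt_mem_nhds (kernelMoment_K_zero_pos 3)))

/-- **There is `ε > 0` with `H̃_1(K_ε) < 0`** (and `b_3(K_ε) > 0`): an admissible counterexample to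
Theorem 1 at `k = 1`. [cite: DimitrovLucas2011, Theorem 1 and (9)] -/
theorem exists_pos_dlHtilde_K_neg :
    ∃ ε : ℝ, 0 < ε ∧ dlHtilde (kernelMoment (K ε)) 1 < 0 ∧ 0 < kernelMoment (K ε) 3 := by
  have h : ∀ᶠ ε in 𝓝[>] (0 : ℝ), dlHtilde (kernelMoment (K ε)) 1 < 0 ∧ 0 < kernelMoment (K ε) 3 :=
    eventually_dlHtilde_K_neg.filter_mono (nhdsWithin_mono _ Ioi_subset_Ici_self)
  obtain ⟨ε, hε, h0⟩ := (h.and self_mem_nhdsWithin).exists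
  exact ⟨ε, h0, hε⟩

end LogConcaveKernel

open LogConcaveKernel

/-! ## Full-line moments of an even kernel -/

/-- For an even kernel, the full-line moments `b_k = ∫_{-∞}^{∞} t^{2k}K(t) dt` of Dimitrov–Lucas'
Theorem 1 are twice the half-line moments of p. 1015. [cite: DimitrovLucas2011, Theorem 1 and p. 1015] -/
theorem integral_even_mul_pow_eq {K : ℝ → ℝ} (hK : ∀ t, K (-t) = K t) (m : ℕ) :
    ∫ t, K t * t ^ (2 * m) = 2 * kernelMoment K m := by
  rw [kernelMoment, ← integral_comp_abs]
  congr 1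
  funext t
  rw [pow_mul, pow_mul, ← sq_abs t]
  rcases le_or_gt 0 t with ht | ht
  · rw [abs_of_nonneg ht]
  · rw [abs_of_neg ht, hK]

/-! ## The positive side: log-concavity of `K(√t)` gives the Turán inequalities (row `d = 2`) -/

/-- **Csordas–Varga 1988, as printed in Varga 1990, §3.3 (3.25)–(3.28)** (the positive side of the
barrier; = Dimitrov–Lucas' Theorem A; for `K = Φ` plus Theorem 3/Theorem B this is the
Csordas–Norfolk–Varga proof of Pólya's 1927 inequalities = the Turán inequalities for `ξ`). Let `K` be a
`C²(ℝ)` ADMISSIBLE KERNEL in the sense of (3.8): (i) `K` integrable over `ℝ`, (ii) `K(t) > 0`,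
(iii) `K(t) = K(−t)`, (iv) `K(t) = O(exp(−|t|^{2+ε}))` (`t → ∞`) for some `ε > 0`; let
`ĉ_m = ∫₀^∞ t^{2m}K(t) dt` (3.26). If (3.28) `(d²/dt²) log K(√t) < 0` for `t > 0`, then (3.27)
`ĉ_m² > ((2m−1)/(2m+1)) ĉ_{m−1} ĉ_{m+1}` for `m = 1, 2, …` — stated here at `m + 1`
(`ĉ_{m+1}² > ((2m+1)/(2m+3)) ĉ_m ĉ_{m+2}` for all `m : ℕ`) to avoid `ℕ`-subtraction. Mechanism:
Matiyasevich's double integral (3.6), `2(2m+1)D_m = ∬ u^{2m}v^{2m}K(u)K(v)(v²−u²)∫_u^v −(d/dt)(K′/(tK))`.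
Equivalently (Dimitrov–Lucas (6)/Theorem A): `J^{2,n}` of `kernelTaylorSeq K` is hyperbolic for
every `n` (`splits_jensenPoly_two_of_momentTuran`, `splits_jensenPoly_two_of_logConcaveSqrt`).
PROVED below: `CsordasVarga1988_momentTuran_holds` (section "Discharge of the positive side").
[cite: Varga1990, §3.3 (3.25)–(3.28) and Theorem 4] [cite: CsordasVarga1988, Theorem 2.2 ff.]
[cite: DimitrovLucas2011, Theorem A] -/
def CsordasVarga1988_momentTuran : Prop :=
  ∀ K : ℝ → ℝ, ContDiff ℝ 2 K → Integrable K → (∀ t, 0 < K t) → (∀ t, K (-t) = K t) →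
    (∃ δ : ℝ, 0 < δ ∧ K =O[atTop] fun t => Real.exp (-|t| ^ (2 + δ))) →
    (∀ s, 0 < s → deriv^[2] (fun s => Real.log (K (Real.sqrt s))) s < 0) →
    ∀ m : ℕ, (2 * (m : ℝ) + 1) / (2 * m + 3) * (kernelMoment K m * kernelMoment K (m + 2)) <
      kernelMoment K (m + 1) ^ 2

/-- **From the moment inequalities to row 2 of the Jensen grid** (Dimitrov–Lucas p. 1015–1016:
`T_k = γ_k² − γ_{k−1}γ_{k+1} = c_k[(2k+1)b_k² − (2k−1)b_{k−1}b_{k+1}]`, `c_k > 0`): if the moments are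
positive and satisfy `ĉ_{m+1}² ≥ ((2m+1)/(2m+3)) ĉ_m ĉ_{m+2}` for all `m`, then every `J^{2,n}` of the
Taylor sequence `γ_m = m! ĉ_m/(2m)!` is hyperbolic. [cite: DimitrovLucas2011, (6)] -/
theorem splits_jensenPoly_two_of_momentTuran {K : ℝ → ℝ} (hpos : ∀ m, 0 < kernelMoment K m)
    (hT : ∀ m : ℕ, (2 * (m : ℝ) + 1) / (2 * m + 3) * (kernelMoment K m * kernelMoment K (m + 2)) ≤
      kernelMoment K (m + 1) ^ 2) (n : ℕ) :
    (jensenPoly (kernelTaylorSeq K) 2 n).Splits := by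
  have hc : ∀ m : ℕ, 0 < (m ! : ℝ) / ((2 * m)! : ℝ) := fun m => by positivity
  refine splits_jensenPoly_two_of_turan (mul_pos (hc _) (hpos _)).ne' ?_
  have hf1 : ((n + 1)! : ℝ) = ((n : ℝ) + 1) * (n ! : ℝ) := by
    rw [Nat.factorial_succ]; push_cast; ring
  have hf2 : ((n + 2)! : ℝ) = ((n : ℝ) + 2) * ((n : ℝ) + 1) * (n ! : ℝ) := by
    rw [Nat.factorial_succ, Nat.factorial_succ]; push_cast; ring
  have hg1 : ((2 * (n + 1))! : ℝ) = (2 * (n : ℝ) + 2) * (2 * (n : ℝ) + 1) * ((2 * n)! : ℝ) := by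
    rw [show 2 * (n + 1) = (2 * n + 1) + 1 by ring, Nat.factorial_succ, Nat.factorial_succ]
    push_cast; ring
  have hg2 : ((2 * (n + 2))! : ℝ) = (2 * (n : ℝ) + 4) * (2 * (n : ℝ) + 3) * ((2 * (n : ℝ) + 2) *
      (2 * (n : ℝ) + 1) * ((2 * n)! : ℝ)) := by
    rw [show 2 * (n + 2) = (((2 * n + 1) + 1) + 1) + 1 by ring, Nat.factorial_succ, Nat.factorial_succ,
      Nat.factorial_succ, Nat.factorial_succ]
    push_cast; ring
  have hn0 : ((2 * n)! : ℝ) ≠ 0 := by positivity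
  have hn0' : (n ! : ℝ) ≠ 0 := by positivity
  have key : (n ! : ℝ) / ((2 * n)! : ℝ) * (((n + 2)! : ℝ) / ((2 * (n + 2))! : ℝ)) =
      (2 * (n : ℝ) + 1) / (2 * n + 3) * (((n + 1)! : ℝ) / ((2 * (n + 1))! : ℝ)) ^ 2 := by
    rw [hf1, hf2, hg1, hg2]
    field_simp
    ring
  calc kernelTaylorSeq K n * kernelTaylorSeq K (n + 2)
      = (n ! : ℝ) / ((2 * n)! : ℝ) * (((n + 2)! : ℝ) / ((2 * (n + 2))! : ℝ)) *
          (kernelMoment K n * kernelMoment K (n + 2)) := by simp only [kernelTaylorSeq]; ring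
    _ = (((n + 1)! : ℝ) / ((2 * (n + 1))! : ℝ)) ^ 2 *
          ((2 * (n : ℝ) + 1) / (2 * n + 3) * (kernelMoment K n * kernelMoment K (n + 2))) := by
        rw [key]; ring
    _ ≤ (((n + 1)! : ℝ) / ((2 * (n + 1))! : ℝ)) ^ 2 * kernelMoment K (n + 1) ^ 2 :=
        mul_le_mul_of_nonneg_left (hT n) (sq_nonneg _)
    _ = kernelTaylorSeq K (n + 1) ^ 2 := by simp only [kernelTaylorSeq]; ring

/-! ## The barrier -/

/-- **Barrier `JensenPolynomialsLogConcaveKernel` (log-concave-kernel class: row `2`, not cell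
`(3,0)`; Dimitrov–Lucas 2011, Theorem 1, is false as stated).** There is a kernel `K : ℝ → ℝ` which
is ADMISSIBLE in the sense of Dimitrov–Lucas, Definition 1 — (i) `K > 0`; (ii) `K` extends to an
ENTIRE function (more than analytic in a strip); (iii) even; (iv) `K′(t) < 0` for `t > 0`; (v) every
derivative `K^{(n)}(t) = O(exp(−|t|^{2+δ}))`, `t → ∞` (`δ = 1`) — and satisfies (8): `log K(√t)` is
strictly concave on `(0,∞)` (both as printed, `(d²/ds²) log K(√s) < 0`, and in the shape of the tree's
`Literature.NumberTheory.LFunctions.DeBruijnPhiLogConcaveSqrt`, `t ↦ −K′(t)/(tK(t))` strictly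
increasing), and yet `H̃_1 < 0` (Dimitrov–Lucas (9), `k = 1`, in the moments `b_m = ∫₀^∞ t^{2m}K`;
the sign is the same for `∫_{-∞}^{∞}`, `dlHtilde_const_mul`) and the cubic Jensen polynomial
`J^{3,0}` of `γ_m = m! b_m/(2m)!` has non-real zeros. Witness: `K_ε(t) = e^{−t²−εt⁴}(1 + t²/10 +
49t⁴/10⁴)` for some (every sufficiently small) `ε > 0`; at `ε = 0` everything is EXACT —
`γ_m(K_0) = (√π/2)4^{−m}q(m)` with the quadratic `q(m) = 1 + (m+½)/10 + 49(m+½)(m+3/2)/10⁴`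
(`kernelTaylorSeq_K_zero`), `H(q(0),…,q(3)) = −440773179/(2.5·10¹⁵)` (`higherTuran_qSeq`), row 2
hyperbolic at every shift (`splits_jensenPoly_K_zero_two`), cell `(3,0)` not
(`not_splits_jensenPoly_K_zero_three`) — and `ε > 0` is reached by dominated convergence
(`exists_pos_dlHtilde_K_neg`).

BARRIER (structured block, D-0021):
- technique_class: KERNEL-SIDE POSITIVITY of the log-concavity type — arguments whose only input about the kernel `K` of a cosine transform `F(z) = ∫₀^∞ K(t)cos(zt)dt` (for `Ξ`: `K = Φ = deBruijnPhi`, `γ = xiTaylorCoeff = 64·4^m·γ_m(Φ)`, `xiTaylorCoeff_eq_kernelTaylorSeq`) is membership in the admissible class — positive, even, analytic in a strip, `K′ < 0` on `(0,∞)`, super-Gaussian decay of all derivatives [cite: DimitrovLucas2011, Definition 1] [cite: Varga1990, §3.3 (3.8)] — together with (strict) concavity of `log K(√t)` [cite: CsordasNorfolkVarga1986, the concavity of log Φ(√t)] [cite: Varga1990, §3.3 Theorem 3 and (3.28)] (tree: `DeBruijnPhiLogConcaveSqrt`), transported to the Taylor coefficients through moment/double-integral identities (Matiyasevich (3.6),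 Pólya–Szegő determinant identities = Dimitrov–Lucas' Theorem D) [cite: Varga1990, §3.3 (3.6)–(3.7)] [cite: DimitrovLucas2011, Theorem D]
- blocks: hyperbolicity of the Jensen polynomials `J^{d,n}_γ` (Pólya's criterion `Literature.NumberTheory.LFunctions.polya_jensen`: RH ↔ all `J^{d,n}_γ` hyperbolic) in any cell of DEGREE `d ≥ 3` from class membership alone — in particular the higher order Turán inequalities / hyperbolicity of `J^{3,n}` as derived in Dimitrov–Lucas, Theorem 1 ("If `K(t)` is an admissible kernel … and `(log K(√t))″ < 0` for `t > 0`, then `H̃_k ≥ 0` for every `k ∈ ℕ`"), which is FALSE as stated: this theorem exhibits an admissible kernel with `(log K(√t))″ < 0` and `H̃_1 < 0` (`not_dimitrovLucas2011_theorem1`) [cite: DimitrovLucas2011, Theorem 1 and (9)]; likewise (companion module `JensenPolynomialsLogConcaveKernelDoubleTuran`, 2026-08-26) Csordas' DOUBLE Turán inequalities `E_k = T_k² − T_{k−1}T_{k+1} ≥ 0` (`k ≥ 2`, `T_k = γ_k² − γ_{k−1}γ_{k+1}`, `γ_k = k! b_k/(2k)!`; RH-necessary) do not follow from class membership — `E_2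 < 0` for an admissible kernel with (8) although all `T_k > 0` (`exists_admissible_doubleTuran_neg`, `not_doubleTuran_of_logConcaveSqrt` there) [cite: Csordas2015, §4, (4.5) and the paragraph before Open Problem 4.14]
- because: the class contains the neighbours `e^{−t²−εt⁴}P(t²)` of the Gaussian, whose cosine transforms `e^{−z²/4}R(z²)` (`ε = 0`) have non-real zeros while `log K(√s) = −s − εs² + log P(s)` stays strictly concave (`P = 1 + as + bs²` with `a² > 2b`): the Taylor sequence is then a geometric factor times a QUADRATIC `q(m)`, for which `J^{d,n}_q = (1+X)^{d−2}Q_{d,n}` is hyperbolic iff a single discriminant is nonnegative, true in row `2` for all `n` and false at `(3,0)` (exact rational arithmetic; `ε > 0` by continuity of the four moments) [folklore]; the gap in the printed proof of Theorem 1 is the last Mean Value step on p. 1020: `A(y,z) = (z²−y²)B(y,z)` vanishes on the diagonal, so `z ↦ A_{1,0}(y,z)/A(y,z) = B_{1,0}/B − 2y/(z²−y²)` is monotone on `(0,y)` and on `(y,∞)` separately but jumps from `+∞` to `−∞` across `z = y`, and "there exists `z` in the interval surrounded by `z₁` and `z₂`" fails for `z₁ < y < z₂` [cite: DimitrovLucas2011,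 p. 1020–1021, (14)]; the positive side (row `2` for the whole class) is the named fact `CsordasVarga1988_momentTuran` [cite: Varga1990, §3.3 (3.25)–(3.28)]
- evasions_known: none published for degree `≥ 3` from kernel-side log-concavity. Row `3` for `Ξ` itself (Dimitrov–Lucas, Corollary 1: all `J^{3,n}_γ` hyperbolic) is TRUE, but via zero-side input: in the tree `Literature.NumberTheory.LFunctions.xiTaylorCoeff_higherTuran_nonneg` is derived from `jensenPoly_xiTaylorCoeff_splits_of_le` (`d ≤ 64`, all shifts, from RH verified to height `16`, Chasse / Kim–Lee) [cite: KimLee2021, Theorem 4 and Remark] [cite: Chasse2013, Theorem 1.8]; more generally `J^{d,n}_γ` is hyperbolic for all `n` and `4d ≤ T²` from RH to height `T`, and for `n ≥ N(d)` by GORZ [cite: GORZPNAS2019, Theorems 1–2] — none of these uses the kernel class. A different (weaker) log-concavity hypothesis, `log K(t)` concave in `t`, does not even give row `2`: Coffey–Csordas' Problem 3.3 (§3), answered negatively in the tree by `Literature.Analysis.SpecialFunctions.CoffeyCsordas2013.not_turanIneq33_one` (conditional on a moment certificate) [cite: CoffeyCsordas2013, §3, Problem 3.3]. A kernel-side argument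 with MORE input is in print for a different RH-necessary family (added 2026-08-26): Csordas–Dimitrov's SECOND-level concavity condition `(log f)″ < 0` on `(0,∞)`, `f = s′² − ss″`, `s(t) = K(√t)` [cite: Csordas2015, §4, Open Problem 4.14] is reported to imply the double Turán inequalities `E_k ≥ 0` [cite: CsordasDimitrov2000, Theorem 2.4 (cited through Csordas2015 §4, "[14, Theorem 2.4]")] and is PROVED for `Φ` by Planat–Solé (two computer-assisted proofs) [cite: PlanatSole2026, Theorem 1.1 and §7]; the tree has examined neither proof (acq-11869), that route claims no hyperbolicity of degree `≥ 3`, and its extra input is not redundant: first-level log-concavity alone does not give `E_2 ≥ 0` (companion module, `exists_admissible_doubleTuran_neg`)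
- status: established (proved here; standard axioms; the only named fact in this file, `CsordasVarga1988_momentTuran`, is the positive side, is NOT used by the barrier theorem, and is itself discharged below, `CsordasVarga1988_momentTuran_holds`). Erratum status of Dimitrov–Lucas' Theorem 1 in print: unknown to the tree (no correction among the 29 citing works in the local citation graph / 30 in the API graph, re-checked 2026-08-26 — the newest, Planat–Solé arXiv:2608.19160 of 19 Aug 2026, cites the paper only inside the moment-inequality programme and does not use Theorem 1 [cite: PlanatSole2026, §7]; no hit in corpus/galaxy search)
- scope_caveats: (a) the theorem refutes Theorem 1 at `k = 1` (cell `(3,0)`) for ONE explicit family; it says nothing against kernel-side arguments that use MORE than the admissible class + log-concavity of `K(√t)` — e.g. de Bruijn-type convexity of `log K` along vertical lines in a strip, total-positivity properties of `K(√t)` of higher order, second-level concavity of `K(√t)` in the sense of Csordas–Dimitrov / Planat–Solé (see evasions_known), or the arithmetic (theta-series) structure of `Φ`; (b) for the `ε = 0` member the whole Jensen grid is explicit and DECIDED (`splits_jensenPoly_K_zero_iff_lt_cornerThreshold`, appended 2026-08-26: `J^{d,n}(K_0)` is hyperbolic iff `n ≥ 79` or `d < d(n)`, `d(n) = 3,4,4,4,5,5,6,6,7,8,8,9,…,160337`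 nondecreasing — the non-hyperbolic cells are exactly the finite-height staircase `{n ≤ 78, d ≥ d(n)}`; row `2` hyperbolic ∀ `n`, `(3,0)` the tip), for the admissible members `ε > 0` only `H̃_1 < 0` and `b_3 > 0` are proved directly (row `2` for them follows from the positive side, proved below: `splits_jensenPoly_two_of_logConcaveSqrt`), and for ONE explicit admissible kernel, `K_β = exp(−t²−t⁴/1000)(1 + t²/20 + 17t⁴/8000)`, the value is enclosed in the kernel: `−1.13732·10⁻⁶·π² < H̃_1(K_β) < −1.13731·10⁻⁶·π²` (full-line; `ExplicitKernel.dlHtilde_Kb_one_fullLine_mem`, appended 2026-08-26); (c) the decay exponent is `2 + δ` with `δ = 1` (`e^{−εt⁴}` would give any `δ < 2`); Dimitrov–Lucas' bonus claim `H̃_k > 8T_kT_{k+1}` (p. 1021) fails for the same kernels (`not_dimitrovLucas2011_strongerIneq`, `exists_admissible_dlJ_neg` below: it is equivalent to the proof's intermediate `J_k > 0`, which fails at `k = 1, 2`); (d) nothing here bears on Corollary 1 (row 3 for `Ξ`), which is a theorem of the tree by other means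

[cite: DimitrovLucas2011, Theorem 1, Definition 1, (8), (9)] [cite: Varga1990, §3.3 (3.25)–(3.28)] -/
def JensenPolynomialsLogConcaveKernel : Prop :=
  ∃ K : ℝ → ℝ,
    (∀ t, 0 < K t) ∧
    (∃ F : ℂ → ℂ, Differentiable ℂ F ∧ ∀ t : ℝ, F t = K t) ∧
    (∀ t, K (-t) = K t) ∧
    (∀ t, 0 < t → deriv K t < 0) ∧
    (∃ δ : ℝ, 0 < δ ∧ ∀ n : ℕ, iteratedDeriv n K =O[atTop] fun t => Real.exp (-|t| ^ (2 + δ))) ∧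
    (∀ s, 0 < s → deriv^[2] (fun s => Real.log (K (Real.sqrt s))) s < 0) ∧
    StrictMonoOn (fun t => -deriv K t / (t * K t)) (Ioi 0) ∧
    dlHtilde (kernelMoment K) 1 < 0 ∧
    ¬ (jensenPoly (kernelTaylorSeq K) 3 0).Splits

/-- **The barrier holds**, witnessed by `K_ε = e^{−t²−εt⁴}(1 + t²/10 + 49t⁴/10⁴)` for a suitable
`ε > 0`. [cite: DimitrovLucas2011, Theorem 1 (refuted as stated)] -/
theorem JensenPolynomialsLogConcaveKernel_holds : JensenPolynomialsLogConcaveKernel := by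
  obtain ⟨ε, hε, hH, h3⟩ := exists_pos_dlHtilde_K_neg
  have h3' : kernelTaylorSeq (K ε) 3 ≠ 0 := by
    rw [kernelTaylorSeq]; positivity
  exact ⟨K ε, K_pos ε, ⟨KC ε, differentiable_KC ε, fun t => KC_ofReal ε t⟩, K_even ε,
    fun t ht => deriv_K_neg hε.le ht, ⟨1, one_pos, fun n => iteratedDeriv_K_isBigO_rpow hε n⟩,
    fun s hs => deriv2_log_K_sqrt_neg hε.le hs, strictMonoOn_neg_deriv_K_div hε.le, hH,
    not_splits_jensenPoly_three_of_dlHtilde_neg h3' hH⟩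

/-- **Dimitrov–Lucas 2011, Theorem 1, is false as stated.** It is NOT the case that for every
admissible kernel `K` (Definition 1: (i) `K > 0`; (ii) analytic in a strip — here even granting an
entire extension; (iii) even; (iv) `K′ < 0` on `(0,∞)`; (v) `K^{(n)}(t) = O(exp(−|t|^{2+ε}))` for
some `ε > 0` and all `n`) with `(log K(√t))″ < 0` for `t > 0`, the moments
`b_k = ∫_{−∞}^{∞} t^{2k}K(t) dt` satisfy `H̃_k ≥ 0` for every `k ≥ 1`. (Corollary 1 of the paper —
row 3 for `Ξ` — is nevertheless true: `xiTaylorCoeff_higherTuran_nonneg`, by other means.)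
[cite: DimitrovLucas2011, Theorem 1] -/
theorem not_dimitrovLucas2011_theorem1 :
    ¬ ∀ K : ℝ → ℝ, (∀ t, 0 < K t) → (∃ F : ℂ → ℂ, Differentiable ℂ F ∧ ∀ t : ℝ, F t = K t) →
        (∀ t, K (-t) = K t) → (∀ t, 0 < t → deriv K t < 0) →
        (∃ δ : ℝ, 0 < δ ∧ ∀ n : ℕ, iteratedDeriv n K =O[atTop] fun t => Real.exp (-|t| ^ (2 + δ))) →
        (∀ s, 0 < s → deriv^[2] (fun s => Real.log (K (Real.sqrt s))) s < 0) →
        ∀ k : ℕ, 1 ≤ k → 0 ≤ dlHtilde (fun m => ∫ t, K t * t ^ (2 * m)) k := by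
  intro h
  obtain ⟨K, h1, h2, h3, h4, h5, h6, -, hH, -⟩ := JensenPolynomialsLogConcaveKernel_holds
  have h := h K h1 h2 h3 h4 h5 h6 1 le_rfl
  have e : (fun m => ∫ t, K t * t ^ (2 * m)) = fun m => 2 * kernelMoment K m :=
    funext (integral_even_mul_pow_eq h3)
  rw [e, dlHtilde_const_mul] at h
  linarith

/-- Corollary in the language of the Jensen grid: admissibility + strict log-concavity of `K(√t)`
(in the tree's monotone shape) do not imply hyperbolicity of `J^{3,0}` of the kernel's Taylor
sequence — the kernel-side mirror of `JensenPolynomialsShiftUniform`/`JensenPolynomialsNarrow`.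
[cite: DimitrovLucas2011, Theorem 1 and Corollary 1] -/
theorem exists_logConcaveSqrt_kernel_not_splits_three :
    ∃ K : ℝ → ℝ, (∀ t, 0 < K t) ∧ (∀ t, K (-t) = K t) ∧ (∀ t, 0 < t → deriv K t < 0) ∧
      StrictMonoOn (fun t => -deriv K t / (t * K t)) (Ioi 0) ∧
      (∀ n : ℕ, iteratedDeriv n K =O[atTop] fun t => Real.exp (-t ^ 3)) ∧
      ¬ (jensenPoly (kernelTaylorSeq K) 3 0).Splits := by
  obtain ⟨ε, hε, hH, h3⟩ := exists_pos_dlHtilde_K_neg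
  have h3' : kernelTaylorSeq (K ε) 3 ≠ 0 := by
    rw [kernelTaylorSeq]; positivity
  exact ⟨K ε, K_pos ε, K_even ε, fun t ht => deriv_K_neg hε.le ht, strictMonoOn_neg_deriv_K_div hε.le,
    fun n => iteratedDeriv_K_isBigO hε n, not_splits_jensenPoly_three_of_dlHtilde_neg h3' hH⟩



/-! ## Discharge of the positive side: `CsordasVarga1988_momentTuran` holds (Matiyasevich's double integral) -/

namespace MomentTuran

/-! ### Decay consequences -/

/-- Super-Gaussian decay (3.8)(iv) of `K` gives `t^n K(t) = O(e^{-t})`. [folklore] -/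
private theorem pow_mul_isBigO_exp_neg {K : ℝ → ℝ} {δ : ℝ} (hδ : 0 < δ)
    (hdec : K =O[atTop] fun t => Real.exp (-|t| ^ (2 + δ))) (n : ℕ) :
    (fun t : ℝ => t ^ n * K t) =O[atTop] fun t => Real.exp (-t) := by
  have h1 : (fun t : ℝ => t ^ n * Real.exp (-|t| ^ (2 + δ))) =O[atTop] fun t => Real.exp (-t) := by
    refine Asymptotics.IsBigO.of_bound (n ! : ℝ) ?_
    filter_upwards [eventually_ge_atTop (2 : ℝ)] with t ht
    have ht0 : 0 ≤ t := by linarith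
    have ht1 : (1 : ℝ) ≤ t := by linarith
    rw [Real.norm_eq_abs, Real.norm_eq_abs, abs_of_nonneg (by positivity), Real.abs_exp]
    have hr : t ^ 2 ≤ |t| ^ (2 + δ) := by
      rw [abs_of_nonneg ht0, show t ^ 2 = t ^ ((2 : ℕ) : ℝ) by rw [Real.rpow_natCast]]
      exact Real.rpow_le_rpow_of_exponent_le ht1 (by push_cast; linarith)
    have h2 : Real.exp (-|t| ^ (2 + δ)) ≤ Real.exp (-t ^ 2) := Real.exp_le_exp.2 (by linarith)
    calc t ^ n * Real.exp (-|t| ^ (2 + δ)) ≤ ((n ! : ℝ) * Real.exp t) * Real.exp (-t ^ 2) :=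
          mul_le_mul (pow_le_factorial_mul_exp ht0 n) h2 (Real.exp_pos _).le (by positivity)
      _ = (n ! : ℝ) * Real.exp (t - t ^ 2) := by rw [mul_assoc, ← Real.exp_add]; ring_nf
      _ ≤ (n ! : ℝ) * Real.exp (-t) := by
          gcongr
          nlinarith
  exact ((Asymptotics.isBigO_refl (fun t : ℝ => t ^ n) atTop).mul hdec).trans h1

/-- All polynomially weighted copies of `K` are integrable on `(0, ∞)` (the moments (3.26) exist). [folklore] -/
private theorem integrableOn_pow_mul {K : ℝ → ℝ} (hK : Continuous K) {δ : ℝ} (hδ : 0 < δ)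
    (hdec : K =O[atTop] fun t => Real.exp (-|t| ^ (2 + δ))) (n : ℕ) :
    IntegrableOn (fun t : ℝ => t ^ n * K t) (Ioi 0) := by
  refine integrable_of_isBigO_exp_neg one_pos ((continuous_pow n).mul hK).continuousOn ?_
  have e : (fun x : ℝ => Real.exp (-1 * x)) = fun x => Real.exp (-x) := by
    funext x; rw [neg_one_mul]
  rw [e]
  exact pow_mul_isBigO_exp_neg hδ hdec n

/-- `t^n K(t) → 0` at `+∞`. [folklore] -/
private theorem tendsto_pow_mul {K : ℝ → ℝ} {δ : ℝ} (hδ : 0 < δ)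
    (hdec : K =O[atTop] fun t => Real.exp (-|t| ^ (2 + δ))) (n : ℕ) :
    Tendsto (fun t : ℝ => t ^ n * K t) atTop (𝓝 0) :=
  (pow_mul_isBigO_exp_neg hδ hdec n).trans_tendsto Real.tendsto_exp_neg_atTop_nhds_zero

/-! ### Log-concavity of `K(√t)` makes `F = K′/(tK)` strictly decreasing -/

/-- The derivative of `h(s) = log K(√s)` at `s > 0` is `K′(√s)/(2√s K(√s))`. [folklore] -/
private theorem hasDerivAt_log_K_sqrt {K : ℝ → ℝ} (hK : ContDiff ℝ 2 K) (hpos : ∀ t, 0 < K t) {s : ℝ}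
    (hs : 0 < s) :
    HasDerivAt (fun s => Real.log (K (Real.sqrt s)))
      (deriv K (Real.sqrt s) / (Real.sqrt s * K (Real.sqrt s)) / 2) s := by
  have h1 : HasDerivAt (fun x : ℝ => Real.sqrt x) (1 / (2 * Real.sqrt s)) s := Real.hasDerivAt_sqrt hs.ne'
  have h2 : HasDerivAt K (deriv K (Real.sqrt s)) (Real.sqrt s) :=
    ((hK.differentiable (by norm_num)) _).hasDerivAt
  have h3 := (h2.comp s h1).log (hpos _).ne'
  refine h3.congr_deriv ?_
  have hsq : Real.sqrt s ≠ 0 := (Real.sqrt_pos.2 hs).ne'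
  field_simp
  simp [Function.comp]

/-- **(3.28) ⟹ Matiyasevich's integrand is positive**: if `(d²/dt²) log K(√t) < 0` on `(0,∞)` then
`F(t) = K′(t)/(tK(t))` is strictly decreasing on `(0, ∞)` (Varga: `−(d/dt)(Φ′(t)/(tΦ(t))) > 0`, the
bracket of (3.6)). [cite: Varga1990, §3.3 (3.6) and (3.28)] -/
theorem strictAntiOn_F {K : ℝ → ℝ} (hK : ContDiff ℝ 2 K) (hpos : ∀ t, 0 < K t)
    (hconc : ∀ s, 0 < s → deriv^[2] (fun s => Real.log (K (Real.sqrt s))) s < 0) :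
    StrictAntiOn (fun t => deriv K t / (t * K t)) (Ioi 0) := by
  set h : ℝ → ℝ := fun s => Real.log (K (Real.sqrt s)) with hh
  -- `deriv h` agrees with `s ↦ F(√s)/2` on `(0, ∞)` and is continuous there
  have hderiv : ∀ s, 0 < s → deriv h s = deriv K (Real.sqrt s) / (Real.sqrt s * K (Real.sqrt s)) / 2 :=
    fun s hs => (hasDerivAt_log_K_sqrt hK hpos hs).deriv
  have hcontF : ContinuousOn (fun t => deriv K t / (t * K t)) (Ioi 0) := by
    refine ContinuousOn.div ?_ ?_ fun t ht => ?_
    · exact (hK.continuous_deriv (by norm_num)).continuousOn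
    · exact (continuousOn_id.mul hK.continuous.continuousOn)
    · exact mul_ne_zero (ne_of_gt ht) (hpos t).ne'
  have hcont : ContinuousOn (deriv h) (Ioi 0) := by
    have hc : ContinuousOn (fun s => deriv K (Real.sqrt s) / (Real.sqrt s * K (Real.sqrt s)) / 2) (Ioi 0) := by
      refine ContinuousOn.div_const (hcontF.comp Real.continuous_sqrt.continuousOn fun s hs => ?_) 2
      exact Real.sqrt_pos.2 hs
    exact hc.congr fun s hs => hderiv s hs
  have hanti : StrictAntiOn (deriv h) (Ioi 0) :=
    strictAntiOn_of_deriv_neg (convex_Ioi 0) hcont fun s hs => by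
      rw [interior_Ioi] at hs
      exact hconc s hs
  intro a ha b hb hab
  have ha' : 0 < a := ha
  have hb' : 0 < b := hb
  have ea : deriv K a / (a * K a) = 2 * deriv h (a ^ 2) := by
    rw [hderiv _ (by positivity), Real.sqrt_sq ha'.le]; ring
  have eb : deriv K b / (b * K b) = 2 * deriv h (b ^ 2) := by
    rw [hderiv _ (by positivity), Real.sqrt_sq hb'.le]; ring
  show deriv K b / (b * K b) < deriv K a / (a * K a)
  rw [ea, eb]
  have : deriv h (b ^ 2) < deriv h (a ^ 2) :=
    hanti (show a ^ 2 ∈ Ioi (0:ℝ) by exact pow_pos ha' 2) (show b ^ 2 ∈ Ioi (0:ℝ) by exact pow_pos hb' 2)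
      (by nlinarith)
  linarith

/-! ### `K′` is eventually negative -/

/-- An integrable positive kernel with `K′/(tK)` decreasing has `K′ < 0` from some point on. [folklore] -/
private theorem exists_deriv_neg {K : ℝ → ℝ} (hK : ContDiff ℝ 2 K) (hint : Integrable K) (hpos : ∀ t, 0 < K t)
    (hanti : StrictAntiOn (fun t => deriv K t / (t * K t)) (Ioi 0)) :
    ∃ t₁ : ℝ, 0 < t₁ ∧ ∀ t, t₁ ≤ t → deriv K t < 0 := by
  have hdiff : Differentiable ℝ K := hK.differentiable (by norm_num)
  -- some point with `K′ ≤ 0`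
  obtain ⟨t₀, ht₀, hle⟩ : ∃ t₀ : ℝ, 0 < t₀ ∧ deriv K t₀ ≤ 0 := by
    by_contra hcon
    push Not at hcon
    -- then `K` is increasing on `[0, ∞)`, hence `K ≥ K 0 > 0` there: not integrable
    have hmono : MonotoneOn K (Ici 0) :=
      monotoneOn_of_deriv_nonneg (convex_Ici 0) hdiff.continuous.continuousOn
        (fun x _ => hdiff.differentiableAt.differentiableWithinAt) fun x hx => by
          rw [interior_Ici] at hx; exact (hcon x hx).le
    have hge : ∀ t ∈ Ioi (0:ℝ), K 0 ≤ K t := fun t ht =>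
      hmono (self_mem_Ici) (Set.mem_Ici.2 (le_of_lt ht)) (le_of_lt ht)
    have hconst : IntegrableOn (fun _ : ℝ => K 0) (Ioi 0) := by
      refine Integrable.mono' hint.integrableOn aestronglyMeasurable_const ?_
      filter_upwards [ae_restrict_mem measurableSet_Ioi] with t ht
      rw [Real.norm_eq_abs, abs_of_pos (hpos 0)]
      exact hge t ht
    rw [integrableOn_const_iff] at hconst
    rcases hconst with h0 | hvol
    · exact (hpos 0).ne' (enorm_eq_zero.mp h0)
    · simp at hvol
  refine ⟨t₀ + 1, by linarith, fun t ht => ?_⟩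
  have hlt : deriv K t / (t * K t) < deriv K t₀ / (t₀ * K t₀) :=
    hanti ht₀ (show t ∈ Ioi (0:ℝ) from lt_of_lt_of_le (by linarith) ht) (by linarith)
  have h0 : deriv K t₀ / (t₀ * K t₀) ≤ 0 :=
    div_nonpos_of_nonpos_of_nonneg hle (mul_pos ht₀ (hpos t₀)).le
  have ht' : 0 < t := by linarith
  have := lt_of_lt_of_le hlt h0
  rwa [div_neg_iff, or_iff_right (not_and.2 fun _ h => absurd (mul_pos ht' (hpos t)) (not_lt.2 h.le)),
    and_iff_left (mul_pos ht' (hpos t))] at this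

/-! ### Integrability of `t^{n+1} K′(t)` and integration by parts on `(0, ∞)` -/

/-- `t^{n+1} K′(t)` is integrable on `(0, ∞)`. [folklore] -/
private theorem integrableOn_pow_mul_deriv {K : ℝ → ℝ} (hK : ContDiff ℝ 2 K) (hint : Integrable K)
    (hpos : ∀ t, 0 < K t) {δ : ℝ} (hδ : 0 < δ) (hdec : K =O[atTop] fun t => Real.exp (-|t| ^ (2 + δ)))
    (hconc : ∀ s, 0 < s → deriv^[2] (fun s => Real.log (K (Real.sqrt s))) s < 0) (n : ℕ) :
    IntegrableOn (fun t : ℝ => t ^ (n + 1) * deriv K t) (Ioi 0) := by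
  obtain ⟨t₁, ht₁, hneg⟩ := exists_deriv_neg hK hint hpos (strictAntiOn_F hK hpos hconc)
  have hdK : Continuous (deriv K) := hK.continuous_deriv (by norm_num)
  have hcontψ : Continuous (fun t : ℝ => t ^ (n + 1) * deriv K t) := (continuous_pow _).mul hdK
  rw [← Ioc_union_Ioi_eq_Ioi ht₁.le, integrableOn_union]
  refine ⟨hcontψ.continuousOn.integrableOn_Icc.mono_set Ioc_subset_Icc_self, ?_⟩
  have hφint : IntegrableOn (fun t : ℝ => t ^ n * K t) (Ioi t₁) :=
    (integrableOn_pow_mul hK.continuous hδ hdec n).mono_set (Ioi_subset_Ioi ht₁.le)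
  have hφcont : Continuous (fun t : ℝ => t ^ n * K t) := (continuous_pow _).mul hK.continuous
  refine integrableOn_Ioi_of_intervalIntegral_norm_bounded
    (t₁ ^ (n + 1) * K t₁ + ((n : ℝ) + 1) * ∫ t in Ioi t₁, t ^ n * K t) t₁
    (fun R => hcontψ.continuousOn.integrableOn_Icc.mono_set Ioc_subset_Icc_self) tendsto_id ?_
  filter_upwards [eventually_ge_atTop t₁] with R hR
  have hR' : t₁ ≤ id R := hR
  -- the derivative of `g(t) = t^{n+1} K(t)`
  have hg : ∀ x, HasDerivAt (fun t : ℝ => t ^ (n + 1) * K t)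
      (((n : ℝ) + 1) * (x ^ n * K x) + x ^ (n + 1) * deriv K x) x := by
    intro x
    have h := (hasDerivAt_pow (n + 1) x).mul ((hK.differentiable (by norm_num)) x).hasDerivAt
    refine h.congr_deriv ?_
    push_cast
    simp
    ring
  have hFTC : ∫ x in t₁..id R, (((n : ℝ) + 1) * (x ^ n * K x) + x ^ (n + 1) * deriv K x) =
      (id R) ^ (n + 1) * K (id R) - t₁ ^ (n + 1) * K t₁ :=
    intervalIntegral.integral_eq_sub_of_hasDerivAt (fun x _ => hg x)
      (((continuous_const.mul hφcont).add hcontψ).intervalIntegrable _ _)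
  -- on `[t₁, R]`, `‖ψ‖ = -ψ`
  have hnorm : ∫ x in t₁..id R, ‖x ^ (n + 1) * deriv K x‖ =
      ∫ x in t₁..id R, (((n : ℝ) + 1) * (x ^ n * K x) -
        (((n : ℝ) + 1) * (x ^ n * K x) + x ^ (n + 1) * deriv K x)) := by
    refine intervalIntegral.integral_congr fun x hx => ?_
    rw [uIcc_of_le hR'] at hx
    have hx0 : 0 < x := lt_of_lt_of_le ht₁ hx.1
    have hψ : x ^ (n + 1) * deriv K x ≤ 0 :=
      mul_nonpos_of_nonneg_of_nonpos (pow_nonneg hx0.le _) (hneg x hx.1).le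
    simp only [Real.norm_eq_abs, abs_of_nonpos hψ]
    ring
  have hi1 : IntervalIntegrable (fun x : ℝ => ((n : ℝ) + 1) * (x ^ n * K x)) volume t₁ (id R) :=
    (continuous_const.mul hφcont).intervalIntegrable _ _
  have hi2 : IntervalIntegrable (fun x : ℝ => ((n : ℝ) + 1) * (x ^ n * K x) + x ^ (n + 1) * deriv K x)
      volume t₁ (id R) :=
    ((continuous_const.mul hφcont).add hcontψ).intervalIntegrable _ _
  rw [hnorm, intervalIntegral.integral_sub hi1 hi2, hFTC, intervalIntegral.integral_const_mul]
  have hpart : ∫ x in t₁..id R, x ^ n * K x ≤ ∫ t in Ioi t₁, t ^ n * K t := by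
    rw [intervalIntegral.integral_of_le hR']
    refine setIntegral_mono_set hφint ?_ Ioc_subset_Ioi_self.eventuallyLE
    filter_upwards [ae_restrict_mem measurableSet_Ioi] with t ht
    exact mul_nonneg (pow_nonneg (ht₁.le.trans (le_of_lt ht)) _) (hpos t).le
  have hgR : 0 ≤ (id R) ^ (n + 1) * K (id R) :=
    mul_nonneg (pow_nonneg (ht₁.le.trans hR') _) (hpos _).le
  have hn : (0 : ℝ) ≤ (n : ℝ) + 1 := by positivity
  nlinarith [mul_le_mul_of_nonneg_left hpart hn]

/-- Integration by parts on `(0, ∞)`: `∫₀^∞ t^{n+1}K′(t) dt = -(n+1) ∫₀^∞ t^n K(t) dt` (the step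
"integration by parts yields `(2k−1)b_{k−1} = −∫₀^∞ t^{2k−1}K′(t)dt`" of Dimitrov–Lucas p. 1019).
[cite: DimitrovLucas2011, p. 1019] -/
theorem integral_pow_mul_deriv {K : ℝ → ℝ} (hK : ContDiff ℝ 2 K) (hint : Integrable K)
    (hpos : ∀ t, 0 < K t) {δ : ℝ} (hδ : 0 < δ) (hdec : K =O[atTop] fun t => Real.exp (-|t| ^ (2 + δ)))
    (hconc : ∀ s, 0 < s → deriv^[2] (fun s => Real.log (K (Real.sqrt s))) s < 0) (n : ℕ) :
    ∫ t in Ioi (0 : ℝ), t ^ (n + 1) * deriv K t = -((n : ℝ) + 1) * ∫ t in Ioi (0 : ℝ), t ^ n * K t := by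
  have hdiff : Differentiable ℝ K := hK.differentiable (by norm_num)
  have h := integral_Ioi_mul_deriv_eq_deriv_mul (a := 0) (a' := 0) (b' := 0)
    (u := fun t : ℝ => t ^ (n + 1)) (v := K) (u' := fun t : ℝ => ((n : ℝ) + 1) * t ^ n) (v' := deriv K)
    (fun x _ => by
      have h := hasDerivAt_pow (n + 1) x
      refine h.congr_deriv ?_
      push_cast; simp)
    (fun x _ => (hdiff x).hasDerivAt) ?_ ?_ ?_ ?_
  · rw [h, ← integral_const_mul]
    simp only [sub_zero, zero_sub, ← integral_neg]
    congr 1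
    funext t
    ring
  · exact integrableOn_pow_mul_deriv hK hint hpos hδ hdec hconc n
  · have hI : IntegrableOn (fun t : ℝ => ((n : ℝ) + 1) * (t ^ n * K t)) (Ioi 0) :=
      (integrableOn_pow_mul hK.continuous hδ hdec n).const_mul ((n : ℝ) + 1)
    refine hI.congr_fun (fun t _ => ?_) measurableSet_Ioi
    simp only [Pi.mul_apply]
    ring
  · have hc : Continuous (fun t : ℝ => t ^ (n + 1) * K t) := (continuous_pow _).mul hK.continuous
    have h0 : Tendsto (fun t : ℝ => t ^ (n + 1) * K t) (𝓝[>] 0) (𝓝 (0 ^ (n + 1) * K 0)) :=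
      (hc.tendsto 0).mono_left nhdsWithin_le_nhds
    have e : ((fun t : ℝ => t ^ (n + 1)) * K) = fun t : ℝ => t ^ (n + 1) * K t := rfl
    rw [e]
    simpa using h0
  · exact tendsto_pow_mul hδ hdec (n + 1)

/-! ### Matiyasevich's double integral and the strict moment inequality -/

/-- **Csordas–Varga 1988 via Matiyasevich's double integral (Varga 1990 (3.6), (3.27)–(3.28))**: for
`K ∈ C²`, integrable, positive, with super-Gaussian decay and `(log K(√t))″ < 0` on `(0,∞)`,
`∬_{(0,∞)²} u^{2m+2}v^{2m+2}K(u)K(v)(v²−u²)(F(u)−F(v)) = 2(2m+3)ĉ_{m+1}² − 2(2m+1)ĉ_mĉ_{m+2}` is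
positive, i.e. `ĉ_{m+1}² > ((2m+1)/(2m+3)) ĉ_m ĉ_{m+2}`. (Evenness is not needed.)
[cite: Varga1990, §3.3 (3.6) and (3.25)–(3.28)] -/
theorem momentTuran {K : ℝ → ℝ} (hK : ContDiff ℝ 2 K) (hint : Integrable K) (hpos : ∀ t, 0 < K t)
    {δ : ℝ} (hδ : 0 < δ) (hdec : K =O[atTop] fun t => Real.exp (-|t| ^ (2 + δ)))
    (hconc : ∀ s, 0 < s → deriv^[2] (fun s => Real.log (K (Real.sqrt s))) s < 0) (m : ℕ) :
    (2 * (m : ℝ) + 1) / (2 * m + 3) * (kernelMoment K m * kernelMoment K (m + 2)) <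
      kernelMoment K (m + 1) ^ 2 := by
  set μ : Measure ℝ := volume.restrict (Ioi (0 : ℝ)) with hμ
  -- the building blocks `φ_j = t^j K`, `ψ_j = t^j K′`
  have hφi : ∀ j : ℕ, Integrable (fun t : ℝ => t ^ j * K t) μ := fun j =>
    integrableOn_pow_mul hK.continuous hδ hdec j
  have hψi : ∀ j : ℕ, Integrable (fun t : ℝ => t ^ (j + 1) * deriv K t) μ := fun j =>
    integrableOn_pow_mul_deriv hK hint hpos hδ hdec hconc j
  have hcm : ∀ k : ℕ, ∫ t, t ^ (2 * k) * K t ∂μ = kernelMoment K k := fun k => by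
    simp only [hμ, kernelMoment]
    congr 1
    funext t
    ring
  have hψm : ∀ k : ℕ, ∫ t, t ^ (2 * k + 1) * deriv K t ∂μ = -(2 * (k : ℝ) + 1) * kernelMoment K k := by
    intro k
    have h := integral_pow_mul_deriv hK hint hpos hδ hdec hconc (2 * k)
    rw [← hcm k]
    simp only [hμ]
    rw [h]
    push_cast
    ring
  -- the four product terms
  set A : ℝ × ℝ → ℝ := fun p => (p.1 ^ (2 * m + 1) * deriv K p.1) * (p.2 ^ (2 * (m + 2)) * K p.2) with hA
  set B : ℝ × ℝ → ℝ := fun p => (p.1 ^ (2 * (m + 1)) * K p.1) * (p.2 ^ (2 * (m + 1) + 1) * deriv K p.2) with hB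
  set C : ℝ × ℝ → ℝ := fun p => (p.1 ^ (2 * (m + 1) + 1) * deriv K p.1) * (p.2 ^ (2 * (m + 1)) * K p.2) with hC
  set D : ℝ × ℝ → ℝ := fun p => (p.1 ^ (2 * (m + 2)) * K p.1) * (p.2 ^ (2 * m + 1) * deriv K p.2) with hD
  have hAi : Integrable A (μ.prod μ) := (hψi (2 * m)).mul_prod (hφi _)
  have hBi : Integrable B (μ.prod μ) := (hφi _).mul_prod (hψi (2 * (m + 1)))
  have hCi : Integrable C (μ.prod μ) := (hψi (2 * (m + 1))).mul_prod (hφi _)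
  have hDi : Integrable D (μ.prod μ) := (hφi _).mul_prod (hψi (2 * m))
  have hIA : ∫ p, A p ∂(μ.prod μ) = (-(2 * (m : ℝ) + 1) * kernelMoment K m) * kernelMoment K (m + 2) := by
    rw [hA, integral_prod_mul (μ := μ) (ν := μ) (fun t : ℝ => t ^ (2 * m + 1) * deriv K t)
      (fun t : ℝ => t ^ (2 * (m + 2)) * K t), hψm, hcm]
  have hIB : ∫ p, B p ∂(μ.prod μ) = kernelMoment K (m + 1) * (-(2 * ((m + 1 : ℕ) : ℝ) + 1) * kernelMoment K (m + 1)) := by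
    rw [hB, integral_prod_mul (μ := μ) (ν := μ) (fun t : ℝ => t ^ (2 * (m + 1)) * K t)
      (fun t : ℝ => t ^ (2 * (m + 1) + 1) * deriv K t), hψm, hcm]
  have hIC : ∫ p, C p ∂(μ.prod μ) = (-(2 * ((m + 1 : ℕ) : ℝ) + 1) * kernelMoment K (m + 1)) * kernelMoment K (m + 1) := by
    rw [hC, integral_prod_mul (μ := μ) (ν := μ) (fun t : ℝ => t ^ (2 * (m + 1) + 1) * deriv K t)
      (fun t : ℝ => t ^ (2 * (m + 1)) * K t), hψm, hcm]
  have hID : ∫ p, D p ∂(μ.prod μ) = kernelMoment K (m + 2) * (-(2 * (m : ℝ) + 1) * kernelMoment K m) := by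
    rw [hD, integral_prod_mul (μ := μ) (ν := μ) (fun t : ℝ => t ^ (2 * (m + 2)) * K t)
      (fun t : ℝ => t ^ (2 * m + 1) * deriv K t), hψm, hcm]
  -- Matiyasevich's integrand
  set G : ℝ × ℝ → ℝ := fun p => A p - B p - C p + D p with hG
  have hABi : Integrable (fun p => A p - B p) (μ.prod μ) := hAi.sub hBi
  have hABCi : Integrable (fun p => A p - B p - C p) (μ.prod μ) := hABi.sub hCi
  have hGi : Integrable G (μ.prod μ) := hABCi.add hDi
  have hGint : ∫ p, G p ∂(μ.prod μ) = 2 * (2 * (m : ℝ) + 3) * kernelMoment K (m + 1) ^ 2 -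
      2 * (2 * (m : ℝ) + 1) * (kernelMoment K m * kernelMoment K (m + 2)) := by
    rw [hG]
    simp only []
    rw [integral_add hABCi hDi, integral_sub hABi hCi, integral_sub hAi hBi, hIA, hIB, hIC, hID]
    push_cast
    ring
  -- pointwise form on `(0,∞)²`
  set F : ℝ → ℝ := fun t => deriv K t / (t * K t) with hF
  have hFanti : StrictAntiOn F (Ioi 0) := strictAntiOn_F hK hpos hconc
  have hkey : ∀ u v : ℝ, 0 < u → 0 < v →
      G (u, v) = u ^ (2 * m + 2) * v ^ (2 * m + 2) * (K u * K v) * ((v ^ 2 - u ^ 2) * (F u - F v)) := by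
    intro u v hu hv
    have hu' : deriv K u = F u * (u * K u) := by
      rw [hF]; exact (div_mul_cancel₀ _ (mul_pos hu (hpos u)).ne').symm
    have hv' : deriv K v = F v * (v * K v) := by
      rw [hF]; exact (div_mul_cancel₀ _ (mul_pos hv (hpos v)).ne').symm
    simp only [hG, hA, hB, hC, hD]
    rw [hu', hv']
    ring
  have hsign : ∀ u v : ℝ, 0 < u → 0 < v → 0 ≤ (v ^ 2 - u ^ 2) * (F u - F v) := by
    intro u v hu hv
    rcases lt_trichotomy u v with h | h | h
    · exact mul_nonneg (by nlinarith) (sub_nonneg.2 (hFanti hu hv h).le)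
    · subst h; simp
    · exact mul_nonneg_of_nonpos_of_nonpos (by nlinarith) (sub_nonpos.2 (hFanti hv hu h).le)
  have hsign' : ∀ u v : ℝ, 0 < u → 0 < v → u < v → 0 < (v ^ 2 - u ^ 2) * (F u - F v) :=
    fun u v hu hv h => mul_pos (by nlinarith) (sub_pos.2 (hFanti hu hv h))
  have hG_nonneg : 0 ≤ᵐ[μ.prod μ] G := by
    rw [hμ, Measure.prod_restrict]
    filter_upwards [ae_restrict_mem (measurableSet_Ioi.prod measurableSet_Ioi)] with p hp
    obtain ⟨hu, hv⟩ := hp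
    have e : p = (p.1, p.2) := rfl
    rw [Pi.zero_apply, e, hkey _ _ hu hv]
    have : 0 ≤ p.1 ^ (2 * m + 2) * p.2 ^ (2 * m + 2) * (K p.1 * K p.2) :=
      mul_nonneg (mul_nonneg (pow_nonneg (le_of_lt hu) _) (pow_nonneg (le_of_lt hv) _))
        (mul_pos (hpos _) (hpos _)).le
    exact mul_nonneg this (hsign _ _ hu hv)
  have hGpos : 0 < ∫ p, G p ∂(μ.prod μ) := by
    rw [integral_pos_iff_support_of_nonneg_ae hG_nonneg hGi]
    have hBox : Ioo (1 : ℝ) 2 ×ˢ Ioo (3 : ℝ) 4 ⊆ Function.support G := by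
      intro p hp
      obtain ⟨⟨h1, h2⟩, ⟨h3, h4⟩⟩ := hp
      have hu : 0 < p.1 := by linarith
      have hv : 0 < p.2 := by linarith
      have e : p = (p.1, p.2) := rfl
      rw [Function.mem_support, e, hkey _ _ hu hv]
      refine (mul_pos (mul_pos (mul_pos (pow_pos hu _) (pow_pos hv _)) (mul_pos (hpos _) (hpos _)))
        (hsign' _ _ hu hv (by linarith))).ne'
    refine lt_of_lt_of_le ?_ (measure_mono hBox)
    rw [Measure.prod_prod, hμ, Measure.restrict_apply measurableSet_Ioo,
      Measure.restrict_apply measurableSet_Ioo]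
    have e1 : Ioo (1 : ℝ) 2 ∩ Ioi 0 = Ioo 1 2 :=
      inter_eq_left.2 fun x hx => lt_trans one_pos hx.1
    have e2 : Ioo (3 : ℝ) 4 ∩ Ioi 0 = Ioo 3 4 :=
      inter_eq_left.2 fun x hx => lt_trans (by norm_num) hx.1
    rw [e1, e2, Real.volume_Ioo, Real.volume_Ioo]
    norm_num
  -- conclude
  rw [hGint] at hGpos
  have h3 : (0 : ℝ) < 2 * (m : ℝ) + 3 := by positivity
  rw [div_mul_eq_mul_div, div_lt_iff₀ h3]
  nlinarith

end MomentTuran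

/-- **Discharge of `CsordasVarga1988_momentTuran`** (Varga 1990 §3.3 (3.25)–(3.28) = Csordas–Varga
1988): proved by Matiyasevich's double integral (3.6). [cite: Varga1990, §3.3 (3.25)–(3.28)]
[cite: CsordasVarga1988, Theorem 2.2 ff.] -/
theorem CsordasVarga1988_momentTuran_holds : CsordasVarga1988_momentTuran := by
  intro K hK hint hpos _heven hdec hconc m
  obtain ⟨δ, hδ, hdec⟩ := hdec
  exact MomentTuran.momentTuran hK hint hpos hδ hdec hconc m

/-- The moments of a positive continuous kernel with super-Gaussian decay are positive. [folklore] -/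
private theorem kernelMoment_pos {K : ℝ → ℝ} (hK : Continuous K) (hpos : ∀ t, 0 < K t) {δ : ℝ}
    (hδ : 0 < δ) (hdec : K =O[atTop] fun t => Real.exp (-|t| ^ (2 + δ))) (m : ℕ) :
    0 < kernelMoment K m := by
  have hi : IntegrableOn (fun t : ℝ => K t * t ^ (2 * m)) (Ioi 0) := by
    refine (MomentTuran.integrableOn_pow_mul hK hδ hdec (2 * m)).congr_fun (fun t _ => ?_)
      measurableSet_Ioi
    ring
  rw [kernelMoment, setIntegral_pos_iff_support_of_nonneg_ae ?_ hi]
  · have hsub : Ioi (0 : ℝ) ⊆ Function.support (fun t : ℝ => K t * t ^ (2 * m)) ∩ Ioi 0 :=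
      fun t ht => ⟨(mul_pos (hpos t) (pow_pos ht _)).ne', ht⟩
    refine lt_of_lt_of_le ?_ (measure_mono hsub)
    simp
  · filter_upwards [ae_restrict_mem measurableSet_Ioi] with t ht
    exact mul_nonneg (hpos t).le (pow_nonneg (le_of_lt ht) _)

/-- **Row 2 of the Jensen grid for the whole class, proved** (Csordas–Norfolk–Varga's mechanism in
general: Varga 1990 (3.25)–(3.28) + Dimitrov–Lucas (6)): for every `C²` admissible kernel `K` with
`(log K(√t))″ < 0` on `(0,∞)`, every quadratic Jensen polynomial `J^{2,n}` of the Taylor sequence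
`γ_m = m! ĉ_m/(2m)!` of its cosine transform is hyperbolic — the Turán inequalities hold at every
shift. (For `K = Φ` this is the Csordas–Norfolk–Varga theorem, modulo their log-concavity of
`Φ(√t)`, the tree's named fact `DeBruijnPhiLogConcaveSqrt` in its strict `C²` form.)
[cite: Varga1990, §3.3 Theorem 4 and (3.25)–(3.28)] [cite: DimitrovLucas2011, Theorem A and (6)] -/
theorem splits_jensenPoly_two_of_logConcaveSqrt {K : ℝ → ℝ} (hK : ContDiff ℝ 2 K) (hint : Integrable K)
    (hpos : ∀ t, 0 < K t) (heven : ∀ t, K (-t) = K t)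
    (hdec : ∃ δ : ℝ, 0 < δ ∧ K =O[atTop] fun t => Real.exp (-|t| ^ (2 + δ)))
    (hconc : ∀ s, 0 < s → deriv^[2] (fun s => Real.log (K (Real.sqrt s))) s < 0) (n : ℕ) :
    (jensenPoly (kernelTaylorSeq K) 2 n).Splits := by
  obtain ⟨δ, hδ, hdec'⟩ := hdec
  exact splits_jensenPoly_two_of_momentTuran (kernelMoment_pos hK.continuous hpos hδ hdec')
    (fun m => (CsordasVarga1988_momentTuran_holds K hK hint hpos heven ⟨δ, hδ, hdec'⟩ hconc m).le) n

/-! ## Dimitrov–Lucas' `T_k`, `U_k`, `J_k`: the proof's intermediate inequality `J_k > 0` and its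
closing remark `H̃_k > 8T_kT_{k+1}` (p. 1021) fail as well

The printed proof of Theorem 1 (pp. 1018–1021) runs: `2T_k = I_{2k,2k}`, `U_k = I_{2k+2,2k} =
I_{2k,2k+2}` (p. 1019, Theorem D), hence (12) `H̃_k = 4(2k+3)T_kT_{k+1} − (2k+1)U_k² =
(2k+3)I_{2k,2k}I_{2k+2,2k+2} − (2k+1)I_{2k+2,2k}I_{2k,2k+2}`; then "`J_k := I_{2k,2k}I_{2k+2,2k+2} −
I_{2k+2,2k}I_{2k,2k+2} > 0`" (p. 1021, from `Ψ(y) > 0` via the Mean Value step on p. 1020) and "then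
obviously `(2k+3)I_{2k,2k}I_{2k+2,2k+2} − (2k+1)[I_{2k+2,2k}]² > 0`, which is equivalent to `H̃_k > 0`",
closing with "we have proven that the logarithmic concavity of the kernel `K(√t)` on the positive real
axes implies the stronger inequalities `H̃_k > 8T_kT_{k+1}`". In the moments, `J_k = 4T_kT_{k+1} − U_k²`
and `H̃_k − 8T_kT_{k+1} = (2k+1)J_k` IDENTICALLY (`dlHtilde_sub_eight_mul_dlT`), so the closing remark is
equivalent to the intermediate claim `J_k > 0`; and since `T_k > 0` throughout the class (the positive
side, `dlT_pos_of_logConcaveSqrt`), `H̃_1 < 0` for the witness already forces `J_1 < 0`: the printed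
argument fails at (or before) "`J_k > 0`", consistent with the gap located on p. 1020. At `ε = 0` the
values are exact rationals times `π²`: `J_1(K_0) < 0`, and `J_2(K_0) < 0` although `H̃_2(K_0) > 0`
(`dlJ_K_zero_two_neg`) — the intermediate inequality fails even where the theorem's conclusion holds. -/

/-- Dimitrov–Lucas (6) (recalled on p. 1018 at the start of the proof of Theorem 1): the Turán
determinant in MOMENT form, `T_k(b) = (2k+1)b_k² − (2k−1)b_{k−1}b_{k+1}`; the Turán determinant of the
Taylor sequence `γ_k = k! b_k/(2k)!` is `γ_k² − γ_{k−1}γ_{k+1} = c_kT_k(b)` with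
`c_k = 2k!(k+1)!/((2k)!(2k+2)!) > 0` (p. 1015–1016), and `2T_k = I_{2k,2k}` (p. 1019). As for
`dlHtilde`, `k − 1` is `ℕ`-subtraction and only `k ≥ 1` is meaningful; `T_{m+1}(ĉ) = (2m+3)ĉ_{m+1}² −
(2m+1)ĉ_mĉ_{m+2}` is the quantity of Varga (3.27) (`CsordasVarga1988_momentTuran`).
[cite: DimitrovLucas2011, (6) and p. 1018–1019] -/
def dlT (b : ℕ → ℝ) (k : ℕ) : ℝ :=
  (2 * (k : ℝ) + 1) * b k ^ 2 - (2 * (k : ℝ) - 1) * b (k - 1) * b (k + 1)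

/-- Dimitrov–Lucas p. 1019: `U_k(b) = (2k+3)b_kb_{k+1} − (2k−1)b_{k−1}b_{k+2}`
(there `U_k = ½[I_{2k+2,2k} + I_{2k,2k+2}] = I_{2k+2,2k} = I_{2k,2k+2}` by Theorem D and the symmetry
of `A`). [cite: DimitrovLucas2011, p. 1019] -/
def dlU (b : ℕ → ℝ) (k : ℕ) : ℝ :=
  (2 * (k : ℝ) + 3) * b k * b (k + 1) - (2 * (k : ℝ) - 1) * b (k - 1) * b (k + 2)

/-- Dimitrov–Lucas p. 1019: `J_k := I_{2k,2k}I_{2k+2,2k+2} − I_{2k+2,2k}I_{2k,2k+2}`, in the moment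
form the paper gives it through `2T_k = I_{2k,2k}` and `U_k = I_{2k+2,2k} = I_{2k,2k+2}` (same page):
`J_k = 4T_kT_{k+1} − U_k²`. The printed proof of Theorem 1 asserts `J_k > 0` (p. 1021: "Thus,
`J_k = I_{2k,2k}I_{2k+2,2k+2} − [I_{2k+2,2k}]² > 0`") and derives `H̃_k > 0` from it via (12).
[cite: DimitrovLucas2011, p. 1019 and p. 1021] -/
def dlJ (b : ℕ → ℝ) (k : ℕ) : ℝ := 4 * (dlT b k * dlT b (k + 1)) - dlU b k ^ 2

/-- Dimitrov–Lucas (12): `H̃_k = 4(2k+3)T_kT_{k+1} − (2k+1)U_k²`, an identity in the moments.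
[cite: DimitrovLucas2011, (12)] -/
theorem dlHtilde_eq_dlT_dlU (b : ℕ → ℝ) (k : ℕ) :
    dlHtilde b k = 4 * (2 * (k : ℝ) + 3) * (dlT b k * dlT b (k + 1)) - (2 * (k : ℝ) + 1) * dlU b k ^ 2 := by
  simp only [dlHtilde, dlT, dlU, Nat.add_sub_cancel, Nat.cast_add, Nat.cast_one]
  ring

/-- **`H̃_k − 8T_kT_{k+1} = (2k+1)J_k` identically in the moments** ((12) rearranged): the "stronger
inequalities `H̃_k > 8T_kT_{k+1}`" of the closing remark on p. 1021 are EQUIVALENT to the proof's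
intermediate claim `J_k > 0`, for every `k` and every moment sequence.
[cite: DimitrovLucas2011, (12) and p. 1021] -/
theorem dlHtilde_sub_eight_mul_dlT (b : ℕ → ℝ) (k : ℕ) :
    dlHtilde b k - 8 * (dlT b k * dlT b (k + 1)) = (2 * (k : ℝ) + 1) * dlJ b k := by
  rw [dlHtilde_eq_dlT_dlU, dlJ]
  ring

/-- `T_k` is homogeneous of degree `2` in the moment sequence. [cite: DimitrovLucas2011, (6)] -/
theorem dlT_const_mul (c : ℝ) (b : ℕ → ℝ) (k : ℕ) :
    dlT (fun m => c * b m) k = c ^ 2 * dlT b k := by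
  simp only [dlT]; ring

/-- `J_k` is homogeneous of degree `4` in the moment sequence (so its sign is the same for half-line
and full-line moments). [cite: DimitrovLucas2011, p. 1019] -/
theorem dlJ_const_mul (c : ℝ) (b : ℕ → ℝ) (k : ℕ) :
    dlJ (fun m => c * b m) k = c ^ 4 * dlJ b k := by
  simp only [dlJ, dlT_const_mul, dlU]; ring

/-- **In the log-concave-`√t` class, `T_k > 0` for every `k ≥ 1`** — the positive side
(`MomentTuran.momentTuran`, Varga (3.27)–(3.28)) in Dimitrov–Lucas' notation (6). Consequently, in
the class, `H̃_k < 0` forces `J_k < 0` and `H̃_k < 8T_kT_{k+1}` (`dlHtilde_sub_eight_mul_dlT`).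
[cite: Varga1990, §3.3 (3.27)–(3.28)] [cite: DimitrovLucas2011, (6)] -/
theorem dlT_pos_of_logConcaveSqrt {K : ℝ → ℝ} (hK : ContDiff ℝ 2 K) (hint : Integrable K)
    (hpos : ∀ t, 0 < K t) (hdec : ∃ δ : ℝ, 0 < δ ∧ K =O[atTop] fun t => Real.exp (-|t| ^ (2 + δ)))
    (hconc : ∀ s, 0 < s → deriv^[2] (fun s => Real.log (K (Real.sqrt s))) s < 0) {k : ℕ}
    (hk : 1 ≤ k) : 0 < dlT (kernelMoment K) k := by
  obtain ⟨m, rfl⟩ := Nat.exists_eq_add_of_le' hk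
  obtain ⟨δ, hδ, hdec⟩ := hdec
  have h := MomentTuran.momentTuran hK hint hpos hδ hdec hconc m
  have h3 : (0 : ℝ) < 2 * (m : ℝ) + 3 := by positivity
  rw [div_mul_eq_mul_div, div_lt_iff₀ h3] at h
  simp only [dlT, Nat.add_sub_cancel, Nat.cast_add, Nat.cast_one]
  nlinarith [h]

namespace LogConcaveKernel

/-- `K_ε` is smooth. [folklore] -/
private theorem contDiff_K (ε : ℝ) {n : WithTop ℕ∞} : ContDiff ℝ n (K ε) := by
  unfold K P
  fun_prop

/-- `K_ε` (`ε ≥ 0`) is integrable over `ℝ` (it is below `2e^{−t²/2}`, `K_le_gaussian`). [folklore] -/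
private theorem integrable_K {ε : ℝ} (hε : 0 ≤ ε) : Integrable (K ε) := by
  have hg : Integrable fun t : ℝ => 2 * Real.exp (-(1 / 2) * t ^ 2) :=
    (integrable_exp_neg_mul_sq (by norm_num : (0 : ℝ) < 1 / 2)).const_mul 2
  refine hg.mono' (continuous_K ε).aestronglyMeasurable (Eventually.of_forall fun t => ?_)
  rw [Real.norm_eq_abs, abs_of_pos (K_pos ε t)]
  have h := K_le_gaussian hε t
  convert h using 3
  ring

/-- (v) at `n = 0`: `K_ε = O(exp(−|t|³))` for `ε > 0`. [cite: DimitrovLucas2011, Definition 1 (v)] -/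
theorem K_isBigO_rpow {ε : ℝ} (hε : 0 < ε) :
    K ε =O[atTop] fun t : ℝ => Real.exp (-|t| ^ ((2 : ℝ) + 1)) := by
  simpa only [iteratedDeriv_zero] using iteratedDeriv_K_isBigO_rpow hε 0

/-- For the admissible witnesses `K_ε`, `ε > 0`: `T_k(K_ε) > 0` for all `k ≥ 1` (row `2`, from the
positive side `dlT_pos_of_logConcaveSqrt`). [cite: DimitrovLucas2011, (6)] -/
theorem dlT_K_pos {ε : ℝ} (hε : 0 < ε) {k : ℕ} (hk : 1 ≤ k) : 0 < dlT (kernelMoment (K ε)) k :=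
  dlT_pos_of_logConcaveSqrt (contDiff_K ε) (integrable_K hε.le) (K_pos ε) ⟨1, one_pos, K_isBigO_rpow hε⟩
    (fun _ hs => deriv2_log_K_sqrt_neg hε.le hs) hk

/-- The moments of `K_0` in closed form: `b_m(K_0) = (√π/2)·(2m)!/(4^m m!)·q(m)`
(`kernelTaylorSeq_K_zero` unscaled). [cite: DimitrovLucas2011, p. 1015] -/
theorem kernelMoment_K_zero_eq (m : ℕ) :
    kernelMoment (K 0) m = Real.sqrt π / 2 * ((1 / 4) ^ m * ((2 * m)! : ℝ) / (m ! : ℝ) * qSeq m) := by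
  have h := kernelTaylorSeq_K_zero m
  rw [kernelTaylorSeq] at h
  have hm : (m ! : ℝ) ≠ 0 := by positivity
  have h2m : ((2 * m)! : ℝ) ≠ 0 := by positivity
  calc kernelMoment (K 0) m
      = ((2 * m)! : ℝ) / (m ! : ℝ) * ((m ! : ℝ) / ((2 * m)! : ℝ) * kernelMoment (K 0) m) := by
        field_simp
    _ = ((2 * m)! : ℝ) / (m ! : ℝ) * (Real.sqrt π / 2 * (1 / 4) ^ m * qSeq m) := by rw [h]
    _ = Real.sqrt π / 2 * ((1 / 4) ^ m * ((2 * m)! : ℝ) / (m ! : ℝ) * qSeq m) := by ring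

/-- The same, as an identity of sequences. [folklore] -/
private theorem kernelMoment_K_zero_eq' :
    kernelMoment (K 0) = fun m => Real.sqrt π / 2 * ((1 / 4) ^ m * ((2 * m)! : ℝ) / (m ! : ℝ) * qSeq m) :=
  funext kernelMoment_K_zero_eq

/-- At `ε = 0`, EXACTLY: `J_1(K_0) < 0` (`= (π²/16)·(−833219446167/(2.048·10¹⁷))` in half-line
moments). [cite: DimitrovLucas2011, p. 1021] -/
theorem dlJ_K_zero_one_neg : dlJ (kernelMoment (K 0)) 1 < 0 := by
  have hπ4 : 0 < (Real.sqrt π / 2) ^ 4 := by positivity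
  rw [kernelMoment_K_zero_eq', dlJ_const_mul]
  refine mul_neg_of_pos_of_neg hπ4 ?_
  norm_num [dlJ, dlT, dlU, qSeq, Nat.factorial]

/-- At `ε = 0`, EXACTLY: `J_2(K_0) < 0` ALTHOUGH `H̃_2(K_0) > 0` — the proof's intermediate inequality
fails at `k = 2` even though the conclusion of Theorem 1 holds there for this kernel.
[cite: DimitrovLucas2011, p. 1021 and (9)] -/
theorem dlJ_K_zero_two_neg : dlJ (kernelMoment (K 0)) 2 < 0 ∧ 0 < dlHtilde (kernelMoment (K 0)) 2 := by
  have hπ4 : 0 < (Real.sqrt π / 2) ^ 4 := by positivity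
  rw [kernelMoment_K_zero_eq', dlJ_const_mul, dlHtilde_const_mul]
  constructor
  · refine mul_neg_of_pos_of_neg hπ4 ?_
    norm_num [dlJ, dlT, dlU, qSeq, Nat.factorial]
  · refine mul_pos hπ4 ?_
    norm_num [dlHtilde, qSeq, Nat.factorial]

/-- `b ↦ J_2(b)` is continuous (a polynomial in `b₁, …, b₄`). [folklore] -/
private theorem continuous_dlJ_two : Continuous fun b : ℕ → ℝ => dlJ b 2 := by
  unfold dlJ dlT dlU
  fun_prop

/-- `b ↦ H̃_2(b)` is continuous. [folklore] -/
private theorem continuous_dlHtilde_two : Continuous fun b : ℕ → ℝ => dlHtilde b 2 := by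
  unfold dlHtilde
  fun_prop

/-- For all sufficiently small `ε ≥ 0`: `J_2(K_ε) < 0 < H̃_2(K_ε)` (dominated convergence from
`ε = 0`). [cite: DimitrovLucas2011, p. 1021 and (9)] -/
theorem eventually_dlJ_K_two_neg :
    ∀ᶠ ε in 𝓝[Ici 0] (0 : ℝ), dlJ (kernelMoment (K ε)) 2 < 0 ∧ 0 < dlHtilde (kernelMoment (K ε)) 2 := by
  have h1 : Tendsto (fun ε : ℝ => dlJ (kernelMoment (K ε)) 2) (𝓝[Ici 0] 0)
      (𝓝 (dlJ (kernelMoment (K 0)) 2)) :=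
    (continuous_dlJ_two.tendsto _).comp tendsto_kernelMoment_K
  have h2 : Tendsto (fun ε : ℝ => dlHtilde (kernelMoment (K ε)) 2) (𝓝[Ici 0] 0)
      (𝓝 (dlHtilde (kernelMoment (K 0)) 2)) :=
    (continuous_dlHtilde_two.tendsto _).comp tendsto_kernelMoment_K
  exact (h1.eventually (gt_mem_nhds dlJ_K_zero_two_neg.1)).and
    (h2.eventually (lt_mem_nhds dlJ_K_zero_two_neg.2))

/-- **There is `ε > 0` with `H̃_1(K_ε) < 0` and `J_2(K_ε) < 0 < H̃_2(K_ε)`** (one admissible kernel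
carrying all the sign patterns of this section). [cite: DimitrovLucas2011, Theorem 1 and p. 1021] -/
theorem exists_pos_dlHtilde_neg_dlJ_two_neg :
    ∃ ε : ℝ, 0 < ε ∧ dlHtilde (kernelMoment (K ε)) 1 < 0 ∧
      dlJ (kernelMoment (K ε)) 2 < 0 ∧ 0 < dlHtilde (kernelMoment (K ε)) 2 := by
  have h : ∀ᶠ ε in 𝓝[>] (0 : ℝ), (dlHtilde (kernelMoment (K ε)) 1 < 0 ∧ 0 < kernelMoment (K ε) 3) ∧
      (dlJ (kernelMoment (K ε)) 2 < 0 ∧ 0 < dlHtilde (kernelMoment (K ε)) 2) :=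
    (eventually_dlHtilde_K_neg.and eventually_dlJ_K_two_neg).filter_mono
      (nhdsWithin_mono _ Ioi_subset_Ici_self)
  obtain ⟨ε, ⟨⟨hH, -⟩, hJ, hH2⟩, hε⟩ := (h.and self_mem_nhdsWithin).exists
  exact ⟨ε, hε, hH, hJ, hH2⟩

end LogConcaveKernel

/-- **The printed proof of Theorem 1 fails at its own intermediate inequality, and so does its
closing remark.** There is an admissible kernel (Definition 1 (i)–(v), with an entire extension and
`δ = 1`) with `(log K(√s))″ < 0` on `(0,∞)` (and `−K′/(tK)` strictly increasing) whose half-line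
moments `b = (∫₀^∞ t^{2m}K)_m` satisfy: `T_1(b) > 0`, `T_2(b) > 0` (as they must, by the positive
side) but `J_1(b) < 0` — against "`J_k > 0`" (p. 1021) — and `H̃_1(b) < 8T_1(b)T_2(b)` — against
"the logarithmic concavity of the kernel `K(√t)` on the positive real axes implies the stronger
inequalities `H̃_k > 8T_kT_{k+1}`" (p. 1021); moreover `J_2(b) < 0` although `H̃_2(b) > 0`. Witness:
`K_ε = e^{−t²−εt⁴}(1 + t²/10 + 49t⁴/10⁴)` for a suitable `ε > 0`; mechanism at `k = 1`:
`H̃_1 < 0 < T_1T_2` and `H̃_1 − 8T_1T_2 = 3J_1`; at `k = 2`: exact values at `ε = 0` and continuity.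
(All quantities are homogeneous in `b`, so the same signs hold for the full-line moments of
Theorem 1: `not_dimitrovLucas2011_Jpos`, `not_dimitrovLucas2011_strongerIneq`.)
[cite: DimitrovLucas2011, p. 1021 and (12)] -/
theorem exists_admissible_dlJ_neg :
    ∃ K : ℝ → ℝ, (∀ t, 0 < K t) ∧ (∃ F : ℂ → ℂ, Differentiable ℂ F ∧ ∀ t : ℝ, F t = K t) ∧
      (∀ t, K (-t) = K t) ∧ (∀ t, 0 < t → deriv K t < 0) ∧
      (∃ δ : ℝ, 0 < δ ∧ ∀ n : ℕ, iteratedDeriv n K =O[atTop] fun t => Real.exp (-|t| ^ (2 + δ))) ∧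
      (∀ s, 0 < s → deriv^[2] (fun s => Real.log (K (Real.sqrt s))) s < 0) ∧
      StrictMonoOn (fun t => -deriv K t / (t * K t)) (Ioi 0) ∧
      0 < dlT (kernelMoment K) 1 ∧ 0 < dlT (kernelMoment K) 2 ∧ dlJ (kernelMoment K) 1 < 0 ∧
      dlHtilde (kernelMoment K) 1 < 8 * (dlT (kernelMoment K) 1 * dlT (kernelMoment K) 2) ∧
      dlJ (kernelMoment K) 2 < 0 ∧ 0 < dlHtilde (kernelMoment K) 2 := by
  obtain ⟨ε, hε, hH, hJ2, hH2⟩ := exists_pos_dlHtilde_neg_dlJ_two_neg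
  have h1 : 0 < dlT (kernelMoment (K ε)) 1 := dlT_K_pos hε le_rfl
  have h2 : 0 < dlT (kernelMoment (K ε)) 2 := dlT_K_pos hε (by norm_num)
  have h12 := mul_pos h1 h2
  have hid := dlHtilde_sub_eight_mul_dlT (kernelMoment (K ε)) 1
  simp only [Nat.cast_one] at hid
  refine ⟨K ε, K_pos ε, ⟨KC ε, differentiable_KC ε, fun t => KC_ofReal ε t⟩, K_even ε,
    fun t ht => deriv_K_neg hε.le ht, ⟨1, one_pos, fun n => iteratedDeriv_K_isBigO_rpow hε n⟩,
    fun s hs => deriv2_log_K_sqrt_neg hε.le hs, strictMonoOn_neg_deriv_K_div hε.le, h1, h2, ?_, ?_,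
    hJ2, hH2⟩
  · linarith
  · linarith

/-- **The intermediate inequality `J_k > 0` of the printed proof (p. 1021) is false in general**: it
is NOT the case that for every admissible kernel `K` (Definition 1, here even with an entire
extension) with `(log K(√t))″ < 0` for `t > 0` and `b_k = ∫_{−∞}^{∞} t^{2k}K(t) dt` one has
`J_k(b) > 0` for every `k ≥ 1` — already `J_1 < 0` (and `J_2 < 0`) for the witness of
`JensenPolynomialsLogConcaveKernel`. [cite: DimitrovLucas2011, p. 1021] -/
theorem not_dimitrovLucas2011_Jpos :
    ¬ ∀ K : ℝ → ℝ, (∀ t, 0 < K t) → (∃ F : ℂ → ℂ, Differentiable ℂ F ∧ ∀ t : ℝ, F t = K t) →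
        (∀ t, K (-t) = K t) → (∀ t, 0 < t → deriv K t < 0) →
        (∃ δ : ℝ, 0 < δ ∧ ∀ n : ℕ, iteratedDeriv n K =O[atTop] fun t => Real.exp (-|t| ^ (2 + δ))) →
        (∀ s, 0 < s → deriv^[2] (fun s => Real.log (K (Real.sqrt s))) s < 0) →
        ∀ k : ℕ, 1 ≤ k → 0 < dlJ (fun m => ∫ t, K t * t ^ (2 * m)) k := by
  intro h
  obtain ⟨K, h1, h2, h3, h4, h5, h6, -, -, -, hJ, -⟩ := exists_admissible_dlJ_neg
  have h := h K h1 h2 h3 h4 h5 h6 1 le_rfl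
  have e : (fun m => ∫ t, K t * t ^ (2 * m)) = fun m => 2 * kernelMoment K m :=
    funext (integral_even_mul_pow_eq h3)
  rw [e, dlJ_const_mul] at h
  linarith

/-- **The closing remark of Dimitrov–Lucas' proof is false as stated**: it is NOT the case that for
every admissible kernel `K` (Definition 1, here even with an entire extension) with
`(log K(√t))″ < 0` for `t > 0` the moments `b_k = ∫_{−∞}^{∞} t^{2k}K(t) dt` satisfy the "stronger
inequalities" `H̃_k > 8T_kT_{k+1}` for every `k ≥ 1` ("It is worth noting that we have proven that
the logarithmic concavity of the kernel `K(√t)` on the positive real axes implies the stronger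
inequalities `H̃_k > 8T_kT_{k+1}`", p. 1021). [cite: DimitrovLucas2011, p. 1021] -/
theorem not_dimitrovLucas2011_strongerIneq :
    ¬ ∀ K : ℝ → ℝ, (∀ t, 0 < K t) → (∃ F : ℂ → ℂ, Differentiable ℂ F ∧ ∀ t : ℝ, F t = K t) →
        (∀ t, K (-t) = K t) → (∀ t, 0 < t → deriv K t < 0) →
        (∃ δ : ℝ, 0 < δ ∧ ∀ n : ℕ, iteratedDeriv n K =O[atTop] fun t => Real.exp (-|t| ^ (2 + δ))) →
        (∀ s, 0 < s → deriv^[2] (fun s => Real.log (K (Real.sqrt s))) s < 0) →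
        ∀ k : ℕ, 1 ≤ k →
          8 * (dlT (fun m => ∫ t, K t * t ^ (2 * m)) k * dlT (fun m => ∫ t, K t * t ^ (2 * m)) (k + 1)) <
            dlHtilde (fun m => ∫ t, K t * t ^ (2 * m)) k := by
  intro h
  obtain ⟨K, h1, h2, h3, h4, h5, h6, -, -, -, -, hlt, -⟩ := exists_admissible_dlJ_neg
  have h := h K h1 h2 h3 h4 h5 h6 1 le_rfl
  have e : (fun m => ∫ t, K t * t ^ (2 * m)) = fun m => 2 * kernelMoment K m :=
    funext (integral_even_mul_pow_eq h3)
  rw [e, dlHtilde_const_mul, dlT_const_mul, dlT_const_mul] at h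
  linarith

/-! ## The full Jensen grid of `K_0` in closed form (appended 2026-08-26, rh-jensen-barrier-1 g3)

Scope caveat (b) of the barrier, closed: the Taylor sequence of the `ε = 0` witness is
`γ_m(K_0) = (√π/2)4^{−m}q(m)` with `q` QUADRATIC in `m` (`kernelTaylorSeq_K_zero`), hence (Newton
expansion `q(n+j) = q(n) + Δq(n)j + (49/10⁴)j(j−1)`, `qSeq_add`, and the binomial identities
`Σ (d choose j)X^j = (X+1)^d`, `Σ j(d choose j)X^j = dX(X+1)^{d−1}`, `Σ j(j−1)(d choose j)X^j =
d(d−1)X²(X+1)^{d−2}`) every Jensen polynomial factors as `J^{e+2,n}_q = (X+1)^e · Q_{e,n}` with ONE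
quadratic cofactor (`jensenPoly_qSeq_eq`), whose discriminant is `(e+2)·L(e+2,n)/10⁸` with the
CORNER FORM `L(d,n) = (9604n − 749594)d + 9604n² + 215208n + 2065203` (`discrim_quadFactor`). So the
cell `(d,n)` of `K_0` is hyperbolic iff `L(d,n) ≥ 0` (`splits_jensenPoly_K_zero_iff`), i.e. iff
`n ≥ 79` or `d < d(n) = ⌊(9604n² + 215208n + 2065203)/(749594 − 9604n)⌋ + 1`
(`splits_jensenPoly_K_zero_iff_lt_cornerThreshold`); `d(n) = 3,4,4,4,5,5,6,6,7,8,8,9,…`, `d(78) =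
160337` (`cornerThreshold_values`, exact integer arithmetic), nondecreasing (`cornerThreshold_mono`).
The non-hyperbolic cells of `K_0` are therefore EXACTLY the finite-height staircase
`{(d,n) : n ≤ 78, d ≥ d(n)}` (`not_splits_jensenPoly_K_zero_iff`): rh-jensen-idea-1's numerical
"corner `d ≥ d(n)`, `d(n) = 3,4,4,4,5,…`" (F1, `dl-counterexample/witness.py`) as a theorem, with the
correction that rows `n ≥ 79` are entirely hyperbolic (`splits_jensenPoly_K_zero_of_le`; as they must
be: `F₁^{(n)} = e^{x/4}·(quadratic)` becomes hyperbolic under differentiation). Nothing here is about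
the admissible members `ε > 0` (whose grids are perturbations of this one, cell by cell, by
`continuousWithinAt_kernelMoment_K`) or about `Ξ`. -/

/-- A real quadratic `aX² + bX + c` (`a ≠ 0`) is hyperbolic (splits over `ℝ`) iff its discriminant
`b² − 4ac` is nonnegative (over a general field: iff the discriminant is a square, cf.
`WeierstrassCurve.splits_quadratic_iff_isSquare_discrim` in
`Literature/NumberTheory/EllipticCurves/QuadraticTwistLocalPolynomialProofs.lean`; over `ℝ` a square is
the same as a nonnegative real, and importing that file here would be a detour); Dimitrov–Lucas p. 1015:
Turán's inequalities "are in fact necessary and sufficient conditions for the second degree generalized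
Jensen polynomials to be hyperbolic". [cite: DimitrovLucas2011, p. 1015] -/
theorem splits_quadratic_iff_discrim_nonneg {a b c : ℝ} (ha : a ≠ 0) :
    (C a * X ^ 2 + C b * X + C c).Splits ↔ 0 ≤ discrim a b c := by
  have hdeg : (C a * X ^ 2 + C b * X + C c).natDegree = 2 := natDegree_quadratic ha
  have hev : ∀ x : ℝ, (C a * X ^ 2 + C b * X + C c).eval x = a * (x * x) + b * x + c := by
    intro x; simp only [eval_add, eval_mul, eval_C, eval_pow, eval_X]; ring
  constructor
  · intro h
    have hd : (C a * X ^ 2 + C b * X + C c).degree ≠ 0 := by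
      rw [degree_eq_natDegree (ne_zero_of_natDegree_gt (n := 1) (by omega)), hdeg]; norm_num
    obtain ⟨x, hx⟩ := h.exists_eval_eq_zero hd
    rw [hev] at hx
    rw [discrim_eq_sq_of_quadratic_eq_zero hx]
    positivity
  · intro h
    obtain ⟨x, hx⟩ := exists_quadratic_eq_zero ha ⟨Real.sqrt (discrim a b c), (Real.mul_self_sqrt h).symm⟩
    exact Splits.of_natDegree_eq_two hdeg (by rw [hev, hx])

namespace LogConcaveKernel

/-- The first difference of the quadratic sequence `q`: `q(m+1) − q(m) = 1/10 + 49(2m+3)/10⁴`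
(its second difference is the constant `2·49/10⁴`). [folklore] -/
def dqSeq (n : ℕ) : ℝ := 1 / 10 + 49 / 10000 * (2 * (n : ℝ) + 3)

/-- Newton expansion of the quadratic `q` at `n`: `q(n+j) = q(n) + Δq(n)·j + (49/10⁴)·j(j−1)`. [folklore] -/
private theorem qSeq_add (n j : ℕ) :
    qSeq (n + j) = qSeq n + dqSeq n * j + 49 / 10000 * ((j : ℝ) * ((j : ℝ) - 1)) := by
  simp only [qSeq, dqSeq]; push_cast; ring

/-- The quadratic cofactor `Q_{e,n} = q(n)(X+1)² + (e+2)Δq(n)·X(X+1) + (49/10⁴)(e+2)(e+1)X²` of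
`J^{e+2,n}_q = (X+1)^e · Q_{e,n}`, written out in the monomial basis. [folklore] -/
def quadFactor (e n : ℕ) : ℝ[X] :=
  C (qSeq n + dqSeq n * ((e : ℝ) + 2) + 49 / 10000 * (((e : ℝ) + 2) * ((e : ℝ) + 1))) * X ^ 2 +
    C (2 * qSeq n + dqSeq n * ((e : ℝ) + 2)) * X + C (qSeq n)

/-- **Factorisation of the whole Jensen grid of `q`**: for every degree `d = e + 2 ≥ 2` and shift
`n`, `J^{e+2,n}_q = (X+1)^e · Q_{e,n}` — because `q` is a QUADRATIC in `m`,
`Σ_j (d choose j)(α + βj + cj(j−1))X^j = α(X+1)^d + βdX(X+1)^{d−1} + cd(d−1)X²(X+1)^{d−2}`. So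
`−1` is a zero of multiplicity `≥ d − 2` of every `J^{d,n}_q`, and hyperbolicity of the cell
`(d,n)` is decided by ONE quadratic (the `g_{n,k}` of Dimitrov–Lucas (4) for the witness sequence).
[cite: DimitrovLucas2011, (4)] -/
theorem jensenPoly_qSeq_eq (e n : ℕ) : jensenPoly qSeq (e + 2) n = (X + 1) ^ e * quadFactor e n := by
  ext k
  have hR : (X + 1) ^ e * quadFactor e n =
      C (qSeq n + dqSeq n * ((e : ℝ) + 2) + 49 / 10000 * (((e : ℝ) + 2) * ((e : ℝ) + 1))) *
          ((X + 1) ^ e * X ^ 2) +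
        C (2 * qSeq n + dqSeq n * ((e : ℝ) + 2)) * ((X + 1) ^ e * X ^ 1) + C (qSeq n) * (X + 1) ^ e := by
    rw [quadFactor, pow_one]; ring
  rw [hR, coeff_jensenPoly, coeff_add, coeff_add, coeff_C_mul, coeff_C_mul, coeff_C_mul,
    coeff_mul_X_pow', coeff_mul_X_pow', coeff_X_add_one_pow]
  rcases k with _ | _ | k
  · simp [coeff_X_add_one_pow]
  · simp only [zero_add, show 0 + 1 ≤ e + 2 from by omega, if_true, Nat.choose_one_right,
      show ¬ (2 ≤ 0 + 1) from by omega, if_false, le_refl, Nat.sub_self, coeff_X_add_one_pow,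
      Nat.choose_zero_right, Nat.choose_one_right, Nat.cast_one, mul_zero, zero_add]
    have h0 := qSeq_add n 1
    push_cast at h0 ⊢
    linear_combination ((e : ℝ) + 2) * h0
  · simp only [show 2 ≤ k + 2 from by omega, show 1 ≤ k + 2 from by omega, if_true,
      show k + 2 - 2 = k from by omega, show k + 2 - 1 = k + 1 from by omega, coeff_X_add_one_pow]
    by_cases hk : k ≤ e
    · rw [if_pos (by omega)]
      have h0 := qSeq_add n (k + 2)
      -- binomial identities, cast to ℝ
      have h1 : ((e + 2).choose (k + 2) : ℝ) =
          (e.choose k : ℝ) + 2 * (e.choose (k + 1) : ℝ) + (e.choose (k + 2) : ℝ) := by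
        have := Nat.choose_succ_succ' (e + 1) (k + 1)
        have h' := Nat.choose_succ_succ' e k
        have h'' := Nat.choose_succ_succ' e (k + 1)
        push_cast [this, h', h'']
        ring
      have h2 : ((k : ℝ) + 2) * ((e + 2).choose (k + 2) : ℝ) =
          ((e : ℝ) + 2) * ((e.choose k : ℝ) + (e.choose (k + 1) : ℝ)) := by
        have := Nat.add_one_mul_choose_eq (e + 1) (k + 1)
        have h' := Nat.choose_succ_succ' e k
        have hc : ((e + 1 + 1) : ℝ) * ((e + 1).choose (k + 1) : ℝ) =
            ((e + 1 + 1).choose (k + 1 + 1) : ℝ) * ((k : ℝ) + 1 + 1) := by exact_mod_cast this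
        push_cast [h'] at hc
        linear_combination -hc
      have h3 : ((k : ℝ) + 2) * ((k : ℝ) + 1) * ((e + 2).choose (k + 2) : ℝ) =
          ((e : ℝ) + 2) * ((e : ℝ) + 1) * (e.choose k : ℝ) := by
        have ha := Nat.add_one_mul_choose_eq (e + 1) (k + 1)
        have hb := Nat.add_one_mul_choose_eq e k
        have hc : ((e + 1 + 1) : ℝ) * ((e + 1).choose (k + 1) : ℝ) =
            ((e + 1 + 1).choose (k + 1 + 1) : ℝ) * ((k : ℝ) + 1 + 1) := by exact_mod_cast ha
        have hd : ((e + 1) : ℝ) * (e.choose k : ℝ) =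
            ((e + 1).choose (k + 1) : ℝ) * ((k : ℝ) + 1) := by exact_mod_cast hb
        linear_combination -((k : ℝ) + 1) * hc - ((e : ℝ) + 2) * hd
      rw [show n + (k + 2) = n + (k + 2) from rfl, h0]
      push_cast
      linear_combination (qSeq n) * h1 + (dqSeq n) * h2 + (49 / 10000 : ℝ) * h3
    · rw [if_neg (by omega), Nat.choose_eq_zero_of_lt (by omega : e < k),
        Nat.choose_eq_zero_of_lt (by omega : e < k + 1), Nat.choose_eq_zero_of_lt (by omega : e < k + 2)]
      simp

/-- The closed form of the discriminant of `Q_{d−2,n}` (times `10⁸/d`): the CORNER FORM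
`L(d,n) = (9604n − 749594)·d + 9604n² + 215208n + 2065203`. [folklore] -/
def cornerForm (d n : ℕ) : ℝ :=
  (9604 * (n : ℝ) - 749594) * d + 9604 * (n : ℝ) ^ 2 + 215208 * n + 2065203

/-- `disc Q_{e,n} = (e+2)·L(e+2,n)/10⁸`. [folklore] -/
private theorem discrim_quadFactor (e n : ℕ) :
    discrim (qSeq n + dqSeq n * ((e : ℝ) + 2) + 49 / 10000 * (((e : ℝ) + 2) * ((e : ℝ) + 1)))
        (2 * qSeq n + dqSeq n * ((e : ℝ) + 2)) (qSeq n) =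
      ((e : ℝ) + 2) * cornerForm (e + 2) n / 10 ^ 8 := by
  simp only [discrim, cornerForm, qSeq, dqSeq]; push_cast; ring

/-- **Hyperbolicity of every cell of `q`'s Jensen grid, decided**: for `d ≥ 2`,
`J^{d,n}_q` is hyperbolic iff `L(d,n) ≥ 0`. [folklore] -/
private theorem splits_jensenPoly_qSeq_iff_two_le (e n : ℕ) :
    (jensenPoly qSeq (e + 2) n).Splits ↔ 0 ≤ cornerForm (e + 2) n := by
  have hlead : qSeq n + dqSeq n * ((e : ℝ) + 2) + 49 / 10000 * (((e : ℝ) + 2) * ((e : ℝ) + 1)) ≠ 0 := by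
    have h1 : 0 < qSeq n := by unfold qSeq; positivity
    have h2 : 0 ≤ dqSeq n * ((e : ℝ) + 2) := by unfold dqSeq; positivity
    positivity
  have hne : ((X : ℝ[X]) + 1) ^ e ≠ 0 := by
    apply pow_ne_zero; rw [← C_1]; exact X_add_C_ne_zero 1
  have hsp : (((X : ℝ[X]) + 1) ^ e).Splits := by
    simpa using (Splits.X_add_C (1 : ℝ)).pow e
  rw [jensenPoly_qSeq_eq, splits_mul_iff_right hne hsp, quadFactor,
    splits_quadratic_iff_discrim_nonneg hlead, discrim_quadFactor]
  constructor
  · intro h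
    by_contra hL
    rw [not_le] at hL
    have : ((e : ℝ) + 2) * cornerForm (e + 2) n / 10 ^ 8 < 0 :=
      div_neg_of_neg_of_pos (mul_neg_of_pos_of_neg (by positivity) hL) (by positivity)
    linarith
  · intro h
    exact div_nonneg (mul_nonneg (by positivity) h) (by positivity)

/-- The same for every degree: `J^{d,n}_q` is hyperbolic iff `L(d,n) ≥ 0` (for `d ≤ 1` both sides
hold: `L(0,n), L(1,n) > 0`); hyperbolicity of the `g_{n,k}` of (4) for the witness sequence `q`,
the subject of Lemma 1 / Theorem 1 there. [cite: DimitrovLucas2011, (4) and Lemma 1] -/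
theorem splits_jensenPoly_qSeq_iff (d n : ℕ) : (jensenPoly qSeq d n).Splits ↔ 0 ≤ cornerForm d n := by
  rcases d with _ | _ | e
  · refine ⟨fun _ => ?_, fun _ => Splits.of_natDegree_le_one
      ((Literature.Analysis.Complex.PolyaSchur.natDegree_jensenPoly_le qSeq 0 n).trans (by norm_num))⟩
    simp only [cornerForm, Nat.cast_zero, mul_zero, zero_add]; positivity
  · refine ⟨fun _ => ?_, fun _ => Splits.of_natDegree_le_one (Literature.Analysis.Complex.PolyaSchur.natDegree_jensenPoly_le qSeq 1 n)⟩
    have : cornerForm 1 n = 9604 * (n : ℝ) ^ 2 + 224812 * n + 1315609 := by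
      simp only [cornerForm]; push_cast; ring
    rw [this]; positivity
  · exact splits_jensenPoly_qSeq_iff_two_le e n

/-- **The Jensen grid of `K_0`, decided cell by cell**: `J^{d,n}` of the Taylor sequence
`γ_m(K_0) = (√π/2)4^{−m}q(m)` is hyperbolic iff `L(d,n) = (9604n − 749594)d + 9604n² + 215208n +
2065203 ≥ 0` (geometric rescaling `splits_jensenPoly_const_mul_pow_mul_iff` + the grid of `q`): the
exact extent to which the conclusion of Theorem 1 (hyperbolicity beyond row `2`) fails for the
`ε = 0` witness. [cite: DimitrovLucas2011, (4) and Theorem 1] -/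
theorem splits_jensenPoly_K_zero_iff (d n : ℕ) :
    (jensenPoly (kernelTaylorSeq (K 0)) d n).Splits ↔ 0 ≤ cornerForm d n := by
  rw [show kernelTaylorSeq (K 0) = fun m => Real.sqrt π / 2 * (1 / 4) ^ m * qSeq m from
      funext kernelTaylorSeq_K_zero,
    splits_jensenPoly_const_mul_pow_mul_iff (by positivity) (by norm_num) qSeq d n]
  exact splits_jensenPoly_qSeq_iff d n

/-- The degree threshold of row `n` (meaningful for `n ≤ 78`):
`d(n) = ⌊(9604n² + 215208n + 2065203)/(749594 − 9604n)⌋ + 1`; `d(0), d(1), … = 3, 4, 4, 4, 5, 5, 6,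
6, 7, 8, 8, 9, …`, `d(78) = 160337` (`cornerThreshold_values`). [folklore] -/
def cornerThreshold (n : ℕ) : ℕ := (9604 * n ^ 2 + 215208 * n + 2065203) / (749594 - 9604 * n) + 1

/-- The first thresholds: `d(0..11) = 3,4,4,4,5,5,6,6,7,8,8,9` (idea-1's table `3,4,4,4,5,…`) and the
last one `d(78) = 160337` (exact integer arithmetic on the thresholds of the witness grid (4)).
[cite: DimitrovLucas2011, (4)] -/
theorem cornerThreshold_values :
    cornerThreshold 0 = 3 ∧ cornerThreshold 1 = 4 ∧ cornerThreshold 2 = 4 ∧ cornerThreshold 3 = 4 ∧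
      cornerThreshold 4 = 5 ∧ cornerThreshold 5 = 5 ∧ cornerThreshold 6 = 6 ∧ cornerThreshold 7 = 6 ∧
      cornerThreshold 8 = 7 ∧ cornerThreshold 9 = 8 ∧ cornerThreshold 10 = 8 ∧
      cornerThreshold 11 = 9 ∧ cornerThreshold 78 = 160337 := by
  simp only [cornerThreshold]
  norm_num

/-- `d(n)` is nondecreasing on `n ≤ 78` (numerator increasing, denominator decreasing), so the
non-hyperbolic cells of each column `d` form an interval of rows and the bad set is a staircase.
[cite: DimitrovLucas2011, (4)] -/
theorem cornerThreshold_mono {m n : ℕ} (hmn : m ≤ n) (hn : n ≤ 78) :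
    cornerThreshold m ≤ cornerThreshold n := by
  unfold cornerThreshold
  have hD : 749594 - 9604 * n ≤ 749594 - 9604 * m := by omega
  have hDpos : 0 < 749594 - 9604 * n := by omega
  have hN : 9604 * m ^ 2 + 215208 * m + 2065203 ≤ 9604 * n ^ 2 + 215208 * n + 2065203 := by
    have := Nat.pow_le_pow_left hmn 2
    omega
  exact Nat.succ_le_succ ((Nat.div_le_div_left hD hDpos).trans (Nat.div_le_div_right hN))

/-- **The exact set of non-hyperbolic cells of `K_0`** (the "corner" of rh-jensen-idea-1's F1,
which turns out to have finite height): `J^{d,n}` of `γ(K_0)` is hyperbolic iff `n ≥ 79` or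
`d < d(n)`. Rows `n ≥ 79` are ENTIRELY hyperbolic (differentiating `e^{x/4}·(quadratic)` 79 times
makes it hyperbolic: `disc_n = b² − 4ac + 64a²n` grows), and in row `n ≤ 78` exactly the degrees
`d ≥ d(n)` fail, `d(n) ↑ 160337`. [cite: DimitrovLucas2011, (4) and Theorem 1] -/
theorem splits_jensenPoly_K_zero_iff_lt_cornerThreshold (d n : ℕ) :
    (jensenPoly (kernelTaylorSeq (K 0)) d n).Splits ↔ 79 ≤ n ∨ d < cornerThreshold n := by
  rw [splits_jensenPoly_K_zero_iff, cornerForm]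
  by_cases hn : 79 ≤ n
  · have hn' : (79 : ℝ) ≤ n := by exact_mod_cast hn
    refine ⟨fun _ => Or.inl hn, fun _ => ?_⟩
    have h1 : (0 : ℝ) ≤ 9604 * (n : ℝ) - 749594 := by linarith
    positivity
  · rw [not_le] at hn
    simp only [show ¬ 79 ≤ n from not_le.2 hn, false_or, cornerThreshold, Nat.lt_succ_iff]
    have hDpos : 0 < 749594 - 9604 * n := by omega
    rw [Nat.le_div_iff_mul_le hDpos]
    have hcast : ((749594 - 9604 * n : ℕ) : ℝ) = 749594 - 9604 * (n : ℝ) := by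
      rw [Nat.cast_sub (by omega)]; push_cast; ring
    constructor
    · intro h
      have h' : (d : ℝ) * (749594 - 9604 * (n : ℝ)) ≤ 9604 * (n : ℝ) ^ 2 + 215208 * n + 2065203 := by
        linarith
      rw [← hcast] at h'
      exact_mod_cast h'
    · intro h
      have h' : ((d * (749594 - 9604 * n) : ℕ) : ℝ) ≤ ((9604 * n ^ 2 + 215208 * n + 2065203 : ℕ) : ℝ) := by
        exact_mod_cast h
      push_cast [Nat.cast_sub (show 9604 * n ≤ 749594 by omega)] at h'
      linarith

/-- Rows `n ≥ 79` of `K_0`'s Jensen grid are hyperbolic in every degree. [cite: DimitrovLucas2011, (4)] -/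
theorem splits_jensenPoly_K_zero_of_le {n : ℕ} (hn : 79 ≤ n) (d : ℕ) :
    (jensenPoly (kernelTaylorSeq (K 0)) d n).Splits :=
  (splits_jensenPoly_K_zero_iff_lt_cornerThreshold d n).2 (Or.inl hn)

/-- In row `n ≤ 78` the non-hyperbolic cells are exactly the degrees `d ≥ d(n)`; in particular
every column `d ≥ 3` contains a non-hyperbolic cell (`(d, 0)`), and `(3,0)` is the corner's tip
(`not_splits_jensenPoly_K_zero_three`). [cite: DimitrovLucas2011, Theorem 1 and Lemma 1] -/
theorem not_splits_jensenPoly_K_zero_iff (d n : ℕ) :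
    ¬ (jensenPoly (kernelTaylorSeq (K 0)) d n).Splits ↔ n ≤ 78 ∧ cornerThreshold n ≤ d := by
  rw [splits_jensenPoly_K_zero_iff_lt_cornerThreshold]; omega

end LogConcaveKernel

/-! ## The explicit admissible kernel `K_β`: the cell's number `H̃_1(K_β) = −1.12249·10⁻⁵`, kernel-certified (appended 2026-08-26, rh-jensen-barrier-1 g3)

The barrier theorem above reaches an admissible witness by a limit (`K_ε`, SOME small `ε > 0`,
dominated convergence from the exact `ε = 0` grid). This section pins ONE explicit admissible
kernel — the `K_β(t) = exp(−t² − t⁴/1000)·(1 + t²/20 + 17t⁴/8000)` of rh-jensen-idea-1's F2 and of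
the referee sheet DLREF-1 (four concurring enclosures of `H̃_1(K_β) = −1.1224861613953145·10⁻⁵`,
full-line moments) — and certifies IN THE KERNEL, by exact rational arithmetic, that
`−1.13732·10⁻⁶·π² < H̃_1(K_β) < −1.13731·10⁻⁶·π²` (`ExplicitKernel.dlHtilde_Kb_one_fullLine_mem`;
half-line: `dlHtilde_Kb_one_mem`, `/16`), together with every hypothesis of Theorem 1 for `K_β`
(`ExplicitKernel.Kb_admissible`: (i)–(v) with an entire extension and `δ = 1`, (8) with the referees'
margin `(log K_β(√s))″ ≤ −1/4000`, `deriv2_log_Kb_sqrt_le`, and the tree's monotone shape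
`strictMonoOn_neg_deriv_Kb_div` — here `2·(17/8000) > (1/20)²`, so unlike the `K_ε` family the
polynomial factor alone is NOT log-concave in `s` and the quartic term carries the concavity).
Consequences: `not_splits_jensenPoly_Kb_three` (cell `(3,0)` of `K_β` not hyperbolic),
`jensenPolynomialsLogConcaveKernel_of_Kb` (the barrier with an explicit, limit-free witness),
`dlT_Kb_pos` (row 2, positive side) and `dlJ_Kb_one_neg` (`J_1(K_β) < 0`, `H̃_1 < 8T_1T_2`).
Method (`ExplicitKernel.dlHtilde_Kb_one_mem`): the alternating Taylor sandwich
`S_7(x) ≤ e^{−x} ≤ S_6(x)` for `x = t⁴/1000 ≥ 0` (`expNegTaylor_alternating`, by induction through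
`S_{n+1}′ = −S_n` and monotonicity), integrated against `e^{−t²}P_β(t²)t^{2m}` with the exact Gaussian
moments `∫₀^∞ t^{2k}e^{−t²} = (√π/2)·4^{−k}(2k)!/k!` (`integral_taylorIntegrand`), gives two-sided
rational enclosures of `b_0, …, b_3` in units of `√π/2` (`kernelMoment_Kb_le`, `le_kernelMoment_Kb`,
widths `≤ 3·10⁻¹¹`); monotone interval arithmetic on `20T_1T_2 − 3U_1²` (`dlHtilde_one_le_of_bounds`)
and `norm_num` on the resulting ~100-digit rationals finish. No floating point anywhere; a third
enclosure mechanism next to DLREF-1's Arb ball arithmetic and exact-rational Taylor remainders. -/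

/-! ## Alternating Taylor bounds for `e^{-x}`, `x ≥ 0` -/

/-- The Taylor partial sums of `e^{−x}`: `S_n(x) = Σ_{j ≤ n} (−x)^j/j!`. [folklore] -/
def expNegTaylor (n : ℕ) (x : ℝ) : ℝ := ∑ j ∈ Finset.range (n + 1), (-x) ^ j / (j ! : ℝ)

/-- `S_n(0) = 1`. [folklore] -/
private theorem expNegTaylor_zero_right (n : ℕ) : expNegTaylor n 0 = 1 := by
  unfold expNegTaylor
  rw [Finset.sum_range_succ']
  simp

/-- `S_{n+1}′ = −S_n`. [folklore] -/
private theorem hasDerivAt_expNegTaylor_succ (n : ℕ) (x : ℝ) :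
    HasDerivAt (expNegTaylor (n + 1)) (-expNegTaylor n x) x := by
  have h : ∀ j ∈ Finset.range (n + 1 + 1), HasDerivAt (fun x : ℝ => (-x) ^ j / (j ! : ℝ))
      ((j : ℝ) * (-x) ^ (j - 1) * (-1) / (j ! : ℝ)) x := by
    intro j _
    exact ((hasDerivAt_neg x).pow j).div_const _
  have hs := HasDerivAt.fun_sum h
  have e : (fun y : ℝ => ∑ j ∈ Finset.range (n + 1 + 1), (-y) ^ j / (j ! : ℝ)) = expNegTaylor (n + 1) := by
    funext y; rfl
  rw [e] at hs
  refine hs.congr_deriv ?_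
  rw [Finset.sum_range_succ', expNegTaylor, ← Finset.sum_neg_distrib]
  simp only [Nat.cast_zero, zero_mul, zero_div, add_zero, Nat.add_sub_cancel]
  refine Finset.sum_congr rfl fun j _ => ?_
  rw [Nat.factorial_succ, Nat.cast_mul, Nat.cast_succ]
  have hj : ((j : ℝ) + 1) ≠ 0 := by positivity
  have hf : (j ! : ℝ) ≠ 0 := by positivity
  field_simp

/-- **Alternating bounds**: `(−1)^n (S_n(x) − e^{−x}) ≥ 0` for `x ≥ 0` (the even partial sums are
above `e^{−x}`, the odd ones below), by induction: the derivative of `(−1)^{n+1}(S_{n+1} − e^{−x})` is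
`(−1)^n(S_n − e^{−x}) ≥ 0` and the function vanishes at `0`. [folklore] -/
private theorem expNegTaylor_alternating (n : ℕ) {x : ℝ} (hx : 0 ≤ x) :
    0 ≤ (-1) ^ n * (expNegTaylor n x - Real.exp (-x)) := by
  induction n generalizing x with
  | zero =>
    have h1 : Real.exp (-x) ≤ 1 := Real.exp_le_one_iff.mpr (by linarith)
    simp only [expNegTaylor, zero_add, Finset.sum_range_one, pow_zero, Nat.factorial_zero, Nat.cast_one,
      div_one, one_mul]
    linarith
  | succ n ih =>
    set D : ℝ → ℝ := fun y => (-1) ^ (n + 1) * (expNegTaylor (n + 1) y - Real.exp (-y)) with hDdef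
    have hD : ∀ y, HasDerivAt D ((-1) ^ n * (expNegTaylor n y - Real.exp (-y))) y := by
      intro y
      have h1 := (hasDerivAt_expNegTaylor_succ n y).sub ((hasDerivAt_neg y).exp)
      have h2 := h1.const_mul ((-1 : ℝ) ^ (n + 1))
      refine h2.congr_deriv ?_
      ring
    have hmono : MonotoneOn D (Ici 0) :=
      monotoneOn_of_deriv_nonneg (convex_Ici 0) (fun y _ => (hD y).continuousAt.continuousWithinAt)
        (fun y _ => (hD y).differentiableAt.differentiableWithinAt) fun y hy => by
          rw [(hD y).deriv]
          rw [interior_Ici] at hy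
          exact ih (le_of_lt hy)
    have h0 : D 0 = 0 := by
      simp only [hDdef, expNegTaylor_zero_right, neg_zero, Real.exp_zero, sub_self, mul_zero]
    have h := hmono (self_mem_Ici (a := (0 : ℝ))) (mem_Ici.2 hx) hx
    rw [h0] at h
    exact h

/-- Even partial sums are upper bounds: `e^{−x} ≤ S_{2k}(x)` for `x ≥ 0`. [folklore] -/
private theorem exp_neg_le_expNegTaylor {n : ℕ} (hn : Even n) {x : ℝ} (hx : 0 ≤ x) :
    Real.exp (-x) ≤ expNegTaylor n x := by
  have h := expNegTaylor_alternating n hx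
  rw [hn.neg_one_pow, one_mul] at h
  linarith

/-- Odd partial sums are lower bounds: `S_{2k+1}(x) ≤ e^{−x}` for `x ≥ 0`. [folklore] -/
private theorem expNegTaylor_le_exp_neg {n : ℕ} (hn : Odd n) {x : ℝ} (hx : 0 ≤ x) :
    expNegTaylor n x ≤ Real.exp (-x) := by
  have h := expNegTaylor_alternating n hx
  rw [hn.neg_one_pow, neg_one_mul] at h
  linarith


/-! ## The explicit admissible kernel `K_β(t) = exp(−t² − t⁴/1000)·(1 + t²/20 + 17t⁴/8000)` -/

namespace ExplicitKernel

/-- The polynomial factor `P_β(s) = 1 + s/20 + 17s²/8000` (variable `s = t²`). [folklore] -/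
def Pb (s : ℝ) : ℝ := 1 + s / 20 + 17 / 8000 * s ^ 2

/-- `P_β′(s) = 1/20 + 34s/8000`. [folklore] -/
def Pb' (s : ℝ) : ℝ := 1 / 20 + 34 / 8000 * s

/-- **The explicit kernel of the cell bus** (rh-jensen STATUS 2026-08-26T06:27:25Z F2, the `K_β` of
the referee sheet DLREF-1): `K_β(t) = exp(−t² − t⁴/1000)·(1 + t²/20 + 17t⁴/8000)` — ONE fully pinned
member of Dimitrov–Lucas' admissible class ((i)–(v) of Definition 1, with an entire extension and
`δ = 1`) satisfying (8) with margin `(log K_β(√s))″ ≤ −1/4000`. [cite: DimitrovLucas2011, Definition 1] -/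
def Kb (t : ℝ) : ℝ := Real.exp (-t ^ 2 - 1 / 1000 * t ^ 4) * Pb (t ^ 2)

/-- `K_β` is the member `ε = 1/1000` of a Gaussian-times-quartic family: in the notation of the
witness family, `K_β(t) = exp(g_{1/1000}(t))·P_β(t²)`. [folklore] -/
private theorem Pb_pos (s : ℝ) : 0 < Pb s := by
  rw [Pb]; nlinarith [sq_nonneg (s + 20)]

/-- `P_β(s) ≥ 1` for `s ≥ 0`. [folklore] -/
private theorem one_le_Pb {s : ℝ} (hs : 0 ≤ s) : 1 ≤ Pb s := by
  rw [Pb]; nlinarith [sq_nonneg s]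

/-- `P_β` has derivative `P_β′`. [folklore] -/
private theorem hasDerivAt_Pb (s : ℝ) : HasDerivAt Pb (Pb' s) s := by
  have h := (((hasDerivAt_id' s).div_const (20 : ℝ)).const_add (1 : ℝ)).fun_add
    ((hasDerivAt_pow 2 s).const_mul (17 / 8000 : ℝ))
  refine h.congr_deriv ?_
  simp [Pb']
  ring

/-- `P_β′` has derivative `P_β″ = 34/8000`. [folklore] -/
private theorem hasDerivAt_Pb' (s : ℝ) : HasDerivAt Pb' (34 / 8000 : ℝ) s := by
  have h := ((hasDerivAt_id' s).const_mul (34 / 8000 : ℝ)).const_add (1 / 20 : ℝ)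
  refine h.congr_deriv ?_
  simp

/-- (i) `K_β > 0`. [cite: DimitrovLucas2011, Definition 1 (i)] -/
theorem Kb_pos (t : ℝ) : 0 < Kb t := mul_pos (Real.exp_pos _) (Pb_pos _)

/-- (iii) `K_β` is even. [cite: DimitrovLucas2011, Definition 1 (iii)] -/
theorem Kb_even (t : ℝ) : Kb (-t) = Kb t := by
  simp only [Kb, even_two.neg_pow, show (-t) ^ 4 = t ^ 4 by ring]

/-- The derivative `K_β′(t) = −2t·e^{−t²−t⁴/1000}·[(1 + t²/500)P_β(t²) − P_β′(t²)]`. [folklore] -/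
def dKb (t : ℝ) : ℝ :=
  -(2 * t * Real.exp (-t ^ 2 - 1 / 1000 * t ^ 4) * ((1 + 2 * (1 / 1000) * t ^ 2) * Pb (t ^ 2) - Pb' (t ^ 2)))

/-- `K_β` has derivative `dKb`. [folklore] -/
private theorem hasDerivAt_Kb (t : ℝ) : HasDerivAt Kb (dKb t) t := by
  have h1 : HasDerivAt (fun t : ℝ => -t ^ 2 - 1 / 1000 * t ^ 4) (-(2 * t) - 1 / 1000 * (4 * t ^ 3)) t := by
    have h := ((hasDerivAt_pow 2 t).fun_neg).fun_sub ((hasDerivAt_pow 4 t).const_mul (1 / 1000 : ℝ))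
    refine h.congr_deriv ?_
    simp
  have h2 : HasDerivAt (fun t : ℝ => Pb (t ^ 2)) (Pb' (t ^ 2) * (2 * t)) t := by
    have h := (hasDerivAt_Pb (t ^ 2)).comp t (hasDerivAt_pow 2 t)
    refine h.congr_deriv ?_
    simp
  have h := (h1.exp).fun_mul h2
  refine h.congr_deriv ?_
  rw [dKb]
  ring

/-- `deriv K_β = dKb`. [folklore] -/
private theorem deriv_Kb : deriv Kb = dKb := funext fun t => (hasDerivAt_Kb t).deriv

/-- `K_β` is continuous. [folklore] -/
private theorem continuous_Kb : Continuous Kb := by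
  unfold Kb Pb; fun_prop

/-- (iv), the bracket: `(1 + s/500)P_β(s) − P_β′(s) = 19/20 + 191s/4000 + 89s²/40000 + 17s³/(4·10⁶)
≥ 19/20` for `s ≥ 0` (the referees' exact margin). [cite: DimitrovLucas2011, Definition 1 (iv)] -/
private theorem bracket_Kb {s : ℝ} (hs : 0 ≤ s) :
    19 / 20 ≤ (1 + 2 * (1 / 1000) * s) * Pb s - Pb' s := by
  have e : (1 + 2 * (1 / 1000) * s) * Pb s - Pb' s =
      19 / 20 + 191 / 4000 * s + 89 / 40000 * s ^ 2 + 17 / 4000000 * s ^ 3 := by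
    rw [Pb, Pb']; ring
  rw [e]
  have : 0 ≤ 191 / 4000 * s + 89 / 40000 * s ^ 2 + 17 / 4000000 * s ^ 3 := by positivity
  linarith

/-- (iv) `K_β′(t) < 0` for `t > 0`. [cite: DimitrovLucas2011, Definition 1 (iv)] -/
theorem deriv_Kb_neg {t : ℝ} (ht : 0 < t) : deriv Kb t < 0 := by
  rw [deriv_Kb, dKb, neg_lt_zero]
  have hb := bracket_Kb (sq_nonneg t)
  have : 0 < (1 + 2 * (1 / 1000) * t ^ 2) * Pb (t ^ 2) - Pb' (t ^ 2) := by linarith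
  positivity

/-- The logarithmic derivative in the tree's shape: `−K_β′(t)/(tK_β(t)) = 2(1 + t²/500) −
2P_β′(t²)/P_β(t²)` for `t > 0`. [folklore] -/
private theorem neg_deriv_Kb_div {t : ℝ} (ht : 0 < t) :
    -deriv Kb t / (t * Kb t) = 2 * (1 + 2 * (1 / 1000) * t ^ 2) - 2 * Pb' (t ^ 2) / Pb (t ^ 2) := by
  rw [deriv_Kb, dKb, Kb]
  have hP := (Pb_pos (t ^ 2)).ne'
  have hE := (Real.exp_pos (-t ^ 2 - 1 / 1000 * t ^ 4)).ne'
  have ht' := ht.ne'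
  field_simp

/-- The key inequality behind (8) for `K_β`: for `0 ≤ a < b`,
`P_β′(b)P_β(a) − P_β′(a)P_β(b) = (b − a)·[7/4000 − (17/160000)(a + b) − 2(17/8000)²ab] ≤ (7/4000)(b − a)`
— here `2·(17/8000) > (1/20)²`, so `P_β′/P_β` is NOT decreasing near `0` and the quartic term
`−t⁴/1000` is what makes `log K_β(√s)` concave (margin `4/1000 − 2·7/4000 = 1/2000` in the
derivative of `−K_β′/(tK_β)`). [folklore] -/
private theorem Pb'_mul_sub_le {a b : ℝ} (ha : 0 ≤ a) (hab : a ≤ b) :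
    Pb' b * Pb a - Pb' a * Pb b ≤ 7 / 4000 * (b - a) := by
  have e : Pb' b * Pb a - Pb' a * Pb b =
      (b - a) * (7 / 4000 - 17 / 160000 * (a + b) - 2 * (17 / 8000) ^ 2 * (a * b)) := by
    rw [Pb, Pb, Pb', Pb']; ring
  rw [e]
  have hb : 0 ≤ b := ha.trans hab
  have h1 : 0 ≤ b - a := sub_nonneg.2 hab
  have h2 : 0 ≤ 17 / 160000 * (a + b) + 2 * (17 / 8000) ^ 2 * (a * b) := by positivity
  nlinarith

/-- **(8) in the tree's shape for `K_β`**: `t ↦ −K_β′(t)/(tK_β(t))` is strictly increasing on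
`(0, ∞)` (compare `Literature.NumberTheory.LFunctions.DeBruijnPhiLogConcaveSqrt`).
[cite: DimitrovLucas2011, (8) and the remark after Theorem B] -/
theorem strictMonoOn_neg_deriv_Kb_div :
    StrictMonoOn (fun t : ℝ => -deriv Kb t / (t * Kb t)) (Ioi 0) := by
  intro a ha b hb hab
  have ha' : 0 < a := ha
  have hb' : 0 < b := hb
  show -deriv Kb a / (a * Kb a) < -deriv Kb b / (b * Kb b)
  rw [neg_deriv_Kb_div ha', neg_deriv_Kb_div hb']
  have hab2 : a ^ 2 < b ^ 2 := by nlinarith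
  have hPa := Pb_pos (a ^ 2)
  have hPb := Pb_pos (b ^ 2)
  have h1a := one_le_Pb (sq_nonneg a)
  have h1b := one_le_Pb (sq_nonneg b)
  have hkey := Pb'_mul_sub_le (sq_nonneg a) hab2.le
  -- `2P′(b²)/P(b²) − 2P′(a²)/P(a²) = 2(P′(b²)P(a²) − P′(a²)P(b²))/(P(a²)P(b²)) ≤ 2·(7/4000)(b² − a²)`
  have hdiff : 2 * Pb' (b ^ 2) / Pb (b ^ 2) - 2 * Pb' (a ^ 2) / Pb (a ^ 2) ≤
      2 * (7 / 4000) * (b ^ 2 - a ^ 2) := by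
    rw [div_sub_div _ _ hPb.ne' hPa.ne', div_le_iff₀ (mul_pos hPb hPa)]
    have h3 : 1 ≤ Pb (b ^ 2) * Pb (a ^ 2) := by nlinarith
    have h4 : 0 ≤ b ^ 2 - a ^ 2 := by nlinarith
    nlinarith
  nlinarith

/-- `log K_β(√s) = −s − s²/1000 + log P_β(s)` for `s ≥ 0`. [cite: DimitrovLucas2011, (8)] -/
theorem log_Kb_sqrt {s : ℝ} (hs : 0 ≤ s) :
    Real.log (Kb (Real.sqrt s)) = -s - 1 / 1000 * s ^ 2 + Real.log (Pb s) := by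
  have h4 : Real.sqrt s ^ 4 = s ^ 2 := by
    rw [show (4 : ℕ) = 2 * 2 from rfl, pow_mul, Real.sq_sqrt hs]
  rw [Kb, Real.log_mul (Real.exp_pos _).ne' (Pb_pos _).ne', Real.log_exp, Real.sq_sqrt hs, h4]

/-- First derivative of the smooth model `−s − s²/1000 + log P_β(s)`. [folklore] -/
private theorem hasDerivAt_logModel_b (s : ℝ) :
    HasDerivAt (fun s : ℝ => -s - 1 / 1000 * s ^ 2 + Real.log (Pb s))
      (-1 - 1 / 1000 * (2 * s) + Pb' s / Pb s) s := by
  have h1 : HasDerivAt (fun s : ℝ => -s - 1 / 1000 * s ^ 2) (-1 - 1 / 1000 * (2 * s)) s := by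
    have h := ((hasDerivAt_id' s).fun_neg).fun_sub ((hasDerivAt_pow 2 s).const_mul (1 / 1000 : ℝ))
    refine h.congr_deriv ?_
    simp
  exact h1.fun_add ((hasDerivAt_Pb s).log (Pb_pos s).ne')

/-- Second derivative of the model: `−2/1000 + (P_β″P_β − P_β′²)/P_β²`. [folklore] -/
private theorem hasDerivAt_logModel_b_deriv (s : ℝ) :
    HasDerivAt (fun s : ℝ => -1 - 1 / 1000 * (2 * s) + Pb' s / Pb s)
      (-(1 / 1000 * 2) + (34 / 8000 * Pb s - Pb' s * Pb' s) / Pb s ^ 2) s := by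
  have h1 : HasDerivAt (fun s : ℝ => -1 - 1 / 1000 * (2 * s)) (-(1 / 1000 * 2)) s := by
    have h := (((hasDerivAt_id' s).const_mul (2 : ℝ)).const_mul (1 / 1000 : ℝ)).const_sub (-1 : ℝ)
    refine h.congr_deriv ?_
    simp
  exact h1.fun_add ((hasDerivAt_Pb' s).fun_div (hasDerivAt_Pb s) (Pb_pos s).ne')

/-- **(8) literally for `K_β`, with the referees' margin**: `(d²/ds²) log K_β(√s) ≤ −1/4000 < 0` for
every `s > 0`; indeed `P_β″P_β − P_β′² = 7/4000 − 17s/80000 − 289s²/(32·10⁶) ≤ 7/4000 ≤ (7/4000)P_β²`.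
[cite: DimitrovLucas2011, (8)] -/
theorem deriv2_log_Kb_sqrt_le {s : ℝ} (hs : 0 < s) :
    deriv^[2] (fun s : ℝ => Real.log (Kb (Real.sqrt s))) s ≤ -(1 / 4000) := by
  have hloc : (fun s : ℝ => Real.log (Kb (Real.sqrt s))) =ᶠ[𝓝 s]
      fun s : ℝ => -s - 1 / 1000 * s ^ 2 + Real.log (Pb s) := by
    filter_upwards [Ioi_mem_nhds hs] with x hx using log_Kb_sqrt hx.le
  have hd1 : deriv (fun s : ℝ => Real.log (Kb (Real.sqrt s))) =ᶠ[𝓝 s]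
      fun s : ℝ => -1 - 1 / 1000 * (2 * s) + Pb' s / Pb s := by
    refine hloc.eventually_nhds.mono fun x hx => ?_
    have hx' : (fun s : ℝ => Real.log (Kb (Real.sqrt s))) =ᶠ[𝓝 x]
        fun s : ℝ => -s - 1 / 1000 * s ^ 2 + Real.log (Pb s) := hx
    rw [hx'.deriv_eq]
    exact (hasDerivAt_logModel_b x).deriv
  show deriv (deriv fun s : ℝ => Real.log (Kb (Real.sqrt s))) s ≤ -(1 / 4000)
  rw [hd1.deriv_eq, (hasDerivAt_logModel_b_deriv s).deriv]
  have hP := Pb_pos s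
  have h1 := one_le_Pb hs.le
  have hnum : 34 / 8000 * Pb s - Pb' s * Pb' s ≤ 7 / 4000 * Pb s ^ 2 := by
    have e : 34 / 8000 * Pb s - Pb' s * Pb' s = 7 / 4000 - 17 / 80000 * s - 289 / 32000000 * s ^ 2 := by
      rw [Pb, Pb']; ring
    rw [e]
    nlinarith
  have : (34 / 8000 * Pb s - Pb' s * Pb' s) / Pb s ^ 2 ≤ 7 / 4000 := by
    rw [div_le_iff₀ (by positivity)]; exact hnum
  linarith

/-- (8): `(d²/ds²) log K_β(√s) < 0` for `s > 0`. [cite: DimitrovLucas2011, (8)] -/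
theorem deriv2_log_Kb_sqrt_neg {s : ℝ} (hs : 0 < s) :
    deriv^[2] (fun s : ℝ => Real.log (Kb (Real.sqrt s))) s < 0 :=
  lt_of_le_of_lt (deriv2_log_Kb_sqrt_le hs) (by norm_num)

/-! ### (ii) entire extension and (v) decay of all derivatives -/

/-- The entire function `exp(−z² − z⁴/1000)(1 + z²/20 + 17z⁴/8000)` extending `K_β`.
[cite: DimitrovLucas2011, Definition 1 (ii)] -/
def KbC (z : ℂ) : ℂ :=
  Complex.exp (-z ^ 2 - 1 / 1000 * z ^ 4) * (1 + z ^ 2 / 20 + 17 / 8000 * (z ^ 2) ^ 2)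

/-- (ii) `KbC` is entire. [cite: DimitrovLucas2011, Definition 1 (ii)] -/
theorem differentiable_KbC : Differentiable ℂ KbC := by
  unfold KbC
  fun_prop

/-- (ii) `KbC` restricts to `K_β` on `ℝ`. [cite: DimitrovLucas2011, Definition 1 (ii)] -/
theorem KbC_ofReal (t : ℝ) : KbC (t : ℂ) = ((Kb t : ℝ) : ℂ) := by
  simp only [KbC, Kb, Pb]
  push_cast
  ring

/-- The quartic `P_β(X²) = 1 + X²/20 + 17X⁴/8000` as a polynomial. [folklore] -/
def pbPoly : ℝ[X] := 1 + C (1 / 20) * X ^ 2 + C (17 / 8000) * X ^ 4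

/-- `K_β(t) = P_β(t²)·exp(g_{1/1000}(t))` with the exponent polynomial `gPoly` of the witness family.
[folklore] -/
private theorem Kb_eq_eval (t : ℝ) : Kb t = pbPoly.eval t * Real.exp ((gPoly (1 / 1000)).eval t) := by
  simp only [Kb, Pb, gPoly, pbPoly, eval_add, eval_sub, eval_neg, eval_mul, eval_pow, eval_C, eval_X,
    eval_one]
  ring_nf

/-- Every derivative of `K_β` is `Q_n(t)·e^{−t²−t⁴/1000}` with `Q_n` a real polynomial.
[cite: DimitrovLucas2011, Definition 1 (v)] -/
theorem exists_iteratedDeriv_Kb_eq (n : ℕ) :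
    ∃ Q : ℝ[X], iteratedDeriv n Kb = fun t => Q.eval t * Real.exp ((gPoly (1 / 1000)).eval t) := by
  induction n with
  | zero => exact ⟨pbPoly, by rw [iteratedDeriv_zero]; funext t; exact Kb_eq_eval t⟩
  | succ n ih =>
    obtain ⟨Q, hQ⟩ := ih
    refine ⟨derivative Q + Q * derivative (gPoly (1 / 1000)), ?_⟩
    rw [iteratedDeriv_succ, hQ]
    funext t
    exact (hasDerivAt_eval_mul_exp Q (gPoly (1 / 1000)) t).deriv

/-- **(v) for `K_β`**: every derivative is `O(e^{−t³})` at `+∞`. [cite: DimitrovLucas2011, Definition 1 (v)] -/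
theorem iteratedDeriv_Kb_isBigO (n : ℕ) :
    iteratedDeriv n Kb =O[atTop] fun t : ℝ => Real.exp (-t ^ 3) := by
  obtain ⟨Q, hQ⟩ := exists_iteratedDeriv_Kb_eq n
  rw [hQ]
  exact eval_mul_exp_isBigO (by norm_num) Q

/-- (v) in the printed shape `K_β^{(n)}(t) = O(exp(−|t|^{2+δ}))`, `δ = 1`. [cite: DimitrovLucas2011, Definition 1 (v)] -/
theorem iteratedDeriv_Kb_isBigO_rpow (n : ℕ) :
    iteratedDeriv n Kb =O[atTop] fun t : ℝ => Real.exp (-|t| ^ ((2 : ℝ) + 1)) := by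
  refine (iteratedDeriv_Kb_isBigO n).congr' Filter.EventuallyEq.rfl ?_
  filter_upwards [eventually_ge_atTop (0 : ℝ)] with t ht
  rw [abs_of_nonneg ht, show (2 : ℝ) + 1 = ((3 : ℕ) : ℝ) by norm_num, Real.rpow_natCast]

/-- **`K_β` is admissible with (8)**: every hypothesis of Dimitrov–Lucas' Theorem 1 as typed in
`not_dimitrovLucas2011_theorem1` ((i) positive; (ii) an entire extension; (iii) even; (iv) `K′ < 0` on
`(0,∞)`; (v) all derivatives `O(exp(−|t|³))`; (8) `(log K(√s))″ < 0`), plus the tree's monotone shape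
of (8). [cite: DimitrovLucas2011, Definition 1 and (8)] -/
theorem Kb_admissible :
    (∀ t, 0 < Kb t) ∧ (∃ F : ℂ → ℂ, Differentiable ℂ F ∧ ∀ t : ℝ, F t = Kb t) ∧ (∀ t, Kb (-t) = Kb t) ∧
      (∀ t, 0 < t → deriv Kb t < 0) ∧
      (∃ δ : ℝ, 0 < δ ∧ ∀ n : ℕ, iteratedDeriv n Kb =O[atTop] fun t => Real.exp (-|t| ^ (2 + δ))) ∧
      (∀ s, 0 < s → deriv^[2] (fun s => Real.log (Kb (Real.sqrt s))) s < 0) ∧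
      StrictMonoOn (fun t => -deriv Kb t / (t * Kb t)) (Ioi 0) :=
  ⟨Kb_pos, ⟨KbC, differentiable_KbC, KbC_ofReal⟩, Kb_even, fun _ ht => deriv_Kb_neg ht,
    ⟨1, one_pos, iteratedDeriv_Kb_isBigO_rpow⟩, fun _ hs => deriv2_log_Kb_sqrt_neg hs,
    strictMonoOn_neg_deriv_Kb_div⟩

end ExplicitKernel


namespace ExplicitKernel

/-! ### The moments of `K_β`: a Taylor-model sandwich with exact Gaussian moments -/

/-- `g(k) = 4^{−k}(2k)!/k! = (2k−1)‼/2^k`, so that `∫₀^∞ t^{2k}e^{−t²} dt = Γ(k+½)/2 = (√π/2)·g(k)`.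
[folklore] -/
def gHalf (k : ℕ) : ℝ := (1 / 4) ^ k * ((2 * k)! : ℝ) / (k ! : ℝ)

/-- Gaussian moments in closed form: `∫₀^∞ t^{2k}e^{−t²} dt = (√π/2)·g(k)`. [folklore] -/
private theorem integral_gauss_moment (k : ℕ) :
    ∫ t in Ioi (0 : ℝ), Real.exp (-t ^ 2) * t ^ (2 * k) = Real.sqrt π / 2 * gHalf k := by
  rw [integral_exp_neg_sq_mul_pow, gHalf]
  have h := factorial_div_mul_Gamma_half k
  have hk : (k ! : ℝ) ≠ 0 := by positivity
  have h2k : ((2 * k)! : ℝ) ≠ 0 := by positivity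
  calc Real.Gamma (k + 1 / 2) / 2
      = ((2 * k)! : ℝ) / (k ! : ℝ) * ((k ! : ℝ) / ((2 * k)! : ℝ) * (Real.Gamma (k + 1 / 2) / 2)) := by
        field_simp
    _ = Real.sqrt π / 2 * ((1 / 4) ^ k * ((2 * k)! : ℝ) / (k ! : ℝ)) := by rw [h]; ring

/-- The Taylor-model moment sums: `S_N(m) = Σ_{j ≤ N} ((−1/1000)^j/j!)·[g(m+2j) + g(m+2j+1)/20 +
17g(m+2j+2)/8000]`, i.e. `(2/√π)·∫₀^∞ t^{2m}e^{−t²}S_N(t⁴/1000)P_β(t²) dt`. [folklore] -/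
def taylorMomentSum (N m : ℕ) : ℝ :=
  ∑ j ∈ Finset.range (N + 1), (-(1 / 1000 : ℝ)) ^ j / (j ! : ℝ) *
    (gHalf (m + 2 * j) + gHalf (m + 2 * j + 1) / 20 + 17 / 8000 * gHalf (m + 2 * j + 2))

/-- Pointwise expansion of the Taylor-model integrand into Gaussian monomials. [folklore] -/
private theorem taylorIntegrand_eq (N m : ℕ) (t : ℝ) :
    Real.exp (-t ^ 2) * (expNegTaylor N (1 / 1000 * t ^ 4) * Pb (t ^ 2) * t ^ (2 * m)) =
      ∑ j ∈ Finset.range (N + 1), (-(1 / 1000 : ℝ)) ^ j / (j ! : ℝ) *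
        (Real.exp (-t ^ 2) * t ^ (2 * (m + 2 * j)) + Real.exp (-t ^ 2) * t ^ (2 * (m + 2 * j + 1)) / 20 +
          17 / 8000 * (Real.exp (-t ^ 2) * t ^ (2 * (m + 2 * j + 2)))) := by
  rw [expNegTaylor, Finset.sum_mul, Finset.sum_mul, Finset.mul_sum]
  refine Finset.sum_congr rfl fun j _ => ?_
  rw [Pb, show -(1 / 1000 * t ^ 4) = -(1 / 1000 : ℝ) * t ^ 4 by ring, mul_pow, ← pow_mul]
  ring

/-- Each Gaussian monomial group is integrable on `(0,∞)`. [folklore] -/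
private theorem integrableOn_taylor_term (m j : ℕ) :
    IntegrableOn (fun t : ℝ => (-(1 / 1000 : ℝ)) ^ j / (j ! : ℝ) *
      (Real.exp (-t ^ 2) * t ^ (2 * (m + 2 * j)) + Real.exp (-t ^ 2) * t ^ (2 * (m + 2 * j + 1)) / 20 +
        17 / 8000 * (Real.exp (-t ^ 2) * t ^ (2 * (m + 2 * j + 2))))) (Ioi 0) :=
  (((integrableOn_exp_neg_sq_mul_pow _).add ((integrableOn_exp_neg_sq_mul_pow _).div_const _)).add
    ((integrableOn_exp_neg_sq_mul_pow _).const_mul _)).const_mul _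

/-- The Taylor-model integrand is integrable on `(0,∞)`. [folklore] -/
private theorem integrableOn_taylorIntegrand (N m : ℕ) :
    IntegrableOn (fun t : ℝ => Real.exp (-t ^ 2) * (expNegTaylor N (1 / 1000 * t ^ 4) * Pb (t ^ 2) * t ^ (2 * m)))
      (Ioi 0) := by
  simp_rw [taylorIntegrand_eq]
  exact integrable_finsetSum _ fun j _ => integrableOn_taylor_term m j

/-- **Exact integration of the Taylor model**: `∫₀^∞ t^{2m}e^{−t²}S_N(t⁴/1000)P_β(t²) dt =
(√π/2)·S_N(m)`. [folklore] -/
private theorem integral_taylorIntegrand (N m : ℕ) :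
    ∫ t in Ioi (0 : ℝ), Real.exp (-t ^ 2) * (expNegTaylor N (1 / 1000 * t ^ 4) * Pb (t ^ 2) * t ^ (2 * m)) =
      Real.sqrt π / 2 * taylorMomentSum N m := by
  simp_rw [taylorIntegrand_eq]
  rw [integral_finsetSum _ fun j _ => integrableOn_taylor_term m j, taylorMomentSum, Finset.mul_sum]
  refine Finset.sum_congr rfl fun j _ => ?_
  have hA := integrableOn_exp_neg_sq_mul_pow (m + 2 * j)
  have hB : IntegrableOn (fun t : ℝ => Real.exp (-t ^ 2) * t ^ (2 * (m + 2 * j + 1)) / 20) (Ioi 0) :=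
    (integrableOn_exp_neg_sq_mul_pow _).div_const _
  have hC : IntegrableOn (fun t : ℝ => 17 / 8000 * (Real.exp (-t ^ 2) * t ^ (2 * (m + 2 * j + 2)))) (Ioi 0) :=
    (integrableOn_exp_neg_sq_mul_pow _).const_mul _
  have hAB : IntegrableOn (fun t : ℝ => Real.exp (-t ^ 2) * t ^ (2 * (m + 2 * j)) +
      Real.exp (-t ^ 2) * t ^ (2 * (m + 2 * j + 1)) / 20) (Ioi 0) := hA.add hB
  rw [integral_const_mul, integral_add hAB hC, integral_add hA hB, integral_div,
    integral_const_mul, integral_gauss_moment, integral_gauss_moment, integral_gauss_moment]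
  ring

/-- `K_β(t)t^{2m} = e^{−t²}·[e^{−t⁴/1000}P_β(t²)t^{2m}]`. [folklore] -/
private theorem Kb_mul_pow_eq (m : ℕ) (t : ℝ) :
    Kb t * t ^ (2 * m) = Real.exp (-t ^ 2) * (Real.exp (-(1 / 1000 * t ^ 4)) * Pb (t ^ 2) * t ^ (2 * m)) := by
  rw [Kb, show -t ^ 2 - 1 / 1000 * t ^ 4 = -t ^ 2 + -(1 / 1000 * t ^ 4) by ring, Real.exp_add]
  ring

/-- Upper Taylor model: `K_β(t)t^{2m} ≤ e^{−t²}S_N(t⁴/1000)P_β(t²)t^{2m}` for even `N`. [folklore] -/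
private theorem Kb_mul_pow_le {N : ℕ} (hN : Even N) (m : ℕ) (t : ℝ) :
    Kb t * t ^ (2 * m) ≤
      Real.exp (-t ^ 2) * (expNegTaylor N (1 / 1000 * t ^ 4) * Pb (t ^ 2) * t ^ (2 * m)) := by
  rw [Kb_mul_pow_eq]
  have h1 := exp_neg_le_expNegTaylor hN (show (0 : ℝ) ≤ 1 / 1000 * t ^ 4 by positivity)
  have h2 : 0 ≤ Pb (t ^ 2) * t ^ (2 * m) := mul_nonneg (Pb_pos _).le (by rw [pow_mul]; positivity)
  have h3 : Real.exp (-(1 / 1000 * t ^ 4)) * Pb (t ^ 2) * t ^ (2 * m) ≤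
      expNegTaylor N (1 / 1000 * t ^ 4) * Pb (t ^ 2) * t ^ (2 * m) := by
    rw [mul_assoc, mul_assoc]
    exact mul_le_mul_of_nonneg_right h1 h2
  exact mul_le_mul_of_nonneg_left h3 (Real.exp_pos _).le

/-- Lower Taylor model: `e^{−t²}S_N(t⁴/1000)P_β(t²)t^{2m} ≤ K_β(t)t^{2m}` for odd `N`. [folklore] -/
private theorem le_Kb_mul_pow {N : ℕ} (hN : Odd N) (m : ℕ) (t : ℝ) :
    Real.exp (-t ^ 2) * (expNegTaylor N (1 / 1000 * t ^ 4) * Pb (t ^ 2) * t ^ (2 * m)) ≤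
      Kb t * t ^ (2 * m) := by
  rw [Kb_mul_pow_eq]
  have h1 := expNegTaylor_le_exp_neg hN (show (0 : ℝ) ≤ 1 / 1000 * t ^ 4 by positivity)
  have h2 : 0 ≤ Pb (t ^ 2) * t ^ (2 * m) := mul_nonneg (Pb_pos _).le (by rw [pow_mul]; positivity)
  have h3 : expNegTaylor N (1 / 1000 * t ^ 4) * Pb (t ^ 2) * t ^ (2 * m) ≤
      Real.exp (-(1 / 1000 * t ^ 4)) * Pb (t ^ 2) * t ^ (2 * m) := by
    rw [mul_assoc, mul_assoc]
    exact mul_le_mul_of_nonneg_right h1 h2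
  exact mul_le_mul_of_nonneg_left h3 (Real.exp_pos _).le

/-- The moments of `K_β` exist (domination by the `N = 0` model `e^{−t²}P_β(t²)t^{2m}`).
[cite: DimitrovLucas2011, p. 1015] -/
theorem integrableOn_Kb_mul_pow (m : ℕ) : IntegrableOn (fun t : ℝ => Kb t * t ^ (2 * m)) (Ioi 0) := by
  refine Integrable.mono' (integrableOn_taylorIntegrand 0 m)
    ((continuous_Kb.mul (continuous_pow _)).aestronglyMeasurable) ?_
  filter_upwards [ae_restrict_mem measurableSet_Ioi] with t ht
  rw [Real.norm_eq_abs, abs_of_nonneg (mul_nonneg (Kb_pos t).le (pow_nonneg (le_of_lt ht) _))]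
  exact Kb_mul_pow_le (by decide) m t

/-- **Upper enclosure of the moments**: `b_m(K_β) ≤ (√π/2)·S_6(m)`. [cite: DimitrovLucas2011, p. 1015] -/
theorem kernelMoment_Kb_le (m : ℕ) : kernelMoment Kb m ≤ Real.sqrt π / 2 * taylorMomentSum 6 m := by
  rw [kernelMoment, ← integral_taylorIntegrand]
  exact setIntegral_mono_on (integrableOn_Kb_mul_pow m) (integrableOn_taylorIntegrand 6 m)
    measurableSet_Ioi fun t _ => Kb_mul_pow_le (by decide) m t

/-- **Lower enclosure of the moments**: `(√π/2)·S_7(m) ≤ b_m(K_β)`. [cite: DimitrovLucas2011, p. 1015] -/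
theorem le_kernelMoment_Kb (m : ℕ) : Real.sqrt π / 2 * taylorMomentSum 7 m ≤ kernelMoment Kb m := by
  rw [kernelMoment, ← integral_taylorIntegrand]
  exact setIntegral_mono_on (integrableOn_taylorIntegrand 7 m) (integrableOn_Kb_mul_pow m)
    measurableSet_Ioi fun t _ => le_Kb_mul_pow (by decide) m t

/-! ### The rational certificate -/

/-- `S_6(0)` in closed form. [folklore] -/
private theorem taylorMomentSum_six_zero :
    taylorMomentSum 6 0 = 17209065040187683411762739 / 16777216000000000000000000 := by
  norm_num [taylorMomentSum, gHalf, Finset.sum_range_succ, Nat.factorial]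

end ExplicitKernel


namespace ExplicitKernel

/-- `S_6(1)` in closed form. [folklore] -/
private theorem taylorMomentSum_six_one :
    taylorMomentSum 6 1 = 18093830937991966813958791 / 33554432000000000000000000 := by
  norm_num [taylorMomentSum, gHalf, Finset.sum_range_succ, Nat.factorial]

/-- `S_6(2)` in closed form. [folklore] -/
private theorem taylorMomentSum_six_two :
    taylorMomentSum 6 2 = 57003950842564853196615321 / 67108864000000000000000000 := by
  norm_num [taylorMomentSum, gHalf, Finset.sum_range_succ, Nat.factorial]

/-- `S_6(3)` in closed form. [folklore] -/
private theorem taylorMomentSum_six_three :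
    taylorMomentSum 6 3 = 298870940435208326078636793 / 134217728000000000000000000 := by
  norm_num [taylorMomentSum, gHalf, Finset.sum_range_succ, Nat.factorial]

/-- `S_7(0)` in closed form. [folklore] -/
private theorem taylorMomentSum_seven_zero :
    taylorMomentSum 7 0 = 68836260160750351547660380097 / 67108864000000000000000000000 := by
  norm_num [taylorMomentSum, gHalf, Finset.sum_range_succ, Nat.factorial]

/-- `S_7(1)` in closed form. [folklore] -/
private theorem taylorMomentSum_seven_one :
    taylorMomentSum 7 1 = 72375323751956203425681789601 / 134217728000000000000000000000 := by
  norm_num [taylorMomentSum, gHalf, Finset.sum_range_succ, Nat.factorial]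

/-- `S_7(2)` in closed form. [folklore] -/
private theorem taylorMomentSum_seven_two :
    taylorMomentSum 7 2 = 45603160673975819971354405287 / 53687091200000000000000000000 := by
  norm_num [taylorMomentSum, gHalf, Finset.sum_range_succ, Nat.factorial]

/-- `S_7(3)` in closed form. [folklore] -/
private theorem taylorMomentSum_seven_three :
    taylorMomentSum 7 3 = 239096752345528575279160277859 / 107374182400000000000000000000 := by
  norm_num [taylorMomentSum, gHalf, Finset.sum_range_succ, Nat.factorial]

/-- Interval arithmetic for `H̃_1 = 20T_1T_2 − 3U_1²` (`T_1 = 3b_1² − b_0b_2`, `T_2 = 5b_2² − 3b_1b_3`,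
`U_1 = 5b_1b_2 − b_0b_3`), upper side: monotonicity in each moment on a box of positive moments where
`T_1, T_2, U_1 > 0`. [folklore] -/
private theorem dlHtilde_one_le_of_bounds {B : ℕ → ℝ} {l0 l1 l2 l3 h0 h1 h2 h3 : ℝ}
    (hl0 : l0 ≤ B 0) (hl1 : l1 ≤ B 1) (hl2 : l2 ≤ B 2) (hl3 : l3 ≤ B 3)
    (hh0 : B 0 ≤ h0) (hh1 : B 1 ≤ h1) (hh2 : B 2 ≤ h2) (hh3 : B 3 ≤ h3)
    (p0 : 0 ≤ l0) (p1 : 0 ≤ l1) (p2 : 0 ≤ l2) (p3 : 0 ≤ l3)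
    (hT1 : 0 ≤ 3 * l1 ^ 2 - h0 * h2) (hT2 : 0 ≤ 5 * l2 ^ 2 - 3 * (h1 * h3))
    (hU1 : 0 ≤ 5 * (l1 * l2) - h0 * h3) :
    dlHtilde B 1 ≤ 20 * ((3 * h1 ^ 2 - l0 * l2) * (5 * h2 ^ 2 - 3 * (l1 * l3))) -
      3 * (5 * (l1 * l2) - h0 * h3) ^ 2 := by
  have b0 : 0 ≤ B 0 := p0.trans hl0
  have b1 : 0 ≤ B 1 := p1.trans hl1
  have b2 : 0 ≤ B 2 := p2.trans hl2
  have b3 : 0 ≤ B 3 := p3.trans hl3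
  have e : dlHtilde B 1 = 20 * ((3 * B 1 ^ 2 - B 0 * B 2) * (5 * B 2 ^ 2 - 3 * (B 1 * B 3))) -
      3 * (5 * (B 1 * B 2) - B 0 * B 3) ^ 2 := by
    simp only [dlHtilde, Nat.cast_one, Nat.sub_self]
    ring
  have hT1u : 3 * B 1 ^ 2 - B 0 * B 2 ≤ 3 * h1 ^ 2 - l0 * l2 := by
    linarith [mul_le_mul hl0 hl2 p2 b0, pow_le_pow_left₀ b1 hh1 2]
  have hT1l : 3 * l1 ^ 2 - h0 * h2 ≤ 3 * B 1 ^ 2 - B 0 * B 2 := by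
    linarith [mul_le_mul hh0 hh2 b2 (b0.trans hh0), pow_le_pow_left₀ p1 hl1 2]
  have hT2u : 5 * B 2 ^ 2 - 3 * (B 1 * B 3) ≤ 5 * h2 ^ 2 - 3 * (l1 * l3) := by
    linarith [mul_le_mul hl1 hl3 p3 b1, pow_le_pow_left₀ b2 hh2 2]
  have hT2l : 5 * l2 ^ 2 - 3 * (h1 * h3) ≤ 5 * B 2 ^ 2 - 3 * (B 1 * B 3) := by
    linarith [mul_le_mul hh1 hh3 b3 (b1.trans hh1), pow_le_pow_left₀ p2 hl2 2]
  have hU1l : 5 * (l1 * l2) - h0 * h3 ≤ 5 * (B 1 * B 2) - B 0 * B 3 := by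
    linarith [mul_le_mul hl1 hl2 p2 b1, mul_le_mul hh0 hh3 b3 (b0.trans hh0)]
  have hprod : (3 * B 1 ^ 2 - B 0 * B 2) * (5 * B 2 ^ 2 - 3 * (B 1 * B 3)) ≤
      (3 * h1 ^ 2 - l0 * l2) * (5 * h2 ^ 2 - 3 * (l1 * l3)) :=
    mul_le_mul hT1u hT2u (hT2.trans hT2l) (hT1.trans (hT1l.trans hT1u))
  have hsq : (5 * (l1 * l2) - h0 * h3) ^ 2 ≤ (5 * (B 1 * B 2) - B 0 * B 3) ^ 2 :=
    pow_le_pow_left₀ hU1 hU1l 2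
  rw [e]
  linarith

/-- Interval arithmetic for `H̃_1`, lower side. [folklore] -/
private theorem le_dlHtilde_one_of_bounds {B : ℕ → ℝ} {l0 l1 l2 l3 h0 h1 h2 h3 : ℝ}
    (hl0 : l0 ≤ B 0) (hl1 : l1 ≤ B 1) (hl2 : l2 ≤ B 2) (hl3 : l3 ≤ B 3)
    (hh0 : B 0 ≤ h0) (hh1 : B 1 ≤ h1) (hh2 : B 2 ≤ h2) (hh3 : B 3 ≤ h3)
    (p0 : 0 ≤ l0) (p1 : 0 ≤ l1) (p2 : 0 ≤ l2) (p3 : 0 ≤ l3)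
    (hT1 : 0 ≤ 3 * l1 ^ 2 - h0 * h2) (hT2 : 0 ≤ 5 * l2 ^ 2 - 3 * (h1 * h3))
    (hU1 : 0 ≤ 5 * (l1 * l2) - h0 * h3) :
    20 * ((3 * l1 ^ 2 - h0 * h2) * (5 * l2 ^ 2 - 3 * (h1 * h3))) -
        3 * (5 * (h1 * h2) - l0 * l3) ^ 2 ≤ dlHtilde B 1 := by
  have b0 : 0 ≤ B 0 := p0.trans hl0
  have b1 : 0 ≤ B 1 := p1.trans hl1
  have b2 : 0 ≤ B 2 := p2.trans hl2
  have b3 : 0 ≤ B 3 := p3.trans hl3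
  have e : dlHtilde B 1 = 20 * ((3 * B 1 ^ 2 - B 0 * B 2) * (5 * B 2 ^ 2 - 3 * (B 1 * B 3))) -
      3 * (5 * (B 1 * B 2) - B 0 * B 3) ^ 2 := by
    simp only [dlHtilde, Nat.cast_one, Nat.sub_self]
    ring
  have hT1l : 3 * l1 ^ 2 - h0 * h2 ≤ 3 * B 1 ^ 2 - B 0 * B 2 := by
    linarith [mul_le_mul hh0 hh2 b2 (b0.trans hh0), pow_le_pow_left₀ p1 hl1 2]
  have hT2l : 5 * l2 ^ 2 - 3 * (h1 * h3) ≤ 5 * B 2 ^ 2 - 3 * (B 1 * B 3) := by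
    linarith [mul_le_mul hh1 hh3 b3 (b1.trans hh1), pow_le_pow_left₀ p2 hl2 2]
  have hU1l : 5 * (l1 * l2) - h0 * h3 ≤ 5 * (B 1 * B 2) - B 0 * B 3 := by
    linarith [mul_le_mul hl1 hl2 p2 b1, mul_le_mul hh0 hh3 b3 (b0.trans hh0)]
  have hU1u : 5 * (B 1 * B 2) - B 0 * B 3 ≤ 5 * (h1 * h2) - l0 * l3 := by
    linarith [mul_le_mul hh1 hh2 b2 (b1.trans hh1), mul_le_mul hl0 hl3 p3 b0]
  have hprod : (3 * l1 ^ 2 - h0 * h2) * (5 * l2 ^ 2 - 3 * (h1 * h3)) ≤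
      (3 * B 1 ^ 2 - B 0 * B 2) * (5 * B 2 ^ 2 - 3 * (B 1 * B 3)) :=
    mul_le_mul hT1l hT2l hT2 (hT1.trans hT1l)
  have hsq : (5 * (B 1 * B 2) - B 0 * B 3) ^ 2 ≤ (5 * (h1 * h2) - l0 * l3) ^ 2 :=
    pow_le_pow_left₀ (hU1.trans hU1l) hU1u 2
  rw [e]
  linarith

/-- **The cell's headline number, kernel-certified** (rh-jensen STATUS 2026-08-26T06:27:25Z F2 and the
referee sheet DLREF-1: `H̃_1(K_β) = −1.1224861614·10⁻⁵` in full-line moments, `= −7.0155·10⁻⁷` in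
half-line moments, `= −1.1373162649·10⁻⁶·π²`): with the half-line moments `b_m = ∫₀^∞ t^{2m}K_β`,
`−1.13732·10⁻⁶·(π²/16) < H̃_1(K_β) < −1.13731·10⁻⁶·(π²/16)` — in particular `H̃_1(K_β) < 0`, a
counterexample to Theorem 1 at `k = 1` by an EXPLICIT admissible kernel. Certificate: the Taylor
sandwich `S_7(x) ≤ e^{−x} ≤ S_6(x)` (`x = t⁴/1000 ≥ 0`) integrated against `e^{−t²}P_β(t²)t^{2m}`
with the exact Gaussian moments `(√π/2)·4^{−k}(2k)!/k!`, then monotone interval arithmetic on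
`20T_1T_2 − 3U_1²`; all in exact rational arithmetic (`norm_num`), no floating point.
[cite: DimitrovLucas2011, Theorem 1 and (9)] -/
theorem dlHtilde_Kb_one_mem :
    π ^ 2 / 16 * -(113732 / 10 ^ 11) < dlHtilde (kernelMoment Kb) 1 ∧
      dlHtilde (kernelMoment Kb) 1 < π ^ 2 / 16 * -(113731 / 10 ^ 11) := by
  have hc : 0 < Real.sqrt π / 2 := by positivity
  set B : ℕ → ℝ := fun m => kernelMoment Kb m / (Real.sqrt π / 2) with hB
  have hK : kernelMoment Kb = fun m => Real.sqrt π / 2 * B m := by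
    funext m; simp only [hB]; field_simp
  have hlo : ∀ m, taylorMomentSum 7 m ≤ B m := fun m => by
    rw [hB, le_div_iff₀ hc, mul_comm]; exact le_kernelMoment_Kb m
  have hhi : ∀ m, B m ≤ taylorMomentSum 6 m := fun m => by
    rw [hB, div_le_iff₀ hc, mul_comm]; exact kernelMoment_Kb_le m
  have h4 : (Real.sqrt π / 2) ^ 4 = π ^ 2 / 16 := by
    rw [div_pow, show (4 : ℕ) = 2 * 2 from rfl, pow_mul, Real.sq_sqrt Real.pi_pos.le]; norm_num
  have l0 := hlo 0; have l1 := hlo 1; have l2 := hlo 2; have l3 := hlo 3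
  have u0 := hhi 0; have u1 := hhi 1; have u2 := hhi 2; have u3 := hhi 3
  rw [taylorMomentSum_seven_zero] at l0; rw [taylorMomentSum_seven_one] at l1
  rw [taylorMomentSum_seven_two] at l2; rw [taylorMomentSum_seven_three] at l3
  rw [taylorMomentSum_six_zero] at u0; rw [taylorMomentSum_six_one] at u1
  rw [taylorMomentSum_six_two] at u2; rw [taylorMomentSum_six_three] at u3
  have hup := dlHtilde_one_le_of_bounds l0 l1 l2 l3 u0 u1 u2 u3 (by norm_num) (by norm_num)
    (by norm_num) (by norm_num) (by norm_num) (by norm_num) (by norm_num)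
  have hdn := le_dlHtilde_one_of_bounds l0 l1 l2 l3 u0 u1 u2 u3 (by norm_num) (by norm_num)
    (by norm_num) (by norm_num) (by norm_num) (by norm_num) (by norm_num)
  rw [hK, dlHtilde_const_mul, h4]
  have hπ : 0 < π ^ 2 / 16 := by positivity
  constructor
  · refine mul_lt_mul_of_pos_left (lt_of_lt_of_le ?_ hdn) hπ
    norm_num
  · refine mul_lt_mul_of_pos_left (lt_of_le_of_lt hup ?_) hπ
    norm_num

/-- **`H̃_1(K_β) < 0`.** [cite: DimitrovLucas2011, Theorem 1 and (9)] -/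
theorem dlHtilde_Kb_one_neg : dlHtilde (kernelMoment Kb) 1 < 0 := by
  have h := dlHtilde_Kb_one_mem.2
  have : π ^ 2 / 16 * -(113731 / 10 ^ 11 : ℝ) < 0 :=
    mul_neg_of_pos_of_neg (by positivity) (by norm_num)
  linarith

/-- The same in the FULL-LINE moments `b_k = ∫_{−∞}^{∞} t^{2k}K_β` of Theorem 1 (`×16`):
`−1.13732·10⁻⁶·π² < H̃_1 < −1.13731·10⁻⁶·π²`, i.e. `H̃_1(K_β) = −1.12248(6±1)·10⁻⁵`, the number
quoted on the cell bus and in DLREF-1 (there to 30+ digits by three independent enclosures).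
[cite: DimitrovLucas2011, Theorem 1 and (9)] -/
theorem dlHtilde_Kb_one_fullLine_mem :
    π ^ 2 * -(113732 / 10 ^ 11) < dlHtilde (fun m => ∫ t, Kb t * t ^ (2 * m)) 1 ∧
      dlHtilde (fun m => ∫ t, Kb t * t ^ (2 * m)) 1 < π ^ 2 * -(113731 / 10 ^ 11) := by
  have e : (fun m => ∫ t, Kb t * t ^ (2 * m)) = fun m => 2 * kernelMoment Kb m :=
    funext (integral_even_mul_pow_eq Kb_even)
  rw [e, dlHtilde_const_mul]
  have h := dlHtilde_Kb_one_mem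
  constructor <;> nlinarith [h.1, h.2, Real.pi_pos]

/-- `b_3(K_β) > 0` (indeed `> 2.2267·(√π/2)`). [cite: DimitrovLucas2011, p. 1015] -/
theorem kernelMoment_Kb_pos_three : 0 < kernelMoment Kb 3 := by
  have h := le_kernelMoment_Kb 3
  rw [taylorMomentSum_seven_three] at h
  have : 0 < Real.sqrt π / 2 * (239096752345528575279160277859 / 107374182400000000000000000000 : ℝ) := by
    positivity
  linarith

/-- **Cell `(3,0)` of `K_β` is not hyperbolic**: `J^{3,0}` of `γ_m = m! b_m(K_β)/(2m)!` has non-real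
zeros (Lemma 1). [cite: DimitrovLucas2011, Lemma 1 and Theorem 1] -/
theorem not_splits_jensenPoly_Kb_three : ¬ (jensenPoly (kernelTaylorSeq Kb) 3 0).Splits := by
  refine not_splits_jensenPoly_three_of_dlHtilde_neg ?_ dlHtilde_Kb_one_neg
  rw [kernelTaylorSeq]
  have := kernelMoment_Kb_pos_three
  positivity

/-- **The barrier, witnessed by the EXPLICIT kernel `K_β`** (every clause of
`JensenPolynomialsLogConcaveKernel` for one pinned admissible kernel, no limiting argument):
a second, `ε`-free proof of `JensenPolynomialsLogConcaveKernel_holds` /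
`not_dimitrovLucas2011_theorem1`. [cite: DimitrovLucas2011, Theorem 1 (refuted as stated)] -/
theorem jensenPolynomialsLogConcaveKernel_of_Kb : JensenPolynomialsLogConcaveKernel := by
  obtain ⟨h1, h2, h3, h4, h5, h6, h7⟩ := Kb_admissible
  exact ⟨Kb, h1, h2, h3, h4, h5, h6, h7, dlHtilde_Kb_one_neg, not_splits_jensenPoly_Kb_three⟩

/-! ### The positive side for `K_β`: `T_1, T_2 > 0`, hence `J_1 < 0` -/

/-- `K_β` is smooth. [folklore] -/
private theorem contDiff_Kb {n : WithTop ℕ∞} : ContDiff ℝ n Kb := by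
  unfold Kb Pb
  fun_prop

/-- `K_β(t) ≤ 2e^{−t²/2}` (so `K_β` is integrable). [folklore] -/
private theorem Kb_le_gaussian (t : ℝ) : Kb t ≤ 2 * Real.exp (-t ^ 2 / 2) := by
  rw [Kb]
  have hP : Pb (t ^ 2) ≤ 2 * Real.exp (t ^ 2 / 2) := by
    have h2 : 1 + t ^ 2 / 2 + (t ^ 2 / 2) ^ 2 / 2 ≤ Real.exp (t ^ 2 / 2) :=
      Real.quadratic_le_exp_of_nonneg (by positivity)
    rw [Pb]; nlinarith [sq_nonneg t]
  have hE : Real.exp (-t ^ 2 - 1 / 1000 * t ^ 4) ≤ Real.exp (-t ^ 2) :=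
    Real.exp_le_exp.2 (by nlinarith [show (0:ℝ) ≤ t ^ 4 by positivity])
  calc Real.exp (-t ^ 2 - 1 / 1000 * t ^ 4) * Pb (t ^ 2)
      ≤ Real.exp (-t ^ 2) * (2 * Real.exp (t ^ 2 / 2)) :=
        mul_le_mul hE hP (Pb_pos _).le (Real.exp_pos _).le
    _ = 2 * Real.exp (-t ^ 2 / 2) := by
        have : Real.exp (-t ^ 2) * Real.exp (t ^ 2 / 2) = Real.exp (-t ^ 2 / 2) := by
          rw [← Real.exp_add]; ring_nf
        rw [← this]; ring

/-- `K_β` is integrable over `ℝ`. [folklore] -/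
private theorem integrable_Kb : Integrable Kb := by
  have hg : Integrable fun t : ℝ => 2 * Real.exp (-(1 / 2) * t ^ 2) :=
    (integrable_exp_neg_mul_sq (by norm_num : (0 : ℝ) < 1 / 2)).const_mul 2
  refine hg.mono' continuous_Kb.aestronglyMeasurable (Eventually.of_forall fun t => ?_)
  rw [Real.norm_eq_abs, abs_of_pos (Kb_pos t)]
  have h := Kb_le_gaussian t
  convert h using 3
  ring

/-- (v) at `n = 0` for `K_β`. [cite: DimitrovLucas2011, Definition 1 (v)] -/
theorem Kb_isBigO_rpow : Kb =O[atTop] fun t : ℝ => Real.exp (-|t| ^ ((2 : ℝ) + 1)) := by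
  simpa only [iteratedDeriv_zero] using iteratedDeriv_Kb_isBigO_rpow 0

/-- **Row 2 for `K_β`**: `T_k(K_β) > 0` for all `k ≥ 1` (the positive side
`dlT_pos_of_logConcaveSqrt`, i.e. Csordas–Varga's moment inequalities, for this kernel).
[cite: DimitrovLucas2011, (6) and Theorem A] -/
theorem dlT_Kb_pos {k : ℕ} (hk : 1 ≤ k) : 0 < dlT (kernelMoment Kb) k :=
  dlT_pos_of_logConcaveSqrt contDiff_Kb integrable_Kb Kb_pos ⟨1, one_pos, Kb_isBigO_rpow⟩
    (fun _ hs => deriv2_log_Kb_sqrt_neg hs) hk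

/-- **`J_1(K_β) < 0` and `H̃_1(K_β) < 8T_1T_2`** for the explicit kernel: the printed proof's
intermediate inequality `J_k > 0` (p. 1021) and its closing "stronger inequalities" both fail for
`K_β` at `k = 1` (`H̃_1 − 8T_1T_2 = 3J_1`, `dlHtilde_sub_eight_mul_dlT`).
[cite: DimitrovLucas2011, p. 1021] -/
theorem dlJ_Kb_one_neg :
    dlJ (kernelMoment Kb) 1 < 0 ∧ dlHtilde (kernelMoment Kb) 1 < 8 * (dlT (kernelMoment Kb) 1 *
      dlT (kernelMoment Kb) 2) := by
  have h := dlHtilde_sub_eight_mul_dlT (kernelMoment Kb) 1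
  have hH := dlHtilde_Kb_one_neg
  have hT : 0 < dlT (kernelMoment Kb) 1 * dlT (kernelMoment Kb) 2 :=
    mul_pos (dlT_Kb_pos le_rfl) (dlT_Kb_pos (by norm_num))
  norm_num at h
  constructor <;> nlinarith

end ExplicitKernel

end Literature.Barriers.RiemannHypothesis

end
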